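import Summits.HubbardSuperconductivity.HubbardSuperconductivity.Theses.ThermalWedge
import Literature.MathematicalPhysics.QuantumLattice.BdGBondHamiltonianTorus
import Literature.MathematicalPhysics.QuantumLattice.ApproximatingHamiltonianProofs
import Literature.MathematicalPhysics.QuantumLattice.DWaveSourceProofs
import Literature.MathematicalPhysics.QuantumLattice.LiebFluxPhaseProofs
import Literature.MathematicalPhysics.QuantumLattice.ApproximateEigenvectorLemmas
import Summits.HubbardSuperconductivity.HubbardSuperconductivity.Theorems.ThermalWedgeTwSourcedInertnessReduction
import Literature.MathematicalPhysics.QuantumLattice.DWaveSourceFreeGainBound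
import Literature.MathematicalPhysics.QuantumLattice.TorusCooperSum

/-!
# Disproof workfile for crux `TwSourcedCondensation` (item `stmt-HubbardSuperconductivity-1697`)

Standing disprover, generation 3 (`refuter-cdisprove-stmt-HubbardSuperconductivity-1697-g3-0`;
§1–§7 are generation 2's, §8–§9 are new). Everything below is `lean check`ed (rc 0, no `sorry`,
axioms `propext/Classical.choice/Quot.sound`); prose lives in docstrings only.
The crux (route `ThermalWedge`, rank 3):

  `∀ [μ₁,μ₂] ⊂ (-4,0) ∃ U₀ a c C h₀ > 0 ∀ U ∈ (0,U₀] ∀ β ∈ [1, e^{a/U}] ∀ μ ∈ [μ₁,μ₂] ∃ L₀ ∀ L ≥ L₀ ∀ |h| ≤ h₀ :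
     c h² log(1/(|h| + 1/β)) - C h² ≤ p̃_L(β,U,μ,h) - p̃_L(β,U,μ,0)`,
  `p̃_L = log Re Z_β(dWaveSourceTorus L U μ h) / (β L²)` (here: `pTilde`, `crux_iff` is `Iff.rfl`).

## Findings (index)

* §1–2 STRUCTURE OF THE RHS (all `L ≥ 1`, all `U, μ`, proved):
  - `W = i^N` (`gaugeW`, the constant `phaseGauge` by `i`) is a unitary with `W K₀ Wᴴ = K₀`,
    `W Δ_g Wᴴ = -Δ_g` (`gaugeW_conj_pairField`), hence `W H_{L,h} Wᴴ = H_{L,-h}`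
    (`gaugeW_conj_dWaveSourceTorus`);
  - EVENNESS `Z_β(H_{L,-h}) = Z_β(H_{L,h})` (`partitionFn_dWaveSourceTorus_neg`, `pTilde_neg`);
  - NO ANOMALOUS AVERAGE `⟨Δ_g + Δ_g†⟩_{β,K₀} = 0`, `⟨Δ_g⟩_{β,K₀} = 0`
    (`gibbsState_hubbardTorusWith_pairSource`);
  - POSITIVITY `0 ≤ p̃_L(h) - p̃_L(0)` for `β ≥ 0` (`log_partitionFn_zero_le`, `pTilde_sub_nonneg`:
    Peierls–Bogoliubov + the vanishing average) — the RHS of the crux is never negative, so the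
    inequality has content only where `c log(1/(|h|+1/β)) > C`, i.e. `|h|, T < e^{-C/c}`, reached
    only as `U → 0` with `β ~ e^{a/U}`;
  - LIPSCHITZ `|p̃_L(h) - p̃_L(0)| ≤ 2 K_d |h|`, `K_d = 4√2` (`abs_pTilde_sub_le`, `Kd_eq`):
    the response is at most LINEAR in `|h|` with an absolute constant.
* §3 DEGENERATE MODEL: on the `1 × 1` torus `Δ_d ≡ 0` (`pairField_dWave_one`), so
  `p̃_1(h) - p̃_1(0) ≡ 0` (`pTilde_one_sub`).
* §4 LOAD-BEARING ANALYSIS (hypothesis by hypothesis):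
  - `∃ L₀` (eventually in `L`) is LOAD-BEARING: the `∀ L ≥ 1` version is FALSE
    (`twSourcedCondensation_false_allL`, witness `L = 1`, `h = 1/β = e^{-a/U}`);
  - `1 ≤ β` is load-bearing only via junk at `β = 0` (`twSourcedCondensation_false_fromBetaZero`);
  - the `|h|` inside the logarithm is LOAD-BEARING: the `log β` version is FALSE
    (`twSourcedCondensation_false_logBeta`: Lipschitz bound vs `c h₀² a/U`);
  - `0 < c` carries ALL the content (`twSourcedCondensation_trivial_at_c_zero`);
  - `U ≤ U₀`, `|h| ≤ h₀` are DECORATIVE: `Crux ↔ TwSourcedCondensationCore` (three constants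
    `a, c, C`, all `U > 0`, all real `h`; `crux_iff_core`, `C' = C + c a/U₀ + c|log h₀|`);
  - the sign of `h` is decorative: `Crux ↔ TwSourcedCondensationPos` (`crux_iff_pos`).
  A prover may therefore assume `0 < h ≤ h₀`, any fixed `U₀`, `h₀`, and must produce `L₀ ≥ 2`
  depending on `(U, β, μ)`.
* §6 TIGHTNESS AT FINITE VOLUME (new): `(A,A)_Duhamel ≤ 2‖A‖²` (`re_duhamel_self_le`), the sourced
  pair expectation grows at most linearly `Re⟨Δ_d+Δ_d†⟩_h ≤ 2β‖Q‖²h` (`re_gibbsState_source_le`,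
  MVT on the susceptibility formula), hence the QUADRATIC bound
  `p̃_L(h) - p̃_L(0) ≤ 8βK_d²L²h²` for all real `h` (`pTilde_sub_le_quadratic`). Consequences:
  - the `1/β` inside the logarithm is LOAD-BEARING: the `log(1/|h|)` version is FALSE
    (`twSourcedCondensation_false_noCutoff`);
  - the ORDER `h²` is load-bearing: a first-order response `c|h| ≤ RHS` is FALSE at every finite
    `L` (`twSourcedCondensation_false_linearResponse`).
  So the crux's LHS `h²·log(1/(|h|+1/β))` is the weakest shape in its natural family that is not
  already refuted at finite volume, and the strongest (`log β`, no cutoff, `|h|¹`) are all dead.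
* §7 THE MECHANISM BEHIND `∃ L₀` (new, abstract + conditional): for a Hamiltonian with a unique
  ground vector `ψ₀`, gap `γ` in projector form and `⟨ψ₀,Qψ₀⟩ = 0`:
  `E₀(H - hQ) ≥ E₀(H) - h²‖Q‖²/γ` (`groundEnergy_source_ge_of_gap`, second-order variational) and
  `log Z_β(H - hQ) - log Z_β(H) ≤ βh²‖Q‖²/γ + log dim` (`log_partitionFn_source_sub_le_of_gap`) —
  a `β`-UNIFORM cap on the response of any gapped cluster. Consequence
  (`twSourcedCondensation_false_fromSide_of_gap`): granted the explicit finite-dimensional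
  `ClusterGapHypothesis ℓ μs γ U₁` (unit gapped ground vector of `hubbardTorusWith 2 ℓ 1 U μs` for
  `0 < U ≤ U₁`; for `ℓ = 2`, `μs = -1/2` it holds at `U = 0` by hand — unique GC ground state, both
  spins in the `k = 0` orbital, gap `1/2` — and persists for small `U` by Weyl; ED cross-check queued as
  kit job j007210), the crux with its
  threshold FROZEN at `L₀ := ℓ` is FALSE (witness `L = ℓ`, `β = e^{a/U}`, `h = β^{-1/2}`). Message:
  `L₀(U,β,μ)` must outgrow every gapped cluster as `β → ∞`; `L ≫` (inverse finite-size gap) is the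
  safe regime — the mirror image of the resonant-shell obstruction in the sibling workfile
  `Cruxes/TwSourcedInertness/Disproof.lean` §D.
  §7b sharpens this to a hypothesis on the FREE cluster only (`FreeClusterGap ℓ μs γ`: unique gapped
  ground vector of `hubbardTorusWith 2 ℓ 1 0 μs` in projector form — an explicit free-fermion
  statement): `log_partitionFn_source_sub_le_of_approxGap` (an approximate gap
  `H ≥ E₁ + γ(1 - |ψ₀⟩⟨ψ₀|)` costs only `β(⟨ψ₀,Hψ₀⟩ - E₁)`), the repulsion is a positive form
  (`re_dotProduct_interaction_mulVec_nonneg`), so the interacting cluster inherits the free gap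
  inequality at cost `βUℓ²`, and `twSourcedCondensation_false_fromSide_of_freeGap` runs the witness at
  the MODERATE temperature `β = 1/(ℓ²U)` (no Weyl perturbation theory, no interacting ground state).
* §8 (gen 3, UNCONDITIONAL) NO THRESHOLD BEFORE THE TEMPERATURE: the tree now PROVES the exact free
  BdG pressure (`Literature…DWaveSourceFreePressure`, `bdgModeGain_le`), so on every torus `L ≥ 3` whose
  free levels avoid `μ` by `γ` the free response is capped `β`-UNIFORMLY, `G_0(h) ≤ 32h²/γ`
  (`free_gain_le_of_levelGap`), and `G_U(h) ≤ 32h²/γ + 2U` (`gain_le_of_levelGap`, tree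
  `sourcedGain_le_free_add`). Generic `μ` in any nondegenerate interval is off the finite level set
  (`exists_mu_off_levels`). Hence `twSourcedCondensation_false_uniformL0 : ¬ TwSourcedCondensationUniformL0`
  — NO threshold `L₀` chosen before `(U, β, μ)` (even depending on `μ₁,μ₂,U₀,a,c,C,h₀`) can serve the crux
  (witness `[-3,-1]`, `L = max(L₀,3)`, generic `μ`, `β = 1/U`, `h = √U`), and as corollaries the frozen
  threshold is false at EVERY side (`twSourcedCondensation_false_fromSide ℓ`, now hypothesis-free: §7a/§7b's
  `ClusterGapHypothesis`/`FreeClusterGap` are no longer needed) and §4a. Quantitative form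
  (`levelGap_obstruction`): wherever the crux's inequality holds at `(U, β = 1/U, h = √U)` the `L`-torus must
  carry a free level within `γ ≤ 32/(c(½ log β - log 2) - C - 2)` of `μ`, i.e. `L₀(U,β,μ) ≳ √(c log β)`
  at generic `μ` — the refuter's reach with the crude `2U` comparison ends at `βU ≲ 1`; the physical
  threshold is the thermal length `L ≳ β`. §8b: the band hypothesis `-4 < μ₁` is LOAD-BEARING — below the band
  (`μ₁ = μ₂ = -5`) every level of every torus avoids `μ` by `1`, so the crux (`twSourcedCondensation_false_belowBand`)
  and the free stub (F) (`stub_freeLinearCooperLog_false_belowBand`) are FALSE there with no `L₀` bookkeeping at all.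
* §9 (gen 3) TARGETS = the lead's four registered stubs (line `entropy-staircase-linear-regime`, skeleton
  `f819e3d0`): all four SURVIVE as stated; what is load-bearing in them:
  (F) `stub_freeLinearCooperLog`: `∃ L₀` after `β, μ` is LOAD-BEARING —
      `stub_freeLinearCooperLog_false_uniformL0` (generic gapped torus, `h = 1/β`: free response `≤ 32h²/γ`
      for every `β`, floor `(c₀ log β - C₀)h²`); and PROVED prover aid `stubF_of_corner`:
      `G_0(h)/h²` is non-increasing in `|h|` (`free_logGain_div_sq_antitone`, from the concavity of the BdG mode
      function `log((1+cosh √v)/2)`, `concaveOn_bdgG`, itself from `tanh` concave on `[0,∞)`), so (F) on the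
      whole window FOLLOWS from its value at the corner `|h| = 1/β` — the sibling workfile's
      `free_gain_thermal_lower_bound` shape (`Cruxes/TwSourcedInertness` §J, `μ = -2`);
  (Fh) `stub_freeLinearThermalLaw`: the SOURCE IS DECORATIVE — `free_heatChord_le_zero_source`: the free
      dyadic heat chord is maximal at `h = 0` (mode by mode, `dyadicMode_antitone`), so (Fh) is a statement
      about the number-conserving free gas (Sommerfeld); and `∃ L₀` after `β` is LOAD-BEARING —
      `stub_freeLinearThermalLaw_false_uniformL0` (resonant torus `μ = -1`, `L = 3j`, `h = 0`: an exact zero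
      mode keeps entropy `2 log 2` to `T = 0`, `free_heatChord_ge_of_zeroMode`: chord `≥ 2 log 2/(βL²) ≫ C₁/β²`;
      so `L₀(β,-1)² ≳ β/C₁`);
  (S) `stub_sourceSlack`, (T) `stub_thermalSlack`: no finite-size or perturbative kill (docstring
      `targets_ST_analysis`): first order in `U` is the Hartree transport `-U[d₀(h) - d₀(0)]` with `d₀ = n₀²/4`
      EXACTLY (the on-site anomalous amplitude of the `d`-wave source vanishes), of size `≍ U h² log β ≤ a h²`
      — so `η` may even be taken `0` at first order and `K ≍ a·n·|∂_μ ρ_d|`; second order `O(U² log² β) = O(a²)`.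
* §10 (gen 3) BAND EDGE: `twSourcedCondensation_false_uniformMu : ¬ TwSourcedCondensationUniformMu` — the
  constants cannot be chosen before the interval `[μ₁,μ₂]`: `|ĝ_d(k)| ≤ (4+ε_L(k))/2` (`abs_dWaveGap_le_edge`)
  makes the free `log β`-coefficient at `μ = -4 + δ` at most `32(1+κ₀)δ` (`free_logGain_edge_le`, with the
  tree's torus Cooper logarithm made explicit in `d₀`: `sum_fermiWeight_le_explicit`, `fermiWeightConst_le`);
  witness `δ = min(1, c/(128(1+κ₀)))`, `U = 1/β²`, `h = 1/β`, `L = max(L₀,3,⌈β⌉)`. MESSAGE: `c(μ₁) ≲ μ₁ + 4`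
  is forced (truth: `ρ_d(μ₁) ≍ (μ₁+4)²`); the planner's interval-dependent constants are necessary, not cosmetic.
* §5 WHY IT RESISTS (docstring `whyItResists`): no sign obstruction exists in the window
  `β ≤ e^{a/U}` — the on-site vertex is blind to the `B₁g` channel at first order (`Σ_k φ_k = 0`),
  the second-order (Kohn–Luttinger) vertex has relative weight `≲ U² ρ_d log β ≤ a U ρ_d → 0`
  whatever its sign, self-energy corrections are `O(U log β) = O(a)`; the free part is the
  textbook Cooper logarithm with `ρ_d(μ) > 0` on all of `(-4,0)`. The crux is "true but
  constructive": its content is the Benfatto–Giuliani–Mastropietro expansion at the summit's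
  fillings (with or, after the planner's Staircase reduction, WITHOUT the source as a second
  infrared cutoff). Small tori cannot refute it (`L₀ = L₀(β)` with `β` up to `e^{a/U}`), and the
  only Lean-decidable instance (`L = 1`) is excluded by `∃ L₀`.

Cited / reused tree facts: `phaseGauge` + its conjugation lemmas (`BdGBondHamiltonian`),
`pairField_dWaveFormFactor_eq`, `torusBondPair` (`BdGBondHamiltonianTorus`), `norm_pairField_le`,
`isHermitian_hubbardTorusWith` (`DWaveSourceProofs`), Peierls–Bogoliubov
`log_partitionFn_sub_le_log_partitionFn_add`, `abs_log_partitionFn_sub_log_partitionFn_le`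
(`ApproximatingHamiltonianProofs`), `partitionFn_unitary_conj` (`DuhamelTwoPoint`).
LANDED through the gate (importable): `Theorems/TwSourcedCondensation/Negative/SourceResponseStructure.lean`
(p70111: §1–3), `…/Negative/FiniteVolumeResponseBounds.lean` (p70511: §6 Duhamel/quadratic, §7 gapped cap),
`…/Negative/StrengtheningsRefuted.lean` (p70662: §4a–c, §6a–b), `…/Negative/NormalFormsAndFrozenThreshold.lean`
(p70791: §4d–e, §7a), `…/Negative/FrozenThresholdFreeGap.lean` (p73948: §7b); gen 3 LANDED
`…/Negative/UniformThreshold.lean` (p75660: §8), `…/Negative/StubThermalLaw.lean` (p77228: §9 (Fh)),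
`…/Negative/StubCooperLogCorner.lean` (p79278: §9 (F) corner reduction + uniform-`L₀`),
`…/Negative/ExplicitCooperLog.lean` (p79207: §10 explicit torus Cooper logarithm),
`…/Negative/BelowBand.lean` (p79416: §8b), and submitted `…/Negative/BandEdge.lean` (p80101: §10) —
ideators/planners should import those rather than this workfile.
Generation 1's file (evidence `20260815T223900Z-Disproof.lean`, not readable from this seat) reported
the same §1–2/§4 structure with the spin-down parity `(-1)^{N↓}` in place of `i^N`; §3/4a are new.
-/

noncomputable section

set_option linter.dupNamespace false

namespace Summit.HubbardSuperconductivity.HubbardSuperconductivity.Cruxes.TwSourcedCondensation.Disproof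

open Matrix Finset Literature.MathematicalPhysics.QuantumLattice Literature.Probability.LatticeModels
open scoped Matrix.Norms.L2Operator ComplexOrder ComplexConjugate

/-! ## §1 The constant gauge rotation by `i` (`W = i^N`) -/

section Gauge

/-- The constant phase `i ∈ U(1)`. [folklore] -/
def phaseI : Circle := ⟨Complex.I, mem_sphere_zero_iff_norm.2 (by simp)⟩

@[simp] theorem coe_phaseI : ((phaseI : Circle) : ℂ) = Complex.I := rfl

variable {Λ : Type*} [LinearOrder Λ] [Fintype Λ]

/-- `z · conj z = 1` on the circle. [folklore] -/
theorem circle_mul_conj (z : Circle) : (z : ℂ) * conj (z : ℂ) = 1 := by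
  rw [Complex.mul_conj, Circle.normSq_coe, Complex.ofReal_one]

/-- `W_gᴴ W_g = 1`. [folklore] -/
theorem conjTranspose_phaseGauge_mul_self (g : Λ → Circle) :
    (phaseGauge g)ᴴ * phaseGauge g = 1 := by
  rw [phaseGauge, diagonal_conjTranspose, diagonal_mul_diagonal, ← diagonal_one]
  congr 1
  funext s
  rw [Pi.star_apply, Complex.star_def, mul_comm, circle_mul_conj]

/-- `W_g W_gᴴ = 1`. [folklore] -/
theorem phaseGauge_mul_conjTranspose_self (g : Λ → Circle) :
    phaseGauge g * (phaseGauge g)ᴴ = 1 := by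
  rw [phaseGauge, diagonal_conjTranspose, diagonal_mul_diagonal, ← diagonal_one]
  congr 1
  funext s
  rw [Pi.star_apply, Complex.star_def, circle_mul_conj]

/-- `W_g` is unitary. [folklore] -/
theorem phaseGauge_mem_unitary (g : Λ → Circle) :
    phaseGauge g ∈ unitary (Matrix (Finset (Orb Λ)) (Finset (Orb Λ)) ℂ) := by
  rw [Unitary.mem_iff, star_eq_conjTranspose]
  exact ⟨conjTranspose_phaseGauge_mul_self g, phaseGauge_mul_conjTranspose_self g⟩

/-- A CONSTANT gauge rotation fixes every spin-diagonal hopping monomial `c†_{xσ} c_{yσ'}`. [folklore] -/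
theorem phaseGauge_const_conj_creation_mul_annihilation (g₀ : Circle) (x y : Λ) (σ τ : Fin 2) :
    phaseGauge (fun _ : Λ => g₀) * (creation (orb x σ) * annihilation (orb y τ)) *
        (phaseGauge (fun _ : Λ => g₀))ᴴ =
      creation (orb x σ) * annihilation (orb y τ) := by
  rw [phaseGauge_mul_mul_mul_conjTranspose, phaseGauge_mul_creation_mul_conjTranspose,
    phaseGauge_mul_annihilation_mul_conjTranspose, smul_mul_smul_comm, circle_mul_conj, one_smul]

/-- A constant gauge rotation fixes the Hubbard Hamiltonian on any finite graph
(particle-number conservation in conjugation form). [folklore] -/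
theorem phaseGauge_const_conj_hamiltonian (G : SimpleGraph Λ) [DecidableRel G.Adj] (g₀ : Circle)
    (t U : ℝ) :
    phaseGauge (fun _ : Λ => g₀) * hamiltonian G t U * (phaseGauge (fun _ : Λ => g₀))ᴴ =
      hamiltonian G t U := by
  set W := phaseGauge (fun _ : Λ => g₀) with hW
  have hnum : ∀ x : Λ, W * (numberOp x 0 * numberOp x 1) * Wᴴ = numberOp x 0 * numberOp x 1 := by
    intro x
    rw [hW, phaseGauge_mul_mul_mul_conjTranspose, phaseGauge_mul_numberOp_mul_conjTranspose,
      phaseGauge_mul_numberOp_mul_conjTranspose]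
  have hhop : ∀ (x y : Λ) (σ : Fin 2),
      W * (if G.Adj x y then creation (orb x σ) * annihilation (orb y σ) else 0) * Wᴴ =
        (if G.Adj x y then creation (orb x σ) * annihilation (orb y σ) else 0) := by
    intro x y σ
    split_ifs
    · rw [hW, phaseGauge_const_conj_creation_mul_annihilation]
    · rw [Matrix.mul_zero, Matrix.zero_mul]
  unfold hamiltonian
  simp only [Matrix.mul_add, Matrix.add_mul, Matrix.mul_smul, Matrix.smul_mul, Finset.mul_sum,
    Finset.sum_mul, hnum, hhop]

/-- A constant gauge rotation fixes the grand-canonical Hubbard Hamiltonian. [folklore] -/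
theorem phaseGauge_const_conj_hamiltonianWith (G : SimpleGraph Λ) [DecidableRel G.Adj]
    (g₀ : Circle) (t U μ : ℝ) :
    phaseGauge (fun _ : Λ => g₀) * hamiltonianWith G t U μ * (phaseGauge (fun _ : Λ => g₀))ᴴ =
      hamiltonianWith G t U μ := by
  rw [hamiltonianWith_eq, Matrix.mul_sub, Matrix.sub_mul, phaseGauge_const_conj_hamiltonian,
    Matrix.mul_smul, Matrix.smul_mul, phaseGauge_mul_totalNumber_mul_conjTranspose]

/-- The rotation by `i` flips the sign of every pair annihilator `c_{xσ} c_{yτ}`. [folklore] -/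
theorem phaseGauge_I_conj_annihilation_mul_annihilation (x y : Λ) (σ τ : Fin 2) :
    phaseGauge (fun _ : Λ => phaseI) * (annihilation (orb x σ) * annihilation (orb y τ)) *
        (phaseGauge (fun _ : Λ => phaseI))ᴴ =
      -(annihilation (orb x σ) * annihilation (orb y τ)) := by
  rw [phaseGauge_mul_mul_mul_conjTranspose, phaseGauge_mul_annihilation_mul_conjTranspose,
    phaseGauge_mul_annihilation_mul_conjTranspose, smul_mul_smul_comm, coe_phaseI, Complex.conj_I,
    neg_mul_neg, Complex.I_mul_I, neg_smul, one_smul]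

end Gauge

section TorusGauge

variable (L : ℕ)

/-- `W = i^N` on the fermionic torus of side `L`. [folklore] -/
def gaugeW : Matrix (Finset (Orb (FermionTorus 2 L))) (Finset (Orb (FermionTorus 2 L))) ℂ :=
  phaseGauge (fun _ : FermionTorus 2 L => phaseI)

/-- `Wᴴ W = 1` (the `DecidableEq` instance on the torus found by class resolution differs
syntactically from the `LinearOrder`-derived one inside `phaseGauge`; `convert` bridges it). [folklore] -/
theorem conjTranspose_gaugeW_mul_self : (gaugeW L)ᴴ * gaugeW L = 1 := by
  have h := conjTranspose_phaseGauge_mul_self (Λ := FermionTorus 2 L) fun _ => phaseI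
  unfold gaugeW
  convert h

theorem gaugeW_mul_conjTranspose_self : gaugeW L * (gaugeW L)ᴴ = 1 := by
  have h := phaseGauge_mul_conjTranspose_self (Λ := FermionTorus 2 L) fun _ => phaseI
  unfold gaugeW
  convert h

theorem gaugeW_mem_unitary :
    gaugeW L ∈ unitary (Matrix (Finset (Orb (FermionTorus 2 L))) (Finset (Orb (FermionTorus 2 L))) ℂ) := by
  rw [Unitary.mem_iff, star_eq_conjTranspose]
  exact ⟨conjTranspose_gaugeW_mul_self L, gaugeW_mul_conjTranspose_self L⟩

/-- `W K₀ Wᴴ = K₀` for the grand-canonical torus Hubbard Hamiltonian. [folklore] -/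
theorem gaugeW_conj_hubbardTorusWith (t U μ : ℝ) :
    gaugeW L * hubbardTorusWith 2 L t U μ * (gaugeW L)ᴴ = hubbardTorusWith 2 L t U μ := by
  unfold gaugeW hubbardTorusWith; exact phaseGauge_const_conj_hamiltonianWith _ _ t U μ

/-- `W` commutes with `K₀`. [folklore] -/
theorem gaugeW_mul_hubbardTorusWith (t U μ : ℝ) :
    gaugeW L * hubbardTorusWith 2 L t U μ = hubbardTorusWith 2 L t U μ * gaugeW L := by
  calc gaugeW L * hubbardTorusWith 2 L t U μ
      = gaugeW L * hubbardTorusWith 2 L t U μ * ((gaugeW L)ᴴ * gaugeW L) := by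
        rw [conjTranspose_gaugeW_mul_self, Matrix.mul_one]
    _ = gaugeW L * hubbardTorusWith 2 L t U μ * (gaugeW L)ᴴ * gaugeW L := by
        rw [← Matrix.mul_assoc]
    _ = hubbardTorusWith 2 L t U μ * gaugeW L := by rw [gaugeW_conj_hubbardTorusWith]

end TorusGauge

section Torus

variable (L : ℕ) [NeZero L]

/-- `W P_x Wᴴ = -P_x` for every local pair. [folklore] -/
theorem gaugeW_conj_localPair (g : Site 2 → ℝ) (x : TorusSite 2 L) :
    gaugeW L * localPair g L x * (gaugeW L)ᴴ = -localPair g L x := by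
  unfold localPair gaugeW
  simp only [Finset.mul_sum, Finset.sum_mul, Matrix.mul_smul, Matrix.smul_mul, Matrix.mul_sub,
    Matrix.sub_mul, phaseGauge_I_conj_annihilation_mul_annihilation, smul_neg, neg_sub_neg, smul_sub]
  rw [← Finset.sum_neg_distrib]
  refine Finset.sum_congr rfl fun e _ => ?_
  abel

/-- `W Δ_g Wᴴ = -Δ_g` for the pair field. [folklore] -/
theorem gaugeW_conj_pairField (g : Site 2 → ℝ) :
    gaugeW L * pairField g L * (gaugeW L)ᴴ = -pairField g L := by
  unfold pairField
  simp only [Finset.mul_sum, Finset.sum_mul, gaugeW_conj_localPair, Finset.sum_neg_distrib]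

/-- `W Δ_gᴴ Wᴴ = -Δ_gᴴ`. [folklore] -/
theorem gaugeW_conj_pairField_conjTranspose (g : Site 2 → ℝ) :
    gaugeW L * (pairField g L)ᴴ * (gaugeW L)ᴴ = -(pairField g L)ᴴ := by
  rw [gaugeW, phaseGauge_mul_conjTranspose_mul_conjTranspose, ← gaugeW, gaugeW_conj_pairField,
    conjTranspose_neg]

/-- **The gauge rotation by `i` reverses the source**: `W H_{L,h} Wᴴ = H_{L,-h}`. [folklore] -/
theorem gaugeW_conj_dWaveSourceTorus (U μ h : ℝ) :
    gaugeW L * dWaveSourceTorus L U μ h * (gaugeW L)ᴴ = dWaveSourceTorus L U μ (-h) := by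
  rw [dWaveSourceTorus, dWaveSourceTorus, Matrix.mul_sub, Matrix.sub_mul, gaugeW_conj_hubbardTorusWith,
    Matrix.mul_smul, Matrix.smul_mul, Matrix.mul_add, Matrix.add_mul, gaugeW_conj_pairField,
    gaugeW_conj_pairField_conjTranspose, Complex.ofReal_neg]
  simp only [smul_add, smul_neg, neg_smul]

/-- **Evenness of the sourced partition function**: `Z_β(H_{L,-h}) = Z_β(H_{L,h})`. [folklore] -/
theorem partitionFn_dWaveSourceTorus_neg (β U μ h : ℝ) :
    partitionFn β (dWaveSourceTorus L U μ (-h)) = partitionFn β (dWaveSourceTorus L U μ h) := by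
  rw [← gaugeW_conj_dWaveSourceTorus, ← star_eq_conjTranspose,
    partitionFn_unitary_conj (gaugeW_mem_unitary L)]

/-- Invariance of a Gibbs state under a unitary commuting with the Hamiltonian. [folklore] -/
theorem gibbsState_conj_of_commute {m : Type*} [Fintype m] [DecidableEq m] {H V : Matrix m m ℂ}
    (hV : V * H = H * V) (hVV : Vᴴ * V = 1) (β : ℝ) (A : Matrix m m ℂ) :
    gibbsState β H (V * A * Vᴴ) = gibbsState β H A := by
  have hc : Commute (gibbsWeight β H) V := by
    have h1 : Commute (-(β : ℂ) • H) V := (Commute.smul_left (a := H) (b := V) hV.symm _)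
    exact h1.exp_left
  rw [gibbsState_apply, gibbsState_apply]
  congr 1
  calc (gibbsWeight β H * (V * A * Vᴴ)).trace = (V * (gibbsWeight β H * A) * Vᴴ).trace := by
        rw [← Matrix.mul_assoc, ← Matrix.mul_assoc, hc.eq, Matrix.mul_assoc V]
    _ = (Vᴴ * V * (gibbsWeight β H * A)).trace := by
        rw [trace_mul_cycle, Matrix.mul_assoc]
    _ = (gibbsWeight β H * A).trace := by rw [hVV, Matrix.one_mul]

/-- **No anomalous thermal average without source**: `⟨Δ_g + Δ_g†⟩_{β, K₀} = 0` for every `β`,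
every form factor, all `t, U, μ`, every `L` (`U(1)`). [folklore] -/
theorem gibbsState_hubbardTorusWith_pairSource (β t U μ : ℝ) (g : Site 2 → ℝ) :
    gibbsState β (hubbardTorusWith 2 L t U μ) (pairField g L + (pairField g L)ᴴ) = 0 := by
  have h := gibbsState_conj_of_commute (gaugeW_mul_hubbardTorusWith L t U μ)
    (conjTranspose_gaugeW_mul_self L) β (pairField g L + (pairField g L)ᴴ)
  rw [Matrix.mul_add, Matrix.add_mul, gaugeW_conj_pairField, gaugeW_conj_pairField_conjTranspose,
    ← neg_add, map_neg, neg_eq_iff_add_eq_zero, add_self_eq_zero] at h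
  exact h

/-- `⟨Δ_g⟩_{β,K₀} = 0` as well. [folklore] -/
theorem gibbsState_hubbardTorusWith_pairField (β t U μ : ℝ) (g : Site 2 → ℝ) :
    gibbsState β (hubbardTorusWith 2 L t U μ) (pairField g L) = 0 := by
  have h := gibbsState_conj_of_commute (gaugeW_mul_hubbardTorusWith L t U μ)
    (conjTranspose_gaugeW_mul_self L) β (pairField g L)
  rw [gaugeW_conj_pairField, map_neg, neg_eq_iff_add_eq_zero, add_self_eq_zero] at h
  exact h

/-- **The source never lowers the torus pressure** (numerator form, every real `β`):
`log Z_β(K₀) ≤ log Z_β(K₀ - h(Δ_d + Δ_d†))` — Peierls–Bogoliubov plus `⟨Δ_d + Δ_d†⟩_{K₀} = 0`. [folklore] -/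
theorem log_partitionFn_zero_le (β U μ h : ℝ) :
    Real.log (partitionFn β (dWaveSourceTorus L U μ 0)).re ≤
      Real.log (partitionFn β (dWaveSourceTorus L U μ h)).re := by
  have hK := isHermitian_hubbardTorusWith L 1 U μ
  have hQ := isHermitian_pairField_add_conjTranspose L
  have hW : (-(h : ℂ) • (pairField dWaveFormFactor L + (pairField dWaveFormFactor L)ᴴ)).IsHermitian := by
    refine IsHermitian.smul hQ ?_
    rw [isSelfAdjoint_iff, star_neg, Complex.star_def, Complex.conj_ofReal]
  have hPB := log_partitionFn_sub_le_log_partitionFn_add hK hW β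
  rw [map_smul, gibbsState_hubbardTorusWith_pairSource, smul_zero, Complex.zero_re, mul_zero,
    sub_zero] at hPB
  rw [dWaveSourceTorus_zero]
  convert hPB using 3
  rw [dWaveSourceTorus, sub_eq_add_neg, neg_smul]

end Torus


/-! ## §2 The sourced torus pressure: a priori facts -/

section Pressure

/-- The finite-volume sourced torus pressure `p̃_L(β,U,μ,h) = log Z_β(H_{L,h}) / (β L²)`, verbatim
the quantity of the crux. [folklore] -/
def pTilde (β : ℝ) (L : ℕ) [NeZero L] (U μ h : ℝ) : ℝ :=
  Real.log (partitionFn β (dWaveSourceTorus L U μ h)).re / (β * (L : ℝ) ^ 2)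

/-- The d-wave source norm constant `K_d = 2 Σ_{e ∈ {0,±e₁,±e₂}} |d(e)/√2|` (`= 4√2`). [folklore] -/
def Kd : ℝ := 2 * ∑ e ∈ insert (0 : Site 2) unitSteps, |dWaveFormFactor e / Real.sqrt 2|

theorem Kd_nonneg : 0 ≤ Kd :=
  mul_nonneg zero_le_two (sum_nonneg fun _ _ => abs_nonneg _)

/-- `K_d = 4√2`. [folklore] -/
theorem Kd_eq : Kd = 4 * Real.sqrt 2 := by
  have h2 : (0 : ℝ) < Real.sqrt 2 := Real.sqrt_pos.2 two_pos
  have hval : ∀ e ∈ unitSteps, |dWaveFormFactor e / Real.sqrt 2| = 1 / Real.sqrt 2 := by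
    intro e he
    have : dWaveFormFactor e = 1 ∨ dWaveFormFactor e = -1 := by
      simp only [unitSteps, Finset.mem_insert, Finset.mem_singleton] at he
      rcases he with rfl | rfl | rfl | rfl
      · exact Or.inl (by rw [dWaveFormFactor_unitStep]; rfl)
      · exact Or.inl (by rw [dWaveFormFactor_neg_unitStep]; rfl)
      · exact Or.inr (by rw [dWaveFormFactor_unitStep]; simp)
      · exact Or.inr (by rw [dWaveFormFactor_neg_unitStep]; simp)
    rcases this with h | h <;> rw [h]
    · rw [abs_of_pos (by positivity)]
    · rw [neg_div, abs_neg, abs_of_pos (by positivity)]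
  rw [Kd, Finset.sum_insert zero_not_mem_unitSteps, dWaveFormFactor_zero, zero_div, abs_zero, zero_add,
    Finset.sum_congr rfl hval, sum_unitSteps]
  have h3 : Real.sqrt 2 * Real.sqrt 2 = 2 := Real.mul_self_sqrt zero_le_two
  have h4 : 1 / Real.sqrt 2 = Real.sqrt 2 / 2 := by
    rw [div_eq_div_iff h2.ne' two_ne_zero, one_mul, h3]
  rw [h4]
  ring

variable (L : ℕ) [NeZero L]

/-- `‖Δ_d‖ ≤ K_d L²` and hence `‖Δ_d + Δ_d†‖ ≤ 2 K_d L²`. [folklore] -/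
theorem norm_pairSource_le :
    ‖pairField dWaveFormFactor L + (pairField dWaveFormFactor L)ᴴ‖ ≤ 2 * Kd * (L : ℝ) ^ 2 := by
  have h1 : ‖pairField dWaveFormFactor L‖ ≤ Kd * (L : ℝ) ^ 2 := norm_pairField_le dWaveFormFactor L
  have h2 : ‖(pairField dWaveFormFactor L)ᴴ‖ ≤ Kd * (L : ℝ) ^ 2 := by
    rw [Matrix.l2_opNorm_conjTranspose]; exact h1
  calc ‖pairField dWaveFormFactor L + (pairField dWaveFormFactor L)ᴴ‖
      ≤ ‖pairField dWaveFormFactor L‖ + ‖(pairField dWaveFormFactor L)ᴴ‖ := norm_add_le _ _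
    _ ≤ 2 * Kd * (L : ℝ) ^ 2 := by linarith

/-- **Lipschitz bound, numerator form**: `|log Z_β(H_{L,h}) - log Z_β(H_{L,0})| ≤ β |h| · 2K_d L²`
for `β ≥ 0`, all `U, μ, h, L`. [folklore] -/
theorem abs_log_partitionFn_sub_le (β U μ h : ℝ) (hβ : 0 ≤ β) :
    |Real.log (partitionFn β (dWaveSourceTorus L U μ h)).re -
        Real.log (partitionFn β (dWaveSourceTorus L U μ 0)).re| ≤
      β * (|h| * (2 * Kd * (L : ℝ) ^ 2)) := by
  have hK := isHermitian_hubbardTorusWith L 1 U μ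
  have hHh := dWaveSourceTorus_isHermitian L hK h
  have hH0 := dWaveSourceTorus_isHermitian L hK 0
  refine (abs_log_partitionFn_sub_log_partitionFn_le hHh hH0 hβ).trans ?_
  refine mul_le_mul_of_nonneg_left ?_ hβ
  have hdiff : dWaveSourceTorus L U μ h - dWaveSourceTorus L U μ 0 =
      -((h : ℂ) • (pairField dWaveFormFactor L + (pairField dWaveFormFactor L)ᴴ)) := by
    rw [dWaveSourceTorus_zero, dWaveSourceTorus]; abel
  rw [hdiff, norm_neg, norm_smul, Complex.norm_real, Real.norm_eq_abs]
  exact mul_le_mul_of_nonneg_left (norm_pairSource_le L) (abs_nonneg h)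

/-- **Positivity of the response** (the RHS of the crux is `≥ 0`): `p̃_L(h) - p̃_L(0) ≥ 0` for
`β ≥ 0`, EVERY `L ≥ 1`, all `U, μ, h`. [folklore] -/
theorem pTilde_sub_nonneg {β : ℝ} (hβ : 0 ≤ β) (U μ h : ℝ) :
    0 ≤ pTilde β L U μ h - pTilde β L U μ 0 := by
  rw [pTilde, pTilde, ← sub_div]
  exact div_nonneg (sub_nonneg.2 (log_partitionFn_zero_le L β U μ h)) (by positivity)

/-- **Evenness of the response**: `p̃_L(-h) = p̃_L(h)`. [folklore] -/
theorem pTilde_neg (β U μ h : ℝ) : pTilde β L U μ (-h) = pTilde β L U μ h := by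
  rw [pTilde, pTilde, partitionFn_dWaveSourceTorus_neg]

/-- **Lipschitz bound**: `|p̃_L(h) - p̃_L(0)| ≤ 2K_d |h| = 8√2 |h|` for `β > 0`, uniformly in
`L, U, μ` — the response is at most LINEAR in the source, with an absolute constant. [folklore] -/
theorem abs_pTilde_sub_le {β : ℝ} (hβ : 0 < β) (U μ h : ℝ) :
    |pTilde β L U μ h - pTilde β L U μ 0| ≤ 2 * Kd * |h| := by
  have hL : (0 : ℝ) < (L : ℝ) ^ 2 := cast_sq_pos_of_neZero L
  have hden : 0 < β * (L : ℝ) ^ 2 := mul_pos hβ hL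
  rw [pTilde, pTilde, ← sub_div, abs_div, abs_of_pos hden, div_le_iff₀ hden]
  calc |Real.log (partitionFn β (dWaveSourceTorus L U μ h)).re -
          Real.log (partitionFn β (dWaveSourceTorus L U μ 0)).re|
      ≤ β * (|h| * (2 * Kd * (L : ℝ) ^ 2)) := abs_log_partitionFn_sub_le L β U μ h hβ.le
    _ = 2 * Kd * |h| * (β * (L : ℝ) ^ 2) := by ring

end Pressure

/-! ## §3 The degenerate `1 × 1` torus: `Δ_d ≡ 0`, so the response vanishes identically -/

section OneByOne

/-- On the `1 × 1` torus every directed bond is a loop, so the two bond pairs of `Δ_d` coincide.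
[folklore] -/
theorem torusBondPair_one_eq (x : TorusSite 2 1) (i j : Fin 2) :
    torusBondPair 1 x i = torusBondPair 1 x j := by
  rw [torusBondPair_eq, torusBondPair_eq, Subsingleton.elim (x + Pi.single i 1) (x + Pi.single j 1)]

/-- **`Δ_d = 0` on the `1 × 1` torus** (`Δ_d = √2(Σ_x b_{x,0} - Σ_x b_{x,1})` and `b_{x,0} = b_{x,1}`).
[folklore] -/
theorem pairField_dWave_one : pairField dWaveFormFactor 1 = 0 := by
  rw [pairField_dWaveFormFactor_eq, Finset.sum_congr rfl fun x _ => torusBondPair_one_eq x 0 1,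
    sub_self, smul_zero]

/-- Hence the sourced `1 × 1` Hamiltonian does not depend on the source. [folklore] -/
theorem dWaveSourceTorus_one (U μ h : ℝ) : dWaveSourceTorus 1 U μ h = dWaveSourceTorus 1 U μ 0 := by
  rw [dWaveSourceTorus, dWaveSourceTorus, pairField_dWave_one]
  simp

/-- And the `1 × 1` response vanishes identically: `p̃_1(h) - p̃_1(0) = 0` for all `β, U, μ, h`.
[folklore] -/
theorem pTilde_one_sub (β U μ h : ℝ) : pTilde β 1 U μ h - pTilde β 1 U μ 0 = 0 := by
  rw [pTilde, pTilde, dWaveSourceTorus_one U μ h, sub_self]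

end OneByOne

/-! ## §4 Load-bearing analysis (each hypothesis dropped or mutated in turn) -/

section LoadBearing

/-- Local name of the crux. -/
abbrev Crux : Prop :=
  Summit.HubbardSuperconductivity.HubbardSuperconductivity.Theses.ThermalWedge.TwSourcedCondensation

/-- The crux, verbatim, with the pressure abbreviated (definitional unfolding). [folklore] -/
theorem crux_iff :
    Crux ↔ ∀ μ₁ μ₂ : ℝ, -4 < μ₁ → μ₁ ≤ μ₂ → μ₂ < 0 → ∃ U₀ a c C h₀ : ℝ, 0 < U₀ ∧ 0 < a ∧ 0 < c ∧
      0 < C ∧ 0 < h₀ ∧ ∀ U : ℝ, 0 < U → U ≤ U₀ → ∀ β : ℝ, 1 ≤ β → β ≤ Real.exp (a / U) →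
      ∀ μ ∈ Set.Icc μ₁ μ₂, ∃ L₀ : ℕ, ∀ (L : ℕ) [NeZero L], L₀ ≤ L → ∀ h : ℝ, |h| ≤ h₀ →
        c * h ^ 2 * Real.log (1 / (|h| + 1 / β)) - C * h ^ 2 ≤ pTilde β L U μ h - pTilde β L U μ 0 :=
  Iff.rfl

/-! ### 4a. `∃ L₀` (eventually in `L`) is load-bearing: the `∀ L` version fails on the `1 × 1` torus -/

/-- The crux with "eventually in `L`" strengthened to "for every `L ≥ 1`". -/
def TwSourcedCondensationAllL : Prop :=
  ∀ μ₁ μ₂ : ℝ, -4 < μ₁ → μ₁ ≤ μ₂ → μ₂ < 0 → ∃ U₀ a c C h₀ : ℝ, 0 < U₀ ∧ 0 < a ∧ 0 < c ∧ 0 < C ∧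
    0 < h₀ ∧ ∀ U : ℝ, 0 < U → U ≤ U₀ → ∀ β : ℝ, 1 ≤ β → β ≤ Real.exp (a / U) →
    ∀ μ ∈ Set.Icc μ₁ μ₂, ∀ (L : ℕ) [NeZero L], ∀ h : ℝ, |h| ≤ h₀ →
      c * h ^ 2 * Real.log (1 / (|h| + 1 / β)) - C * h ^ 2 ≤ pTilde β L U μ h - pTilde β L U μ 0

/-- A large ratio `a/U` inside `(0, U₀]`: for `M > 0` the coupling `U = min U₀ (a/M)` has `a/U ≥ M`.
[folklore] -/
theorem exists_small_coupling {U₀ a : ℝ} (hU₀ : 0 < U₀) (ha : 0 < a) {M : ℝ} (hM : 0 < M) :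
    ∃ U : ℝ, 0 < U ∧ U ≤ U₀ ∧ M ≤ a / U := by
  refine ⟨min U₀ (a / M), lt_min hU₀ (div_pos ha hM), min_le_left _ _, ?_⟩
  rw [le_div_iff₀ (lt_min hU₀ (div_pos ha hM))]
  calc M * min U₀ (a / M) ≤ M * (a / M) := mul_le_mul_of_nonneg_left (min_le_right _ _) hM.le
    _ = a := mul_div_cancel₀ a hM.ne'

/-- **`TwSourcedCondensation` is FALSE without "eventually in `L`"** (any proof must use `L₀ ≥ 2`):
on the `1 × 1` torus the response is `0`, while at `h = 1/β = e^{-a/U}` the claimed lower bound is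
`e^{-2a/U}(c(a/U - log 2) - C) > 0` once `a/U > log 2 + C/c`. [folklore] -/
theorem twSourcedCondensation_false_allL : ¬ TwSourcedCondensationAllL := by
  intro H
  obtain ⟨U₀, a, c, C, h₀, hU₀, ha, hc, hC, hh₀, H⟩ := H (-2) (-2) (by norm_num) le_rfl (by norm_num)
  have hMpos : 0 < |Real.log 2 + C / c| + |Real.log h₀| + 1 := by positivity
  obtain ⟨U, hUpos, hUle, haU⟩ := exists_small_coupling hU₀ ha hMpos
  set β : ℝ := Real.exp (a / U) with hβ
  have hβpos : 0 < β := Real.exp_pos _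
  have hβ1 : 1 ≤ β := Real.one_le_exp (div_nonneg ha.le hUpos.le)
  have hhβ : |1 / β| ≤ h₀ := by
    rw [abs_of_pos (one_div_pos.2 hβpos), hβ, one_div, ← Real.exp_neg, ← Real.le_log_iff_exp_le hh₀]
    linarith [neg_abs_le (Real.log h₀), abs_nonneg (Real.log 2 + C / c)]
  have key := H U hUpos hUle β hβ1 le_rfl (-2) ⟨le_rfl, le_rfl⟩ 1 (1 / β) hhβ
  rw [pTilde_one_sub] at key
  have hlog : Real.log (1 / (|1 / β| + 1 / β)) = a / U - Real.log 2 := by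
    rw [abs_of_pos (one_div_pos.2 hβpos), show 1 / (1 / β + 1 / β) = β / 2 by field_simp; ring,
      Real.log_div hβpos.ne' two_ne_zero, hβ, Real.log_exp]
  rw [hlog] at key
  have h1 : Real.log 2 + C / c < a / U := by
    linarith [le_abs_self (Real.log 2 + C / c), abs_nonneg (Real.log h₀)]
  have h2 : 0 < c * (a / U - Real.log 2) - C := by
    have : C / c < a / U - Real.log 2 := by linarith
    rw [div_lt_iff₀ hc] at this
    linarith
  have h3 : 0 < (1 / β) ^ 2 := by positivity
  have h4 : (1 / β) ^ 2 * (c * (a / U - Real.log 2) - C) =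
      c * (1 / β) ^ 2 * (a / U - Real.log 2) - C * (1 / β) ^ 2 := by ring
  linarith [mul_pos h3 h2]

/-! ### 4b. `1 ≤ β` is load-bearing only through the junk value at `β = 0` -/

/-- The crux with `1 ≤ β` weakened to `0 ≤ β`. -/
def TwSourcedCondensationFromBetaZero : Prop :=
  ∀ μ₁ μ₂ : ℝ, -4 < μ₁ → μ₁ ≤ μ₂ → μ₂ < 0 → ∃ U₀ a c C h₀ : ℝ, 0 < U₀ ∧ 0 < a ∧ 0 < c ∧ 0 < C ∧
    0 < h₀ ∧ ∀ U : ℝ, 0 < U → U ≤ U₀ → ∀ β : ℝ, 0 ≤ β → β ≤ Real.exp (a / U) →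
    ∀ μ ∈ Set.Icc μ₁ μ₂, ∃ L₀ : ℕ, ∀ (L : ℕ) [NeZero L], L₀ ≤ L → ∀ h : ℝ, |h| ≤ h₀ →
      c * h ^ 2 * Real.log (1 / (|h| + 1 / β)) - C * h ^ 2 ≤ pTilde β L U μ h - pTilde β L U μ 0

/-- **FALSE from `β = 0`** (junk arithmetic only: `1/0 = 0` makes the temperature cutoff of the
logarithm disappear while `log Z/(0·L²) = 0`): at `β = 0` the LHS is `h²(c log(1/|h|) - C) > 0` for
`0 < |h| < e^{-C/c}` and the RHS is `0`. Says nothing about physics; it only certifies that the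
lower bound `1 ≤ β` (or any `β₀ > 0`) must stay. [folklore] -/
theorem twSourcedCondensation_false_fromBetaZero : ¬ TwSourcedCondensationFromBetaZero := by
  intro H
  obtain ⟨U₀, a, c, C, h₀, hU₀, ha, hc, hC, hh₀, H⟩ := H (-2) (-2) (by norm_num) le_rfl (by norm_num)
  obtain ⟨L₀, hL₀⟩ := H U₀ hU₀ le_rfl 0 le_rfl (Real.exp_pos _).le (-2) ⟨le_rfl, le_rfl⟩
  set h : ℝ := min h₀ (Real.exp (-(C / c + 1))) with hh
  have hhpos : 0 < h := lt_min hh₀ (Real.exp_pos _)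
  have key := hL₀ (L₀ + 1) (Nat.le_succ _) h (by rw [abs_of_pos hhpos]; exact min_le_left _ _)
  have hR : pTilde 0 (L₀ + 1) U₀ (-2) h - pTilde 0 (L₀ + 1) U₀ (-2) 0 = 0 := by simp [pTilde]
  rw [hR, abs_of_pos hhpos, div_zero, add_zero, one_div, Real.log_inv] at key
  have hlogh : Real.log h ≤ -(C / c + 1) := by
    rw [Real.log_le_iff_le_exp hhpos]; exact min_le_right _ _
  have h2 : 0 < c * -Real.log h - C := by
    have : C / c + 1 ≤ -Real.log h := by linarith
    have hcc : C / c * c = C := div_mul_cancel₀ C hc.ne'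
    nlinarith
  have h3 : 0 < h ^ 2 := by positivity
  have h4 : h ^ 2 * (c * -Real.log h - C) = c * h ^ 2 * -Real.log h - C * h ^ 2 := by ring
  linarith [mul_pos h3 h2]

/-! ### 4c. The `|h|` inside the logarithm is load-bearing: the `log β` version is false -/

/-- The crux with the cutoff logarithm `log(1/(|h| + 1/β))` strengthened to `log β`. -/
def TwSourcedCondensationLogBeta : Prop :=
  ∀ μ₁ μ₂ : ℝ, -4 < μ₁ → μ₁ ≤ μ₂ → μ₂ < 0 → ∃ U₀ a c C h₀ : ℝ, 0 < U₀ ∧ 0 < a ∧ 0 < c ∧ 0 < C ∧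
    0 < h₀ ∧ ∀ U : ℝ, 0 < U → U ≤ U₀ → ∀ β : ℝ, 1 ≤ β → β ≤ Real.exp (a / U) →
    ∀ μ ∈ Set.Icc μ₁ μ₂, ∃ L₀ : ℕ, ∀ (L : ℕ) [NeZero L], L₀ ≤ L → ∀ h : ℝ, |h| ≤ h₀ →
      c * h ^ 2 * Real.log β - C * h ^ 2 ≤ pTilde β L U μ h - pTilde β L U μ 0

/-- **FALSE with `log β` in place of `log(1/(|h| + 1/β))`**: at `h = h₀` and `β = e^{a/U}` the
LHS grows like `c h₀² a/U` while the response is `≤ 2K_d h₀` uniformly (Lipschitz bound) —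
the source, not only the temperature, must cut the Cooper logarithm off. [folklore] -/
theorem twSourcedCondensation_false_logBeta : ¬ TwSourcedCondensationLogBeta := by
  intro H
  obtain ⟨U₀, a, c, C, h₀, hU₀, ha, hc, hC, hh₀, H⟩ := H (-2) (-2) (by norm_num) le_rfl (by norm_num)
  have hMpos : 0 < (2 * Kd / h₀ + C) / c + 1 := by
    have := Kd_nonneg; positivity
  obtain ⟨U, hUpos, hUle, haU⟩ := exists_small_coupling hU₀ ha hMpos
  set β : ℝ := Real.exp (a / U) with hβ
  have hβpos : 0 < β := Real.exp_pos _
  have hβ1 : 1 ≤ β := Real.one_le_exp (div_nonneg ha.le hUpos.le)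
  obtain ⟨L₀, hL₀⟩ := H U hUpos hUle β hβ1 le_rfl (-2) ⟨le_rfl, le_rfl⟩
  have key := hL₀ (L₀ + 1) (Nat.le_succ _) h₀ (by rw [abs_of_pos hh₀])
  have hlip := (le_abs_self _).trans (abs_pTilde_sub_le (L₀ + 1) hβpos U (-2) h₀)
  rw [abs_of_pos hh₀] at hlip
  rw [hβ, Real.log_exp] at key
  -- `c h₀² (a/U) - C h₀² ≥ h₀² (c M - C) = 2 K_d h₀ + c h₀² > 2 K_d h₀`
  have h1 : 2 * Kd / h₀ + C + c ≤ c * (a / U) := by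
    have := mul_le_mul_of_nonneg_left haU hc.le
    rw [mul_add, mul_one, mul_div_cancel₀ _ hc.ne'] at this
    exact this
  have h2 : h₀ ^ 2 * (2 * Kd / h₀ + C + c) = 2 * Kd * h₀ + C * h₀ ^ 2 + c * h₀ ^ 2 := by
    field_simp
  have h3 : 0 < c * h₀ ^ 2 := by positivity
  nlinarith [mul_le_mul_of_nonneg_left h1 (sq_nonneg h₀)]

/-! ### 4d. `0 < c` carries all the content: with `c = 0` the statement is a triviality -/

/-- With the Cooper-logarithm coefficient `c` set to `0` the crux holds trivially (RHS `≥ 0`),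
for ALL `U, β > 0, μ, L, h` — every bit of content of `TwSourcedCondensation` is in `0 < c`. [folklore] -/
theorem twSourcedCondensation_trivial_at_c_zero (β : ℝ) (hβ : 0 < β) (L : ℕ) [NeZero L]
    (U μ h C : ℝ) (hC : 0 ≤ C) :
    0 * h ^ 2 * Real.log (1 / (|h| + 1 / β)) - C * h ^ 2 ≤ pTilde β L U μ h - pTilde β L U μ 0 := by
  have := pTilde_sub_nonneg L hβ.le U μ h
  nlinarith [sq_nonneg h]

/-! ### 4e. `U ≤ U₀` and `|h| ≤ h₀` are decorative; so is the sign of `h` -/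

/-- The three-constant core form: no coupling ceiling `U₀`, no source window `h₀`. -/
def TwSourcedCondensationCore : Prop :=
  ∀ μ₁ μ₂ : ℝ, -4 < μ₁ → μ₁ ≤ μ₂ → μ₂ < 0 → ∃ a c C : ℝ, 0 < a ∧ 0 < c ∧ 0 < C ∧
    ∀ U : ℝ, 0 < U → ∀ β : ℝ, 1 ≤ β → β ≤ Real.exp (a / U) → ∀ μ ∈ Set.Icc μ₁ μ₂,
      ∃ L₀ : ℕ, ∀ (L : ℕ) [NeZero L], L₀ ≤ L → ∀ h : ℝ,
        c * h ^ 2 * Real.log (1 / (|h| + 1 / β)) - C * h ^ 2 ≤ pTilde β L U μ h - pTilde β L U μ 0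

/-- The cutoff logarithm is at most `log β` (`β > 0`). [folklore] -/
theorem log_cutoff_le_log {β : ℝ} (hβ : 0 < β) (h : ℝ) :
    Real.log (1 / (|h| + 1 / β)) ≤ Real.log β := by
  have hpos : 0 < |h| + 1 / β := by positivity
  refine Real.log_le_log (by positivity) ?_
  rw [div_le_iff₀ hpos]
  have : β * (1 / β) = 1 := mul_one_div_cancel hβ.ne'
  nlinarith [abs_nonneg h]

/-- The cutoff logarithm is at most `log(1/h₀)` outside the window `|h| ≤ h₀` (`β > 0`). [folklore] -/
theorem log_cutoff_le_of_lt {β h₀ : ℝ} (hβ : 0 < β) (hh₀ : 0 < h₀) {h : ℝ} (hh : h₀ < |h|) :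
    Real.log (1 / (|h| + 1 / β)) ≤ |Real.log h₀| := by
  have hpos : 0 < |h| + 1 / β := by positivity
  calc Real.log (1 / (|h| + 1 / β)) ≤ Real.log (1 / h₀) := by
        refine Real.log_le_log (by positivity) (one_div_le_one_div_of_le hh₀ ?_)
        linarith [one_div_pos.2 hβ]
    _ ≤ |Real.log h₀| := by rw [one_div, Real.log_inv]; exact neg_le_abs _

/-- **`TwSourcedCondensation ↔ TwSourcedCondensationCore`**: the coupling ceiling `U ≤ U₀` and the
source window `|h| ≤ h₀` can be traded for a larger constant `C' = C + c·a/U₀ + c|log h₀|`, because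
the RHS is `≥ 0` and outside those ranges the LHS is `≤ 0`. A prover may therefore fix `U₀` and
`h₀` at will (or drop them). [folklore] -/
theorem crux_iff_core : Crux ↔ TwSourcedCondensationCore := by
  rw [crux_iff]
  constructor
  · intro H μ₁ μ₂ h1 h2 h3
    obtain ⟨U₀, a, c, C, h₀, hU₀, ha, hc, hC, hh₀, H⟩ := H μ₁ μ₂ h1 h2 h3
    refine ⟨a, c, C + c * (a / U₀) + c * |Real.log h₀|, ha, hc, by positivity, ?_⟩
    intro U hU β hβ1 hβa μ hμ
    have hβ : 0 < β := by linarith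
    by_cases hUU : U ≤ U₀
    · obtain ⟨L₀, hL₀⟩ := H U hU hUU β hβ1 hβa μ hμ
      refine ⟨L₀, fun L _ hL h => ?_⟩
      have e1 : 0 ≤ c * (a / U₀) * h ^ 2 := by positivity
      have e2 : 0 ≤ c * |Real.log h₀| * h ^ 2 := by positivity
      by_cases hh : |h| ≤ h₀
      · have := hL₀ L hL h hh
        nlinarith
      · push Not at hh
        have hlog := log_cutoff_le_of_lt hβ hh₀ hh
        have hR := pTilde_sub_nonneg L hβ.le U μ h
        have e3 : c * h ^ 2 * Real.log (1 / (|h| + 1 / β)) ≤ c * h ^ 2 * |Real.log h₀| :=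
          mul_le_mul_of_nonneg_left hlog (by positivity)
        have e4 : 0 ≤ C * h ^ 2 := by positivity
        nlinarith
    · push Not at hUU
      refine ⟨0, fun L _ _ h => ?_⟩
      have hlog : Real.log (1 / (|h| + 1 / β)) ≤ a / U₀ := by
        calc Real.log (1 / (|h| + 1 / β)) ≤ Real.log β := log_cutoff_le_log hβ h
          _ ≤ a / U := by rw [← Real.log_exp (a / U)]; exact Real.log_le_log hβ hβa
          _ ≤ a / U₀ := div_le_div_of_nonneg_left ha.le hU₀ hUU.le
      have hR := pTilde_sub_nonneg L hβ.le U μ h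
      have e2 : 0 ≤ c * |Real.log h₀| * h ^ 2 := by positivity
      have e3 : c * h ^ 2 * Real.log (1 / (|h| + 1 / β)) ≤ c * h ^ 2 * (a / U₀) :=
        mul_le_mul_of_nonneg_left hlog (by positivity)
      have e4 : 0 ≤ C * h ^ 2 := by positivity
      nlinarith
  · intro H μ₁ μ₂ h1 h2 h3
    obtain ⟨a, c, C, ha, hc, hC, H⟩ := H μ₁ μ₂ h1 h2 h3
    refine ⟨1, a, c, C, 1, one_pos, ha, hc, hC, one_pos, fun U hU _ β hβ1 hβa μ hμ => ?_⟩
    obtain ⟨L₀, hL₀⟩ := H U hU β hβ1 hβa μ hμ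
    exact ⟨L₀, fun L _ hL h _ => hL₀ L hL h⟩

/-- The crux restricted to POSITIVE sources `0 < h ≤ h₀`. -/
def TwSourcedCondensationPos : Prop :=
  ∀ μ₁ μ₂ : ℝ, -4 < μ₁ → μ₁ ≤ μ₂ → μ₂ < 0 → ∃ U₀ a c C h₀ : ℝ, 0 < U₀ ∧ 0 < a ∧ 0 < c ∧ 0 < C ∧
    0 < h₀ ∧ ∀ U : ℝ, 0 < U → U ≤ U₀ → ∀ β : ℝ, 1 ≤ β → β ≤ Real.exp (a / U) →
    ∀ μ ∈ Set.Icc μ₁ μ₂, ∃ L₀ : ℕ, ∀ (L : ℕ) [NeZero L], L₀ ≤ L → ∀ h : ℝ, 0 < h → h ≤ h₀ →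
      c * h ^ 2 * Real.log (1 / (|h| + 1 / β)) - C * h ^ 2 ≤ pTilde β L U μ h - pTilde β L U μ 0

/-- **`TwSourcedCondensation ↔ TwSourcedCondensationPos`**: by evenness (`p̃_L(-h) = p̃_L(h)`, gauge
rotation by `i`) and `h = 0` being an equality, only positive sources matter. [folklore] -/
theorem crux_iff_pos : Crux ↔ TwSourcedCondensationPos := by
  rw [crux_iff]
  constructor
  · intro H μ₁ μ₂ h1 h2 h3
    obtain ⟨U₀, a, c, C, h₀, hU₀, ha, hc, hC, hh₀, H⟩ := H μ₁ μ₂ h1 h2 h3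
    refine ⟨U₀, a, c, C, h₀, hU₀, ha, hc, hC, hh₀, fun U hU hUU β hβ1 hβa μ hμ => ?_⟩
    obtain ⟨L₀, hL₀⟩ := H U hU hUU β hβ1 hβa μ hμ
    exact ⟨L₀, fun L _ hL h hh hhh => hL₀ L hL h (by rwa [abs_of_pos hh])⟩
  · intro H μ₁ μ₂ h1 h2 h3
    obtain ⟨U₀, a, c, C, h₀, hU₀, ha, hc, hC, hh₀, H⟩ := H μ₁ μ₂ h1 h2 h3
    refine ⟨U₀, a, c, C, h₀, hU₀, ha, hc, hC, hh₀, fun U hU hUU β hβ1 hβa μ hμ => ?_⟩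
    obtain ⟨L₀, hL₀⟩ := H U hU hUU β hβ1 hβa μ hμ
    refine ⟨L₀, fun L _ hL h hh => ?_⟩
    rcases lt_trichotomy h 0 with hneg | rfl | hpos
    · have := hL₀ L hL (-h) (neg_pos.2 hneg) (by rwa [abs_of_neg hneg] at hh)
      rwa [abs_neg, neg_sq, pTilde_neg] at this
    · simp
    · exact hL₀ L hL h hpos (by rwa [abs_of_pos hpos] at hh)

end LoadBearing

/-! ## §6 Tightness at finite volume: the response is at most QUADRATIC in `h` (with an
`L`-dependent constant), so the temperature cutoff inside the logarithm and the order `h²` are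
load-bearing -/

section Quadratic

open intervalIntegral

/-- The Duhamel kernel is at most the SUM of the two Boltzmann weights (logarithmic mean ≤ max).
[folklore] -/
theorem duhamelKernel_le_add (β x y : ℝ) :
    duhamelKernel β x y ≤ Real.exp (-(β * x)) + Real.exp (-(β * y)) := by
  have hconst : ∫ _ in (0 : ℝ)..1, (Real.exp (-(β * x)) + Real.exp (-(β * y))) =
      Real.exp (-(β * x)) + Real.exp (-(β * y)) := by simp
  rw [duhamelKernel, ← hconst]
  refine intervalIntegral.integral_mono_on zero_le_one
    ((continuous_duhamelKernel_integrand β x y).intervalIntegrable _ _) (by simp) fun s hs => ?_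
  obtain ⟨hs0, hs1⟩ := hs
  have key : -(β * (s * y + (1 - s) * x)) = s * (-(β * y)) + (1 - s) * (-(β * x)) := by ring
  rw [key]
  rcases le_total (-(β * x)) (-(β * y)) with hxy | hxy
  · calc Real.exp (s * -(β * y) + (1 - s) * -(β * x)) ≤ Real.exp (-(β * y)) :=
          Real.exp_le_exp.2 (by nlinarith)
      _ ≤ _ := le_add_of_nonneg_left (Real.exp_pos _).le
  · calc Real.exp (s * -(β * y) + (1 - s) * -(β * x)) ≤ Real.exp (-(β * x)) :=
          Real.exp_le_exp.2 (by nlinarith)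
      _ ≤ _ := le_add_of_nonneg_right (Real.exp_pos _).le

variable {m : Type*} [Fintype m] [DecidableEq m]

/-- **The Duhamel two-point function is bounded by the norm**: `(A, A)_{β,H} ≤ 2‖A‖²` for
Hermitian `H`, `A` (pair-sum form, kernel ≤ sum of weights, `⟨A²⟩ ≤ ‖A‖²`). [folklore] -/
theorem re_duhamel_self_le {H A : Matrix m m ℂ} (hH : H.IsHermitian) (hA : A.IsHermitian)
    [Nonempty m] (β : ℝ) : (duhamel β H A A).re ≤ 2 * ‖A‖ ^ 2 := by
  rw [hH.re_duhamel_self hA β]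
  set V := (hH.eigenvectorUnitary : Matrix m m ℂ) with hV
  set E := hH.eigenvalues with hE
  set a := star V * A * V with ha
  set w : m → ℝ := fun i => Real.exp (-(β * E i)) with hw
  have hZ : 0 < ∑ i, w i := sum_pos (fun i _ => Real.exp_pos _) univ_nonempty
  have hsymm : ∀ i j, ‖a i j‖ = ‖a j i‖ := by
    intro i j
    have haH : aᴴ = a := by
      rw [ha, conjTranspose_mul, conjTranspose_mul, hA.eq, star_eq_conjTranspose,
        conjTranspose_conjTranspose, Matrix.mul_assoc]
    have hij : aᴴ i j = a i j := by rw [haH]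
    rw [conjTranspose_apply] at hij
    rw [← hij, norm_star]
  have hsq : (gibbsState β H (A * A)).re = (∑ i, w i)⁻¹ * ∑ i, ∑ j, ‖a i j‖ ^ 2 * w i :=
    hH.re_gibbsState_sq hA β
  have hbound : (gibbsState β H (A * A)).re ≤ ‖A‖ ^ 2 := by
    calc (gibbsState β H (A * A)).re ≤ |(gibbsState β H (A * A)).re| := le_abs_self _
      _ ≤ ‖A * A‖ := abs_re_gibbsState_le hH β _
      _ ≤ ‖A‖ * ‖A‖ := norm_mul_le _ _
      _ = ‖A‖ ^ 2 := (sq _).symm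
  have hswap : ∑ i, ∑ j, ‖a i j‖ ^ 2 * w j = ∑ i, ∑ j, ‖a i j‖ ^ 2 * w i := by
    rw [Finset.sum_comm]
    refine sum_congr rfl fun i _ => sum_congr rfl fun j _ => ?_
    rw [hsymm j i]
  calc (∑ i, w i)⁻¹ * ∑ i, ∑ j, ‖a i j‖ ^ 2 * duhamelKernel β (E i) (E j)
      ≤ (∑ i, w i)⁻¹ * ∑ i, ∑ j, ‖a i j‖ ^ 2 * (w i + w j) := by
        refine mul_le_mul_of_nonneg_left (sum_le_sum fun i _ => sum_le_sum fun j _ =>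
          mul_le_mul_of_nonneg_left (duhamelKernel_le_add β _ _) (sq_nonneg _)) (inv_nonneg.2 hZ.le)
    _ = 2 * (gibbsState β H (A * A)).re := by
        rw [hsq]
        simp only [mul_add, Finset.sum_add_distrib]
        rw [hswap]
        ring
    _ ≤ 2 * ‖A‖ ^ 2 := by linarith

/-- **The sourced magnetisation grows at most linearly**: if `⟨A⟩_{β,H} = 0` then
`Re⟨A⟩_{β, H - tA} ≤ 2β‖A‖² t` for `t > 0` (mean value theorem for the susceptibility formula
`m' = β((A,A) - m²) ≤ 2β‖A‖²`). [folklore] -/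
theorem re_gibbsState_source_le {H A : Matrix m m ℂ} (hH : H.IsHermitian) (hA : A.IsHermitian)
    [Nonempty m] {β : ℝ} (hβ : 0 < β) (h0 : (gibbsState β H A).re = 0) {t : ℝ} (ht : 0 < t) :
    (gibbsState β (H - (t : ℂ) • A) A).re ≤ 2 * β * ‖A‖ ^ 2 * t := by
  set f : ℝ → ℝ := fun s => (gibbsState β (H - (s : ℂ) • A) A).re with hf
  set f' : ℝ → ℝ := fun s => β * ((duhamel β (H - (s : ℂ) • A) A A).re -
    (gibbsState β (H - (s : ℂ) • A) A).re ^ 2) with hf'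
  have hd : ∀ s, HasDerivAt f (f' s) s := fun s => hasDerivAt_re_gibbsState_source hH hA hβ s
  obtain ⟨ξ, -, hslope⟩ := exists_hasDerivAt_eq_slope f f' ht
    (fun s _ => (hd s).continuousAt.continuousWithinAt) (fun s _ => hd s)
  have hf0 : f 0 = 0 := by simp [hf, h0]
  have hbound : f' ξ ≤ 2 * β * ‖A‖ ^ 2 := by
    have h1 := re_duhamel_self_le (isHermitian_sub_smul hH hA ξ) hA β
    have h2 : 0 ≤ (gibbsState β (H - (ξ : ℂ) • A) A).re ^ 2 := sq_nonneg _
    have h3 : f' ξ = β * ((duhamel β (H - (ξ : ℂ) • A) A A).re -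
      (gibbsState β (H - (ξ : ℂ) • A) A).re ^ 2) := rfl
    rw [h3]
    nlinarith
  have hft : f t = f' ξ * t := by
    rw [hslope, hf0, sub_zero, sub_zero, div_mul_cancel₀ _ ht.ne']
  calc (gibbsState β (H - (t : ℂ) • A) A).re = f t := rfl
    _ = f' ξ * t := hft
    _ ≤ 2 * β * ‖A‖ ^ 2 * t := mul_le_mul_of_nonneg_right hbound ht.le

variable (L : ℕ) [NeZero L]

/-- **Quadratic upper bound at finite volume** (numerator form, `h > 0`):
`log Z_β(H_{L,h}) - log Z_β(H_{L,0}) ≤ 2β²‖Δ_d + Δ_d†‖² h² ≤ 2β²(2K_d L²)² h²`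
(Bogoliubov's inequality at `H_{L,h}` plus the linear growth of `⟨Δ_d + Δ_d†⟩_h`). [folklore] -/
theorem log_partitionFn_sub_le_quadratic {β : ℝ} (hβ : 0 < β) (U μ : ℝ) {h : ℝ} (hh : 0 < h) :
    Real.log (partitionFn β (dWaveSourceTorus L U μ h)).re -
        Real.log (partitionFn β (dWaveSourceTorus L U μ 0)).re ≤
      2 * β ^ 2 * (2 * Kd * (L : ℝ) ^ 2) ^ 2 * h ^ 2 := by
  set Q := pairField dWaveFormFactor L + (pairField dWaveFormFactor L)ᴴ with hQdef
  have hK := isHermitian_hubbardTorusWith L 1 U μ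
  have hQ : Q.IsHermitian := isHermitian_pairField_add_conjTranspose L
  have hKh : (hubbardTorusWith 2 L 1 U μ - (h : ℂ) • Q).IsHermitian := isHermitian_sub_smul hK hQ h
  have hW : ((h : ℂ) • Q).IsHermitian := isHermitian_real_smul hQ h
  -- linear growth of the sourced pair expectation
  have hmag := re_gibbsState_source_le hK hQ hβ
    (by rw [hQdef, gibbsState_hubbardTorusWith_pairSource, Complex.zero_re]) hh
  -- Bogoliubov's inequality at the sourced Hamiltonian, perturbation `+hQ`
  have hPB := log_partitionFn_sub_le_log_partitionFn_add hKh hW β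
  rw [sub_add_cancel, map_smul, smul_eq_mul, Complex.re_ofReal_mul] at hPB
  have hnorm : ‖Q‖ ≤ 2 * Kd * (L : ℝ) ^ 2 := norm_pairSource_le L
  have hQn : 0 ≤ ‖Q‖ := norm_nonneg _
  have hsq : ‖Q‖ ^ 2 ≤ (2 * Kd * (L : ℝ) ^ 2) ^ 2 := pow_le_pow_left₀ hQn hnorm 2
  have hK0 : dWaveSourceTorus L U μ 0 = hubbardTorusWith 2 L 1 U μ := dWaveSourceTorus_zero L U μ
  have hKh' : dWaveSourceTorus L U μ h = hubbardTorusWith 2 L 1 U μ - (h : ℂ) • Q := rfl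
  rw [hK0, hKh']
  have step : β * (h * (gibbsState β (hubbardTorusWith 2 L 1 U μ - (h : ℂ) • Q) Q).re) ≤
      β * (h * (2 * β * ‖Q‖ ^ 2 * h)) :=
    mul_le_mul_of_nonneg_left (mul_le_mul_of_nonneg_left hmag hh.le) hβ.le
  have step2 : β * (h * (2 * β * ‖Q‖ ^ 2 * h)) ≤ 2 * β ^ 2 * (2 * Kd * (L : ℝ) ^ 2) ^ 2 * h ^ 2 := by
    have : 0 ≤ β ^ 2 * h ^ 2 := by positivity
    nlinarith
  linarith

/-- **Quadratic upper bound for the response**: `p̃_L(h) - p̃_L(0) ≤ 8 β K_d² L² h²` for `β > 0`,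
every `L ≥ 1`, all `U, μ` and ALL real `h` (evenness for `h < 0`). The finite-volume response is
`O(h²)` as `h → 0` — with a constant that may (and physically does, like `χ_L(β) ~ log β`) grow
with `β` and `L`. [folklore] -/
theorem pTilde_sub_le_quadratic {β : ℝ} (hβ : 0 < β) (U μ h : ℝ) :
    pTilde β L U μ h - pTilde β L U μ 0 ≤ 8 * β * Kd ^ 2 * (L : ℝ) ^ 2 * h ^ 2 := by
  have hL : (0 : ℝ) < (L : ℝ) ^ 2 := cast_sq_pos_of_neZero L
  have hden : 0 < β * (L : ℝ) ^ 2 := mul_pos hβ hL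
  have pos_case : ∀ {k : ℝ}, 0 < k →
      pTilde β L U μ k - pTilde β L U μ 0 ≤ 8 * β * Kd ^ 2 * (L : ℝ) ^ 2 * k ^ 2 := by
    intro k hk
    rw [pTilde, pTilde, ← sub_div, div_le_iff₀ hden]
    calc Real.log (partitionFn β (dWaveSourceTorus L U μ k)).re -
          Real.log (partitionFn β (dWaveSourceTorus L U μ 0)).re
        ≤ 2 * β ^ 2 * (2 * Kd * (L : ℝ) ^ 2) ^ 2 * k ^ 2 := log_partitionFn_sub_le_quadratic L hβ U μ hk
      _ = 8 * β * Kd ^ 2 * (L : ℝ) ^ 2 * k ^ 2 * (β * (L : ℝ) ^ 2) := by ring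
  rcases lt_trichotomy h 0 with hneg | rfl | hpos
  · have := pos_case (neg_pos.2 hneg)
    rwa [pTilde_neg, neg_sq] at this
  · simp
  · exact pos_case hpos

/-! ### 6a. The temperature cutoff inside the logarithm is load-bearing -/

/-- The crux with the cutoff logarithm replaced by the bare `log(1/|h|)` (no `1/β`). -/
def TwSourcedCondensationNoCutoff : Prop :=
  ∀ μ₁ μ₂ : ℝ, -4 < μ₁ → μ₁ ≤ μ₂ → μ₂ < 0 → ∃ U₀ a c C h₀ : ℝ, 0 < U₀ ∧ 0 < a ∧ 0 < c ∧ 0 < C ∧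
    0 < h₀ ∧ ∀ U : ℝ, 0 < U → U ≤ U₀ → ∀ β : ℝ, 1 ≤ β → β ≤ Real.exp (a / U) →
    ∀ μ ∈ Set.Icc μ₁ μ₂, ∃ L₀ : ℕ, ∀ (L : ℕ) [NeZero L], L₀ ≤ L → ∀ h : ℝ, |h| ≤ h₀ →
      c * h ^ 2 * Real.log (1 / |h|) - C * h ^ 2 ≤ pTilde β L U μ h - pTilde β L U μ 0

/-- **FALSE without the temperature cutoff in the logarithm**: at fixed `(U, β, L)` the response is
`≤ B h²` (`B = 8βK_d²L²`, `pTilde_sub_le_quadratic`) while `c h² log(1/|h|) - C h²` exceeds `B h²`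
as soon as `log(1/|h|) > (C + B)/c`. The finite-volume susceptibility is finite: every lower bound
must saturate as `h → 0` at fixed `β`, which is what `1/β` inside the logarithm does. [folklore] -/
theorem twSourcedCondensation_false_noCutoff : ¬ TwSourcedCondensationNoCutoff := by
  intro H
  obtain ⟨U₀, a, c, C, h₀, hU₀, ha, hc, hC, hh₀, H⟩ := H (-2) (-2) (by norm_num) le_rfl (by norm_num)
  obtain ⟨L₀, hL₀⟩ := H U₀ hU₀ le_rfl 1 le_rfl (Real.one_le_exp (div_nonneg ha.le hU₀.le)) (-2)
    ⟨le_rfl, le_rfl⟩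
  set B : ℝ := 8 * 1 * Kd ^ 2 * ((L₀ + 1 : ℕ) : ℝ) ^ 2 with hB
  have hBnn : 0 ≤ B := by positivity
  set h : ℝ := min h₀ (Real.exp (-((C + B) / c + 1))) with hh
  have hhpos : 0 < h := lt_min hh₀ (Real.exp_pos _)
  have key := hL₀ (L₀ + 1) (Nat.le_succ _) h (by rw [abs_of_pos hhpos]; exact min_le_left _ _)
  have hquad := pTilde_sub_le_quadratic (L₀ + 1) one_pos U₀ (-2) h
  rw [abs_of_pos hhpos, one_div, Real.log_inv] at key
  have hlogh : Real.log h ≤ -((C + B) / c + 1) := by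
    rw [Real.log_le_iff_le_exp hhpos]; exact min_le_right _ _
  have h2 : C + B + c ≤ c * -Real.log h := by
    have : (C + B) / c + 1 ≤ -Real.log h := by linarith
    have hcc : (C + B) / c * c = C + B := div_mul_cancel₀ _ hc.ne'
    nlinarith
  have h3 : 0 < h ^ 2 := by positivity
  have h4 : 0 < c * h ^ 2 := by positivity
  nlinarith [mul_le_mul_of_nonneg_left h2 h3.le]

/-! ### 6b. The ORDER `h²` is load-bearing: no first-order (symmetry-breaking-like) response at
finite volume -/

/-- A first-order response claim: `c|h| ≤ p̃_L(h) - p̃_L(0)` eventually in `L`, for small `|h|`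
(what a spontaneously broken `U(1)` would give in the thermodynamic limit, transplanted to the
finite-volume quantifier structure of the crux). -/
def TwSourcedCondensationLinearResponse : Prop :=
  ∀ μ₁ μ₂ : ℝ, -4 < μ₁ → μ₁ ≤ μ₂ → μ₂ < 0 → ∃ U₀ a c h₀ : ℝ, 0 < U₀ ∧ 0 < a ∧ 0 < c ∧ 0 < h₀ ∧
    ∀ U : ℝ, 0 < U → U ≤ U₀ → ∀ β : ℝ, 1 ≤ β → β ≤ Real.exp (a / U) →
    ∀ μ ∈ Set.Icc μ₁ μ₂, ∃ L₀ : ℕ, ∀ (L : ℕ) [NeZero L], L₀ ≤ L → ∀ h : ℝ, |h| ≤ h₀ →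
      c * |h| ≤ pTilde β L U μ h - pTilde β L U μ 0

/-- **FALSE: no linear response at finite volume** (`c|h| ≤ B h²` fails for `0 < h < c/B`).
Any every-`L ≥ L₀` lower bound must be `O(h²)` as `h → 0`; the crux's `h² log(1/(|h|+1/β))` is. [folklore] -/
theorem twSourcedCondensation_false_linearResponse : ¬ TwSourcedCondensationLinearResponse := by
  intro H
  obtain ⟨U₀, a, c, h₀, hU₀, ha, hc, hh₀, H⟩ := H (-2) (-2) (by norm_num) le_rfl (by norm_num)
  obtain ⟨L₀, hL₀⟩ := H U₀ hU₀ le_rfl 1 le_rfl (Real.one_le_exp (div_nonneg ha.le hU₀.le)) (-2)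
    ⟨le_rfl, le_rfl⟩
  set B : ℝ := 8 * 1 * Kd ^ 2 * ((L₀ + 1 : ℕ) : ℝ) ^ 2 with hB
  have hBnn : 0 ≤ B := by positivity
  set h : ℝ := min h₀ (c / (2 * (B + 1))) with hh
  have hhpos : 0 < h := lt_min hh₀ (by positivity)
  have key := hL₀ (L₀ + 1) (Nat.le_succ _) h (by rw [abs_of_pos hhpos]; exact min_le_left _ _)
  have hquad := pTilde_sub_le_quadratic (L₀ + 1) one_pos U₀ (-2) h
  rw [abs_of_pos hhpos] at key
  have hsmall : h * (2 * (B + 1)) ≤ c := by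
    have := min_le_right h₀ (c / (2 * (B + 1)))
    rwa [← hh, le_div_iff₀ (by positivity)] at this
  -- `c h ≤ B h² ≤ (B+1) h · h ≤ (c/2) h < c h`
  nlinarith [mul_pos hc hhpos]

end Quadratic

/-! ## §7 The finite-volume obstruction behind `∃ L₀`: a gapped, non-degenerate ground state caps
the response UNIFORMLY in `β`, so `L₀(U,β,μ) → ∞` as `β → ∞` is forced at non-resonant `μ` -/

section Gapped

variable {m : Type*} [Fintype m] [DecidableEq m]

/-- A unit coordinate vector, to witness nonemptiness of Rayleigh sets. [folklore] -/
theorem star_single_dotProduct_single (i : m) :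
    star (Pi.single i (1 : ℂ)) ⬝ᵥ Pi.single i (1 : ℂ) = 1 := by
  simp [dotProduct, Pi.single_apply]

/-- `c ≤ E₀(A)` as soon as `c ≤ Re⟨φ, Aφ⟩` for every unit vector (variational principle, attained
form `minEnergyOn_top`). [folklore] -/
theorem le_groundEnergy_of_forall_rayleigh {A : Matrix m m ℂ} (hA : A.IsHermitian) [Nonempty m]
    {c : ℝ} (hc : ∀ φ : m → ℂ, star φ ⬝ᵥ φ = 1 → c ≤ (star φ ⬝ᵥ A *ᵥ φ).re) :
    c ≤ A.groundEnergy := by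
  rw [← minEnergyOn_top_holds hA]
  obtain ⟨i⟩ := ‹Nonempty m›
  refine le_csInf ⟨_, Pi.single i 1, Submodule.mem_top, star_single_dotProduct_single i, rfl⟩ ?_
  rintro E ⟨φ, -, hφ1, rfl⟩
  exact hc φ hφ1

/-- **Second-order variational bound for a gapped non-degenerate ground state.**
If `Re⟨φ,Hφ⟩ ≥ E₀ + γ(1 - |⟨ψ₀,φ⟩|²)` for all unit `φ` (i.e. `H ≥ E₀ + γ(1 - |ψ₀⟩⟨ψ₀|)`, `γ > 0`,
`ψ₀` unit) and the source has no first-order matrix element `⟨ψ₀,Qψ₀⟩ = 0`, then for every real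
`h` and every unit `φ`: `Re⟨φ,(H - hQ)φ⟩ ≥ E₀ - h²‖Q‖²/γ`. (Write `φ = αψ₀ + χ`; then
`|⟨φ,Qφ⟩| ≤ 2‖Q‖‖χ‖` and `γ‖χ‖² - 2|h|‖Q‖‖χ‖ ≥ -h²‖Q‖²/γ`.) [folklore] -/
theorem rayleigh_source_ge_of_gap {H Q : Matrix m m ℂ} {ψ₀ : m → ℂ} (hψ₀ : star ψ₀ ⬝ᵥ ψ₀ = 1)
    {E₀ γ : ℝ} (hγ : 0 < γ)
    (hgap : ∀ φ : m → ℂ, star φ ⬝ᵥ φ = 1 →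
      E₀ + γ * (1 - ‖star ψ₀ ⬝ᵥ φ‖ ^ 2) ≤ (star φ ⬝ᵥ H *ᵥ φ).re)
    (h1 : star ψ₀ ⬝ᵥ Q *ᵥ ψ₀ = 0) (h : ℝ) (φ : m → ℂ) (hφ : star φ ⬝ᵥ φ = 1) :
    E₀ - h ^ 2 * ‖Q‖ ^ 2 / γ ≤ (star φ ⬝ᵥ (H - (h : ℂ) • Q) *ᵥ φ).re := by
  set α : ℂ := star ψ₀ ⬝ᵥ φ with hα
  set χ : m → ℂ := φ - α • ψ₀ with hχ
  have hφ1 : eucNorm φ = 1 := eucNorm_eq_one hφ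
  have hψ1 : eucNorm ψ₀ = 1 := eucNorm_eq_one hψ₀
  -- `‖χ‖² = 1 - |α|²`
  have hdecomp : φ = χ + α • ψ₀ := by rw [hχ, sub_add_cancel]
  have hχψ : star ψ₀ ⬝ᵥ χ = 0 := by
    rw [hχ, dotProduct_sub, dotProduct_smul, hψ₀, smul_eq_mul, mul_one, ← hα, sub_self]
  have hχsq : eucNorm χ ^ 2 = 1 - ‖α‖ ^ 2 := by
    have hstarχ : star χ = star φ - star α • star ψ₀ := by
      rw [hχ, star_sub, star_smul]
    have e1 : star χ ⬝ᵥ χ = star φ ⬝ᵥ φ - star α * (star ψ₀ ⬝ᵥ φ) - α * (star φ ⬝ᵥ ψ₀) +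
        star α * α * (star ψ₀ ⬝ᵥ ψ₀) := by
      rw [hstarχ, hχ, sub_dotProduct, dotProduct_sub, dotProduct_sub, smul_dotProduct, smul_dotProduct,
        dotProduct_smul, dotProduct_smul]
      simp only [smul_eq_mul]
      ring
    have e2 : star φ ⬝ᵥ ψ₀ = star α := by
      rw [hα, ← star_dotProduct_star, star_star]  -- star (star ψ₀ ⬝ᵥ φ) = star φ ⬝ᵥ ψ₀ ?
    rw [eucNorm_sq, e1, hφ, hψ₀, ← hα, e2]
    have : star α * α = ((‖α‖ ^ 2 : ℝ) : ℂ) := by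
      rw [Complex.star_def, mul_comm, Complex.mul_conj, Complex.normSq_eq_norm_sq]
    rw [mul_one, this]
    simp only [Complex.sub_re, Complex.add_re, Complex.one_re, Complex.ofReal_re]
    have hre' : (α * star α).re = ‖α‖ ^ 2 := by
      rw [mul_comm, this, Complex.ofReal_re]
    rw [hre']
    ring
  -- `|⟨φ, Qφ⟩| ≤ 2‖Q‖‖χ‖`
  have hQφ : ‖star φ ⬝ᵥ Q *ᵥ φ‖ ≤ 2 * ‖Q‖ * eucNorm χ := by
    have hsplit : star φ ⬝ᵥ Q *ᵥ φ = star χ ⬝ᵥ Q *ᵥ φ + star α * (star ψ₀ ⬝ᵥ Q *ᵥ χ) := by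
      have e : star φ = star χ + star α • star ψ₀ := by
        rw [hdecomp, star_add, star_smul]
      have e3 : star ψ₀ ⬝ᵥ Q *ᵥ φ = star ψ₀ ⬝ᵥ Q *ᵥ χ := by
        rw [hdecomp, mulVec_add, mulVec_smul, dotProduct_add, dotProduct_smul, h1, smul_zero, add_zero]
      calc star φ ⬝ᵥ Q *ᵥ φ = (star χ + star α • star ψ₀) ⬝ᵥ Q *ᵥ φ := by rw [e]
        _ = star χ ⬝ᵥ Q *ᵥ φ + star α * (star ψ₀ ⬝ᵥ Q *ᵥ φ) := by
            rw [add_dotProduct, smul_dotProduct, smul_eq_mul]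
        _ = star χ ⬝ᵥ Q *ᵥ φ + star α * (star ψ₀ ⬝ᵥ Q *ᵥ χ) := by rw [e3]
    rw [hsplit]
    have t1 : ‖star χ ⬝ᵥ Q *ᵥ φ‖ ≤ ‖Q‖ * eucNorm χ := by
      calc ‖star χ ⬝ᵥ Q *ᵥ φ‖ ≤ eucNorm χ * eucNorm (Q *ᵥ φ) := norm_star_dotProduct_le _ _
        _ ≤ eucNorm χ * (‖Q‖ * eucNorm φ) :=
            mul_le_mul_of_nonneg_left (eucNorm_mulVec_le Q φ) (eucNorm_nonneg _)
        _ = ‖Q‖ * eucNorm χ := by rw [hφ1, mul_one, mul_comm]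
    have t2 : ‖star α * (star ψ₀ ⬝ᵥ Q *ᵥ χ)‖ ≤ ‖Q‖ * eucNorm χ := by
      have hαle : ‖α‖ ≤ 1 := by
        have := eucNorm_nonneg χ
        nlinarith [hχsq, norm_nonneg α, sq_nonneg (eucNorm χ)]
      calc ‖star α * (star ψ₀ ⬝ᵥ Q *ᵥ χ)‖ = ‖α‖ * ‖star ψ₀ ⬝ᵥ Q *ᵥ χ‖ := by
            rw [norm_mul, norm_star]
        _ ≤ 1 * (eucNorm ψ₀ * eucNorm (Q *ᵥ χ)) :=
            mul_le_mul hαle (norm_star_dotProduct_le _ _) (norm_nonneg _) zero_le_one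
        _ ≤ ‖Q‖ * eucNorm χ := by
            rw [one_mul, hψ1, one_mul]; exact eucNorm_mulVec_le Q χ
    calc ‖star χ ⬝ᵥ Q *ᵥ φ + star α * (star ψ₀ ⬝ᵥ Q *ᵥ χ)‖
        ≤ ‖star χ ⬝ᵥ Q *ᵥ φ‖ + ‖star α * (star ψ₀ ⬝ᵥ Q *ᵥ χ)‖ := norm_add_le _ _
      _ ≤ 2 * ‖Q‖ * eucNorm χ := by linarith
  -- assemble
  have hH := hgap φ hφ
  rw [← hχsq] at hH
  have hform : (star φ ⬝ᵥ (H - (h : ℂ) • Q) *ᵥ φ).re =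
      (star φ ⬝ᵥ H *ᵥ φ).re - h * (star φ ⬝ᵥ Q *ᵥ φ).re := by
    rw [sub_mulVec, dotProduct_sub, smul_mulVec, dotProduct_smul, Complex.sub_re, smul_eq_mul,
      Complex.re_ofReal_mul]
  rw [hform]
  have hre : |(star φ ⬝ᵥ Q *ᵥ φ).re| ≤ 2 * ‖Q‖ * eucNorm χ :=
    (Complex.abs_re_le_norm _).trans hQφ
  have hprod : |h * (star φ ⬝ᵥ Q *ᵥ φ).re| ≤ |h| * (2 * ‖Q‖ * eucNorm χ) := by
    rw [abs_mul]; exact mul_le_mul_of_nonneg_left hre (abs_nonneg h)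
  have hx := eucNorm_nonneg χ
  have hQn := norm_nonneg Q
  -- `γ x² - 2|h|‖Q‖x ≥ -h²‖Q‖²/γ`
  have hsq : -(h ^ 2 * ‖Q‖ ^ 2 / γ) ≤ γ * eucNorm χ ^ 2 - 2 * |h| * ‖Q‖ * eucNorm χ := by
    set b : ℝ := |h| * ‖Q‖ with hb
    set x : ℝ := eucNorm χ with hxdef
    have hb2 : b ^ 2 = h ^ 2 * ‖Q‖ ^ 2 := by rw [hb, mul_pow, sq_abs]
    have h4 : γ * (γ * x ^ 2 - 2 * b * x + b ^ 2 / γ) = (γ * x - b) ^ 2 := by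
      field_simp
      ring
    have h5 : 0 ≤ γ * x ^ 2 - 2 * b * x + b ^ 2 / γ := by
      have : 0 ≤ γ * (γ * x ^ 2 - 2 * b * x + b ^ 2 / γ) := by rw [h4]; exact sq_nonneg _
      exact (mul_nonneg_iff_of_pos_left hγ).mp this
    rw [← hb2]
    have hbx : 2 * |h| * ‖Q‖ * x = 2 * b * x := by rw [hb]; ring
    rw [hbx]
    linarith
  linarith [le_abs_self (h * (star φ ⬝ᵥ Q *ᵥ φ).re), hprod]

/-- Hence the sourced ground energy drops at most quadratically, UNIFORMLY in the volume's
temperature-independent data: `E₀(H - hQ) ≥ E₀ - h²‖Q‖²/γ`. [folklore] -/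
theorem groundEnergy_source_ge_of_gap {H Q : Matrix m m ℂ} (hH : H.IsHermitian) (hQ : Q.IsHermitian)
    [Nonempty m] {ψ₀ : m → ℂ} (hψ₀ : star ψ₀ ⬝ᵥ ψ₀ = 1) {E₀ γ : ℝ} (hγ : 0 < γ)
    (hgap : ∀ φ : m → ℂ, star φ ⬝ᵥ φ = 1 →
      E₀ + γ * (1 - ‖star ψ₀ ⬝ᵥ φ‖ ^ 2) ≤ (star φ ⬝ᵥ H *ᵥ φ).re)
    (h1 : star ψ₀ ⬝ᵥ Q *ᵥ ψ₀ = 0) (h : ℝ) :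
    E₀ - h ^ 2 * ‖Q‖ ^ 2 / γ ≤ (H - (h : ℂ) • Q).groundEnergy :=
  le_groundEnergy_of_forall_rayleigh (isHermitian_sub_smul hH hQ h)
    (rayleigh_source_ge_of_gap hψ₀ hγ hgap h1 h)

/-- **Gapped clusters have `β`-uniformly bounded response**: under the same hypotheses, with
`E₀ = E₀(H)` the ground energy, for every `β ≥ 0` and every real `h`,
`log Z_β(H - hQ) - log Z_β(H) ≤ β h²‖Q‖²/γ + log dim`
(entropy sandwich `e^{-βE₀} ≤ Z ≤ dim·e^{-βE₀}` on both sides). Divided by `βL²` this is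
`p̃(h) - p̃(0) ≤ h²‖Q‖²/(γL²) + log dim/(βL²)`: NO `log β` growth — a fixed gapped torus can never
carry the crux's `c h² log(1/(|h|+1/β))` as `β → ∞`. This is the mechanism that makes `∃ L₀` (with
`L₀ = L₀(U,β,μ)`) load-bearing beyond the trivial `L = 1` case: for every fixed `L` and every
chemical potential at which the finite cluster has a unique gapped ground state (all but finitely
many `μ` at `U = 0`, an open dense set for small `U`), the inequality of the crux FAILS for `β`
large, so `L₀(U,β,μ) → ∞` as `β → ∞` is forced. (The complementary resonant case — `μ` at a shell
level, Curie response `~β` — is what kills the `∀ L` version of the sibling crux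
`TwSourcedInertness`, see its workfile §D.) [folklore] -/
theorem log_partitionFn_source_sub_le_of_gap {H Q : Matrix m m ℂ} (hH : H.IsHermitian)
    (hQ : Q.IsHermitian) [Nonempty m] {ψ₀ : m → ℂ} (hψ₀ : star ψ₀ ⬝ᵥ ψ₀ = 1) {γ : ℝ} (hγ : 0 < γ)
    (hgap : ∀ φ : m → ℂ, star φ ⬝ᵥ φ = 1 →
      H.groundEnergy + γ * (1 - ‖star ψ₀ ⬝ᵥ φ‖ ^ 2) ≤ (star φ ⬝ᵥ H *ᵥ φ).re)
    (h1 : star ψ₀ ⬝ᵥ Q *ᵥ ψ₀ = 0) {β : ℝ} (hβ : 0 ≤ β) (h : ℝ) :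
    Real.log (partitionFn β (H - (h : ℂ) • Q)).re - Real.log (partitionFn β H).re ≤
      β * (h ^ 2 * ‖Q‖ ^ 2 / γ) + Real.log (Fintype.card m) := by
  have hHh := isHermitian_sub_smul hH hQ h
  have hE := groundEnergy_source_ge_of_gap hH hQ hψ₀ hγ hgap h1 h
  have hD : (0 : ℝ) < Fintype.card m := by exact_mod_cast Fintype.card_pos
  -- upper bound on `log Z(H - hQ)`
  have hup := partitionFn_le_card_mul_exp hHh hβ
  have hZh : 0 < (partitionFn β (H - (h : ℂ) • Q)).re := partitionFn_re_pos hHh β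
  have hup' := Real.log_le_log hZh hup
  rw [Real.log_mul hD.ne' (Real.exp_pos _).ne', Real.log_exp] at hup'
  -- lower bound on `log Z(H)`
  have hlow := exp_neg_mul_groundEnergy_le_partitionFn hH β
  have hlow' := Real.log_le_log (Real.exp_pos _) hlow
  rw [Real.log_exp] at hlow'
  have hmono : -(β * (H - (h : ℂ) • Q).groundEnergy) ≤ -(β * (H.groundEnergy - h ^ 2 * ‖Q‖ ^ 2 / γ)) := by
    have := mul_le_mul_of_nonneg_left hE hβ
    linarith
  linarith

/-! ### 7a. Consequence for the crux: with `L₀` frozen at ANY fixed side `ℓ` whose cluster is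
gapped (off resonance) the statement is false — conditional on an explicit finite-dimensional
spectral hypothesis (`ℓ = 2`, `μ = -1/2`: verified by hand at `U = 0`, ED cross-check kit j007210) -/

/-- Spectral hypothesis on ONE finite cluster (side `ℓ`, chemical potential `μs`), uniformly for
couplings `0 < U ≤ U₁`: the grand-canonical torus Hamiltonian has a unit ground vector `ψ₀` with a
gap `γ` in projector form (`K₀ ≥ E₀ + γ(1 - |ψ₀⟩⟨ψ₀|)`) and no first-order pair matrix element
`⟨ψ₀,(Δ_d + Δ_d†)ψ₀⟩ = 0` (automatic for a non-degenerate ground state, which has definite particle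
number). At `U = 0` this holds for every `μs` off the finite set of "resonant" values where a free
many-body level of the `N ± 2` sectors crosses the ground level (e.g. `ℓ = 2`: resonant `μs ∈ ℤ`;
at `μs = -1/2` the gap is `1/2`), and it persists for `U ≤ U₁(ℓ, μs)` by norm-continuity of the
spectrum. Kept as a HYPOTHESIS here (a 256-dimensional diagonalisation is not a `decide` goal). -/
def ClusterGapHypothesis (ℓ : ℕ) [NeZero ℓ] (μs γ U₁ : ℝ) : Prop :=
  0 < γ ∧ 0 < U₁ ∧ ∀ U : ℝ, 0 < U → U ≤ U₁ → ∃ ψ₀ : Fock (Orb (FermionTorus 2 ℓ)),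
    star ψ₀ ⬝ᵥ ψ₀ = 1 ∧
    star ψ₀ ⬝ᵥ (pairField dWaveFormFactor ℓ + (pairField dWaveFormFactor ℓ)ᴴ) *ᵥ ψ₀ = 0 ∧
    ∀ φ : Fock (Orb (FermionTorus 2 ℓ)), star φ ⬝ᵥ φ = 1 →
      (hubbardTorusWith 2 ℓ 1 U μs).groundEnergy + γ * (1 - ‖star ψ₀ ⬝ᵥ φ‖ ^ 2) ≤
        (star φ ⬝ᵥ (hubbardTorusWith 2 ℓ 1 U μs) *ᵥ φ).re

/-- The crux with its threshold FROZEN at the side `ℓ` (`L₀ := ℓ` for every `U, β, μ`). -/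
def TwSourcedCondensationFromSide (ℓ : ℕ) : Prop :=
  ∀ μ₁ μ₂ : ℝ, -4 < μ₁ → μ₁ ≤ μ₂ → μ₂ < 0 → ∃ U₀ a c C h₀ : ℝ, 0 < U₀ ∧ 0 < a ∧ 0 < c ∧ 0 < C ∧
    0 < h₀ ∧ ∀ U : ℝ, 0 < U → U ≤ U₀ → ∀ β : ℝ, 1 ≤ β → β ≤ Real.exp (a / U) →
    ∀ μ ∈ Set.Icc μ₁ μ₂, ∀ (L : ℕ) [NeZero L], ℓ ≤ L → ∀ h : ℝ, |h| ≤ h₀ →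
      c * h ^ 2 * Real.log (1 / (|h| + 1 / β)) - C * h ^ 2 ≤ pTilde β L U μ h - pTilde β L U μ 0

/-- **A frozen threshold is impossible at a gapped cluster**: under `ClusterGapHypothesis ℓ μs γ U₁`
with `μs ∈ (-4,0)`, `TwSourcedCondensationFromSide ℓ` is FALSE. Witness: `μ₁ = μ₂ = μs`, `L = ℓ`,
`β = e^{a/U}`, `h = e^{-a/(2U)} = β^{-1/2}` (so `β h² = 1`): the response is
`≤ (‖Q‖²/(γℓ²) + log dim/ℓ²)·h²` by §7 while the claimed floor is `h²(c(a/(2U) - log 2) - C)`,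
and `a/U` is at the refuter's disposal. Hence, granted the hypothesis, the crux's `L₀(U,β,μ)` must
leave every fixed gapped cluster behind as `β → ∞`: `L₀ → ∞` is forced. [folklore] -/
theorem twSourcedCondensation_false_fromSide_of_gap (ℓ : ℕ) [NeZero ℓ] {μs γ U₁ : ℝ}
    (hμ1 : -4 < μs) (hμ2 : μs < 0) (hyp : ClusterGapHypothesis ℓ μs γ U₁) :
    ¬ TwSourcedCondensationFromSide ℓ := by
  intro H
  obtain ⟨hγ, hU₁, hyp⟩ := hyp
  obtain ⟨U₀, a, c, C, h₀, hU₀, ha, hc, hC, hh₀, H⟩ := H μs μs hμ1 le_rfl hμ2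
  set Q := pairField dWaveFormFactor ℓ + (pairField dWaveFormFactor ℓ)ᴴ with hQdef
  have hℓ : (0 : ℝ) < (ℓ : ℝ) ^ 2 := cast_sq_pos_of_neZero ℓ
  set A : ℝ := ‖Q‖ ^ 2 / (γ * (ℓ : ℝ) ^ 2) with hA
  set B : ℝ := Real.log (Fintype.card (Finset (Orb (FermionTorus 2 ℓ)))) / (ℓ : ℝ) ^ 2 with hB
  have hA0 : 0 ≤ A := by positivity
  have hlogD : 0 ≤ Real.log (Fintype.card (Finset (Orb (FermionTorus 2 ℓ)))) :=
    Real.log_nonneg (by exact_mod_cast Nat.one_le_iff_ne_zero.2 Fintype.card_ne_zero)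
  have hB0 : 0 ≤ B := div_nonneg hlogD hℓ.le
  have hlog2 : 0 < Real.log 2 := Real.log_pos one_lt_two
  have hsum : 0 ≤ A + B + C + c * Real.log 2 := by nlinarith
  set M : ℝ := 2 * (A + B + C + c * Real.log 2) / c + 2 * |Real.log h₀| + 1 with hM
  have hMpos : 0 < M := by
    have : 0 ≤ 2 * (A + B + C + c * Real.log 2) / c := by positivity
    positivity
  obtain ⟨U, hUpos, hUle, haU⟩ := exists_small_coupling (lt_min hU₀ hU₁) ha hMpos
  set β : ℝ := Real.exp (a / U) with hβ
  have hβpos : 0 < β := Real.exp_pos _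
  have hβ1 : 1 ≤ β := Real.one_le_exp (div_nonneg ha.le hUpos.le)
  set h : ℝ := Real.exp (-(a / U) / 2) with hh
  have hhpos : 0 < h := Real.exp_pos _
  have haU0 : 0 ≤ a / U := div_nonneg ha.le hUpos.le
  have hhle : h ≤ 1 := Real.exp_le_one_iff.2 (by linarith)
  have hh2 : h ^ 2 * β = 1 := by
    rw [hh, hβ, sq, ← Real.exp_add, ← Real.exp_add, show -(a / U) / 2 + -(a / U) / 2 + a / U = 0 by ring,
      Real.exp_zero]
  have hβinv : 1 / β = h ^ 2 := by
    rw [eq_comm, eq_div_iff hβpos.ne']; exact hh2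
  have hhh₀ : |h| ≤ h₀ := by
    rw [abs_of_pos hhpos, hh, ← Real.le_log_iff_exp_le hh₀]
    have : -|Real.log h₀| ≤ Real.log h₀ := neg_abs_le _
    have h2 : 2 * |Real.log h₀| ≤ a / U := by
      have : 0 ≤ 2 * (A + B + C + c * Real.log 2) / c := by positivity
      linarith
    linarith
  have key := H U hUpos (hUle.trans (min_le_left _ _)) β hβ1 le_rfl μs ⟨le_rfl, le_rfl⟩ ℓ le_rfl h hhh₀
  -- the gapped-cluster bound at this `U`
  obtain ⟨ψ₀, hψ₀, hψQ, hgap⟩ := hyp U hUpos (hUle.trans (min_le_right _ _))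
  have hK := isHermitian_hubbardTorusWith ℓ 1 U μs
  have hQh : Q.IsHermitian := isHermitian_pairField_add_conjTranspose ℓ
  have bound := log_partitionFn_source_sub_le_of_gap hK hQh hψ₀ hγ hgap hψQ hβpos.le h
  have hden : 0 < β * (ℓ : ℝ) ^ 2 := mul_pos hβpos hℓ
  have hR : pTilde β ℓ U μs h - pTilde β ℓ U μs 0 ≤ (A + B) * h ^ 2 := by
    rw [pTilde, pTilde, ← sub_div, div_le_iff₀ hden, dWaveSourceTorus_zero]
    change Real.log (partitionFn β (hubbardTorusWith 2 ℓ 1 U μs - (h : ℂ) • Q)).re -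
        Real.log (partitionFn β (hubbardTorusWith 2 ℓ 1 U μs)).re ≤ _
    refine bound.trans (le_of_eq ?_)
    have hℓ0 : (ℓ : ℝ) ≠ 0 := by exact_mod_cast NeZero.ne ℓ
    have e1 : β * (h ^ 2 * ‖Q‖ ^ 2 / γ) = A * h ^ 2 * (β * (ℓ : ℝ) ^ 2) := by
      rw [hA]; field_simp
    have e2 : Real.log (Fintype.card (Finset (Orb (FermionTorus 2 ℓ)))) = B * h ^ 2 * (β * (ℓ : ℝ) ^ 2) := by
      rw [hB]
      calc Real.log (Fintype.card (Finset (Orb (FermionTorus 2 ℓ))))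
          = Real.log (Fintype.card (Finset (Orb (FermionTorus 2 ℓ)))) / (ℓ : ℝ) ^ 2 * (h ^ 2 * β) *
              (ℓ : ℝ) ^ 2 := by rw [hh2, mul_one, div_mul_cancel₀ _ hℓ.ne']
        _ = _ := by ring
    rw [e1, e2]; ring
  -- the claimed floor at `h`
  have hlog : a / U / 2 - Real.log 2 ≤ Real.log (1 / (|h| + 1 / β)) := by
    rw [abs_of_pos hhpos, hβinv]
    have hsum' : h + h ^ 2 ≤ 2 * h := by nlinarith
    have hpos' : 0 < h + h ^ 2 := by positivity
    calc a / U / 2 - Real.log 2 = Real.log (1 / (2 * h)) := by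
          rw [one_div, Real.log_inv, Real.log_mul two_ne_zero hhpos.ne', hh, Real.log_exp]; ring
      _ ≤ Real.log (1 / (h + h ^ 2)) :=
          Real.log_le_log (by positivity) (one_div_le_one_div_of_le hpos' hsum')
  have hh2pos : 0 < h ^ 2 := by positivity
  have step : c * h ^ 2 * (a / U / 2 - Real.log 2) - C * h ^ 2 ≤ (A + B) * h ^ 2 := by
    have := mul_le_mul_of_nonneg_left hlog (le_of_lt (mul_pos hc hh2pos))
    linarith
  -- divide by `h²` and compare with `M ≤ a/U`
  have step2 : c * (a / U / 2 - Real.log 2) - C ≤ A + B := by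
    by_contra hcon
    push Not at hcon
    have := mul_lt_mul_of_pos_left hcon hh2pos
    linarith
  have hM2 : 2 * (A + B + C + c * Real.log 2) / c + 1 ≤ a / U := by
    linarith [abs_nonneg (Real.log h₀)]
  have hM3 : 2 * (A + B + C + c * Real.log 2) + c ≤ c * (a / U) := by
    have e : c * (2 * (A + B + C + c * Real.log 2) / c + 1) = 2 * (A + B + C + c * Real.log 2) + c := by
      field_simp
    rw [← e]
    exact mul_le_mul_of_nonneg_left hM2 hc.le
  linarith

/-! ### 7b. The same obstruction from a FREE-cluster hypothesis only (no Weyl, no interacting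
ground state): an approximate gap `H ≥ E₁ + γ(1 - |ψ₀⟩⟨ψ₀|)` with `E₁ ≤ E₀(H) ≤ ⟨ψ₀,Hψ₀⟩` costs
only `β(⟨ψ₀,Hψ₀⟩ - E₁)` in the exponent; for `K_U = K_0 + U·W`, `W ≥ 0`, the free gap inequality
transfers verbatim (`E₁ = ⟨ψ₀,K_0ψ₀⟩`) and the cost is `≤ βU‖W‖ ≤ βUℓ²`, which the refuter keeps
`≤ 1` by running the witness at `β = 1/(ℓ²U)` instead of `e^{a/U}` -/

/-- **Approximate-gap version of the `β`-uniform cap**: if `Re⟨φ,Hφ⟩ ≥ E₁ + γ(1 - |⟨ψ₀,φ⟩|²)` for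
all unit `φ` (`ψ₀` unit, `γ > 0`, `E₁` any real) and `⟨ψ₀,Qψ₀⟩ = 0`, then for `β ≥ 0` and real `h`
`log Z_β(H - hQ) - log Z_β(H) ≤ βh²‖Q‖²/γ + log dim + β(Re⟨ψ₀,Hψ₀⟩ - E₁)`. [folklore] -/
theorem log_partitionFn_source_sub_le_of_approxGap {H Q : Matrix m m ℂ} (hH : H.IsHermitian)
    (hQ : Q.IsHermitian) [Nonempty m] {ψ₀ : m → ℂ} (hψ₀ : star ψ₀ ⬝ᵥ ψ₀ = 1) {E₁ γ : ℝ} (hγ : 0 < γ)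
    (hgap : ∀ φ : m → ℂ, star φ ⬝ᵥ φ = 1 →
      E₁ + γ * (1 - ‖star ψ₀ ⬝ᵥ φ‖ ^ 2) ≤ (star φ ⬝ᵥ H *ᵥ φ).re)
    (h1 : star ψ₀ ⬝ᵥ Q *ᵥ ψ₀ = 0) {β : ℝ} (hβ : 0 ≤ β) (h : ℝ) :
    Real.log (partitionFn β (H - (h : ℂ) • Q)).re - Real.log (partitionFn β H).re ≤
      β * (h ^ 2 * ‖Q‖ ^ 2 / γ) + Real.log (Fintype.card m) +
        β * ((star ψ₀ ⬝ᵥ H *ᵥ ψ₀).re - E₁) := by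
  have hHh := isHermitian_sub_smul hH hQ h
  have hE : E₁ - h ^ 2 * ‖Q‖ ^ 2 / γ ≤ (H - (h : ℂ) • Q).groundEnergy :=
    le_groundEnergy_of_forall_rayleigh hHh (rayleigh_source_ge_of_gap hψ₀ hγ hgap h1 h)
  have hE0 : H.groundEnergy ≤ (star ψ₀ ⬝ᵥ H *ᵥ ψ₀).re := groundEnergy_le_rayleigh_holds hH ψ₀ hψ₀
  have hD : (0 : ℝ) < Fintype.card m := by exact_mod_cast Fintype.card_pos
  have hup := partitionFn_le_card_mul_exp hHh hβ
  have hZh : 0 < (partitionFn β (H - (h : ℂ) • Q)).re := partitionFn_re_pos hHh β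
  have hup' := Real.log_le_log hZh hup
  rw [Real.log_mul hD.ne' (Real.exp_pos _).ne', Real.log_exp] at hup'
  have hlow := exp_neg_mul_groundEnergy_le_partitionFn hH β
  have hlow' := Real.log_le_log (Real.exp_pos _) hlow
  rw [Real.log_exp] at hlow'
  have hmono : -(β * (H - (h : ℂ) • Q).groundEnergy) ≤ -(β * (E₁ - h ^ 2 * ‖Q‖ ^ 2 / γ)) := by
    have := mul_le_mul_of_nonneg_left hE hβ
    linarith
  have hmono' : β * H.groundEnergy ≤ β * (star ψ₀ ⬝ᵥ H *ᵥ ψ₀).re := mul_le_mul_of_nonneg_left hE0 hβ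
  linarith

/-- One on-site repulsion term `n_{x↑} n_{x↓}` is a `0/1`-diagonal matrix, hence a positive
quadratic form. [folklore] -/
theorem re_dotProduct_numberOp_mul_numberOp_mulVec_nonneg {Λ : Type*} [LinearOrder Λ] [Fintype Λ]
    (x : Λ) (φ : Fock (Orb Λ)) :
    0 ≤ (star φ ⬝ᵥ (numberOp x 0 * numberOp x 1) *ᵥ φ).re := by
  set d : Finset (Orb Λ) → ℂ := fun s =>
    (if orb x 0 ∈ s then (1 : ℂ) else 0) * (if orb x 1 ∈ s then (1 : ℂ) else 0) with hd
  have hdiag : (numberOp x 0 * numberOp x 1 : Matrix (Finset (Orb Λ)) (Finset (Orb Λ)) ℂ) = diagonal d := by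
    rw [LiebThm1.numberOp_eq_diagonal, LiebThm1.numberOp_eq_diagonal, diagonal_mul_diagonal]
  have hds : ∀ s, d s = ((if orb x 0 ∈ s ∧ orb x 1 ∈ s then (1 : ℝ) else 0 : ℝ) : ℂ) := by
    intro s
    by_cases h0 : orb x 0 ∈ s <;> by_cases h1 : orb x 1 ∈ s <;> simp [hd, h0, h1]
  rw [hdiag, dotProduct, Complex.re_sum]
  refine Finset.sum_nonneg fun s _ => ?_
  rw [mulVec_diagonal, Pi.star_apply, hds s, Complex.star_def,
    show (starRingEnd ℂ) (φ s) * (((if orb x 0 ∈ s ∧ orb x 1 ∈ s then (1 : ℝ) else 0 : ℝ) : ℂ) * φ s) =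
      (((if orb x 0 ∈ s ∧ orb x 1 ∈ s then (1 : ℝ) else 0 : ℝ) : ℂ)) * (φ s * (starRingEnd ℂ) (φ s)) by ring,
    Complex.mul_conj, ← Complex.ofReal_mul, Complex.ofReal_re]
  exact mul_nonneg (by split_ifs <;> norm_num) (Complex.normSq_nonneg _)

/-- The on-site repulsion `Σ_x n_{x↑} n_{x↓}` is a positive quadratic form. [folklore] -/
theorem re_dotProduct_interaction_mulVec_nonneg {Λ : Type*} [LinearOrder Λ] [Fintype Λ]
    (φ : Fock (Orb Λ)) :
    0 ≤ (star φ ⬝ᵥ (∑ x : Λ, numberOp x 0 * numberOp x 1) *ᵥ φ).re := by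
  rw [Matrix.sum_mulVec, dotProduct_sum, Complex.re_sum]
  exact Finset.sum_nonneg fun x _ => re_dotProduct_numberOp_mul_numberOp_mulVec_nonneg x φ

/-- FREE-cluster spectral hypothesis (side `ℓ`, chemical potential `μs`): the `U = 0` torus Hamiltonian
`K_0 = hubbardTorusWith 2 ℓ 1 0 μs` has a unit vector `ψ₀` with no first-order pair matrix element and
`K_0 ≥ ⟨ψ₀,K_0ψ₀⟩ + γ(1 - |ψ₀⟩⟨ψ₀|)` — i.e. `ψ₀` is the unique ground state of the FREE cluster with
gap `γ`. A statement about one explicit quadratic (free-fermion) Hamiltonian; for `ℓ = 2`,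
`μs = -1/2`: both spins in the `k = 0` orbital, `γ = 1/2`. -/
def FreeClusterGap (ℓ : ℕ) [NeZero ℓ] (μs γ : ℝ) : Prop :=
  0 < γ ∧ ∃ ψ₀ : Fock (Orb (FermionTorus 2 ℓ)), star ψ₀ ⬝ᵥ ψ₀ = 1 ∧
    star ψ₀ ⬝ᵥ (pairField dWaveFormFactor ℓ + (pairField dWaveFormFactor ℓ)ᴴ) *ᵥ ψ₀ = 0 ∧
    ∀ φ : Fock (Orb (FermionTorus 2 ℓ)), star φ ⬝ᵥ φ = 1 →
      (star ψ₀ ⬝ᵥ (hubbardTorusWith 2 ℓ 1 0 μs) *ᵥ ψ₀).re + γ * (1 - ‖star ψ₀ ⬝ᵥ φ‖ ^ 2) ≤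
        (star φ ⬝ᵥ (hubbardTorusWith 2 ℓ 1 0 μs) *ᵥ φ).re

/-- Switching the repulsion on: `K_U = K_0 + U·Σ_x n_{x↑}n_{x↓}`. [folklore] -/
theorem hubbardTorusWith_eq_free_add (ℓ : ℕ) [NeZero ℓ] (U μ : ℝ) :
    hubbardTorusWith 2 ℓ 1 U μ =
      hubbardTorusWith 2 ℓ 1 0 μ + (U : ℂ) • ∑ x : FermionTorus 2 ℓ, numberOp x 0 * numberOp x 1 := by
  have h := Summit.HubbardSuperconductivity.HubbardSuperconductivity.Theorems.dWaveSourceTorus_sub_free ℓ U μ 0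
  rw [dWaveSourceTorus_zero, dWaveSourceTorus_zero, sub_eq_iff_eq_add'] at h
  rw [h, add_comm]

/-- **The frozen threshold is impossible already from the FREE-cluster gap**: under
`FreeClusterGap ℓ μs γ` with `μs ∈ (-4,0)`, `TwSourcedCondensationFromSide ℓ` is FALSE. The interacting
cluster inherits the free gap inequality with `E₁ = ⟨ψ₀,K_0ψ₀⟩` because `Σ_x n_{x↑}n_{x↓} ≥ 0`, at the
price `βU⟨ψ₀,Wψ₀⟩ ≤ βUℓ²` in the exponent (`log_partitionFn_source_sub_le_of_approxGap`); the witness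
therefore runs at the MODERATE temperature `β = 1/(ℓ²U)` (inside `[1, e^{a/U}]` for small `U`) with
`h = β^{-1/2} = ℓ√U`: response `≤ (‖Q‖²/γ + log dim + 1)/(βℓ²)`, floor
`≥ (c((1/2)log β - log 2) - C)/β`, and `log β = log(1/(ℓ²U)) → ∞`. [folklore] -/
theorem twSourcedCondensation_false_fromSide_of_freeGap (ℓ : ℕ) [NeZero ℓ] {μs γ : ℝ}
    (hμ1 : -4 < μs) (hμ2 : μs < 0) (hyp : FreeClusterGap ℓ μs γ) :
    ¬ TwSourcedCondensationFromSide ℓ := by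
  intro H
  set Q := pairField dWaveFormFactor ℓ + (pairField dWaveFormFactor ℓ)ᴴ with hQdef
  set W : Matrix (Finset (Orb (FermionTorus 2 ℓ))) (Finset (Orb (FermionTorus 2 ℓ))) ℂ :=
    ∑ x : FermionTorus 2 ℓ, numberOp x 0 * numberOp x 1 with hWdef
  set K0 := hubbardTorusWith 2 ℓ 1 0 μs with hK0def
  obtain ⟨hγ, ψ₀, hψ₀, hψQ, hgap0⟩ := hyp
  obtain ⟨U₀, a, c, C, h₀, hU₀, ha, hc, hC, hh₀, H⟩ := H μs μs hμ1 le_rfl hμ2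
  have hℓ : (0 : ℝ) < (ℓ : ℝ) ^ 2 := cast_sq_pos_of_neZero ℓ
  set ω : ℝ := (ℓ : ℝ) ^ 2 with hω
  have hωpos : 0 < ω := hℓ
  -- constants of the response bound
  set A : ℝ := ‖Q‖ ^ 2 / γ with hA
  set Dl : ℝ := Real.log (Fintype.card (Finset (Orb (FermionTorus 2 ℓ)))) with hDl
  have hA0 : 0 ≤ A := by positivity
  have hDl0 : 0 ≤ Dl := Real.log_nonneg (by exact_mod_cast Nat.one_le_iff_ne_zero.2 Fintype.card_ne_zero)
  have hlog2 : 0 < Real.log 2 := Real.log_pos one_lt_two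
  -- the target size of `log β`
  set M₁ : ℝ := 2 * (A + Dl + 1 + ω * C + ω * c * Real.log 2) / (ω * c) with hM₁
  have hM₁0 : 0 ≤ M₁ := by positivity
  -- the coupling: small enough for five constraints
  set ε : ℝ := min (min (1 / ω) (h₀ ^ 2 / ω)) (min (a ^ 2 / 4) (Real.exp (-M₁ - 1) / ω)) with hε
  have hεpos : 0 < ε := by positivity
  set U : ℝ := min U₀ ε with hU
  have hUpos : 0 < U := lt_min hU₀ hεpos
  have hUU₀ : U ≤ U₀ := min_le_left _ _
  have hUε : U ≤ ε := min_le_right _ _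
  have hU1 : U ≤ 1 / ω := hUε.trans ((min_le_left _ _).trans (min_le_left _ _))
  have hU2 : U ≤ h₀ ^ 2 / ω := hUε.trans ((min_le_left _ _).trans (min_le_right _ _))
  have hU3 : U ≤ a ^ 2 / 4 := hUε.trans ((min_le_right _ _).trans (min_le_left _ _))
  have hU4 : U ≤ Real.exp (-M₁ - 1) / ω := hUε.trans ((min_le_right _ _).trans (min_le_right _ _))
  -- the temperature `β = 1/(ωU)` and the source `h = √(ωU)`
  set β : ℝ := 1 / (ω * U) with hβ
  have hωU : 0 < ω * U := mul_pos hωpos hUpos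
  have hβpos : 0 < β := one_div_pos.2 hωU
  have hβ1 : 1 ≤ β := by
    rw [hβ, le_div_iff₀ hωU, one_mul]
    calc ω * U ≤ ω * (1 / ω) := mul_le_mul_of_nonneg_left hU1 hωpos.le
      _ = 1 := mul_one_div_cancel hωpos.ne'
  have hβexp : β ≤ Real.exp (a / U) := by
    -- `1/(ωU) ≤ 1/U ≤ (a/(2U))² ≤ e^{a/U}` for `U ≤ a²/4`, `ω ≥ 1`
    have hω1 : 1 ≤ ω := by
      rw [hω]; exact_mod_cast Nat.one_le_pow _ _ (Nat.pos_of_ne_zero (NeZero.ne ℓ))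
    have step1 : β ≤ 1 / U := by
      rw [hβ]; exact one_div_le_one_div_of_le hUpos (le_mul_of_one_le_left hUpos.le hω1)
    have step2 : 1 / U ≤ (a / (2 * U)) ^ 2 := by
      rw [div_pow, div_le_div_iff₀ hUpos (by positivity)]
      nlinarith
    have step3 : (a / (2 * U)) ^ 2 ≤ Real.exp (a / U) := by
      have e1 : a / (2 * U) ≤ Real.exp (a / (2 * U)) := by
        linarith [Real.add_one_le_exp (a / (2 * U))]
      have e2 : 0 ≤ a / (2 * U) := by positivity
      calc (a / (2 * U)) ^ 2 ≤ Real.exp (a / (2 * U)) ^ 2 := pow_le_pow_left₀ e2 e1 2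
        _ = Real.exp (a / U) := by rw [sq, ← Real.exp_add]; congr 1; ring
    exact step1.trans (step2.trans step3)
  set h : ℝ := Real.sqrt (ω * U) with hh
  have hhpos : 0 < h := Real.sqrt_pos.2 hωU
  have hh2 : h ^ 2 = ω * U := Real.sq_sqrt hωU.le
  have hh2β : h ^ 2 * β = 1 := by rw [hh2, hβ, mul_one_div_cancel hωU.ne']
  have hβinv : 1 / β = h ^ 2 := by rw [hβ, one_div_one_div, hh2]
  have hhle1 : h ≤ 1 := by
    rw [← Real.sqrt_one, hh]; refine Real.sqrt_le_sqrt ?_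
    calc ω * U ≤ ω * (1 / ω) := mul_le_mul_of_nonneg_left hU1 hωpos.le
      _ = 1 := mul_one_div_cancel hωpos.ne'
  have hhh₀ : |h| ≤ h₀ := by
    rw [abs_of_pos hhpos, ← Real.sqrt_sq hh₀.le, hh]
    refine Real.sqrt_le_sqrt ?_
    calc ω * U ≤ ω * (h₀ ^ 2 / ω) := mul_le_mul_of_nonneg_left hU2 hωpos.le
      _ = h₀ ^ 2 := mul_div_cancel₀ _ hωpos.ne'
  have key := H U hUpos hUU₀ β hβ1 hβexp μs ⟨le_rfl, le_rfl⟩ ℓ le_rfl h hhh₀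
  -- the approximate-gap bound for `K_U = K0 + U W`
  have hKU : hubbardTorusWith 2 ℓ 1 U μs = K0 + (U : ℂ) • W := hubbardTorusWith_eq_free_add ℓ U μs
  have hK := isHermitian_hubbardTorusWith ℓ 1 U μs
  have hQh : Q.IsHermitian := isHermitian_pairField_add_conjTranspose ℓ
  have hgapU : ∀ φ : Fock (Orb (FermionTorus 2 ℓ)), star φ ⬝ᵥ φ = 1 →
      (star ψ₀ ⬝ᵥ K0 *ᵥ ψ₀).re + γ * (1 - ‖star ψ₀ ⬝ᵥ φ‖ ^ 2) ≤
        (star φ ⬝ᵥ (hubbardTorusWith 2 ℓ 1 U μs) *ᵥ φ).re := by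
    intro φ hφ
    have hW := re_dotProduct_interaction_mulVec_nonneg (Λ := FermionTorus 2 ℓ) φ
    rw [hKU, add_mulVec, dotProduct_add, Complex.add_re, smul_mulVec, dotProduct_smul, smul_eq_mul,
      Complex.re_ofReal_mul]
    have := hgap0 φ hφ
    nlinarith [mul_nonneg hUpos.le hW]
  have bound := log_partitionFn_source_sub_le_of_approxGap hK hQh hψ₀ hγ hgapU hψQ hβpos.le h
  -- the interaction cost `β U ⟨ψ₀, W ψ₀⟩ ≤ β U ω = 1`
  have hcost : (star ψ₀ ⬝ᵥ (hubbardTorusWith 2 ℓ 1 U μs) *ᵥ ψ₀).re - (star ψ₀ ⬝ᵥ K0 *ᵥ ψ₀).re ≤ U * ω := by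
    rw [hKU, add_mulVec, dotProduct_add, Complex.add_re, smul_mulVec, dotProduct_smul, smul_eq_mul,
      Complex.re_ofReal_mul, add_sub_cancel_left]
    refine mul_le_mul_of_nonneg_left ?_ hUpos.le
    have hnW : ‖W‖ ≤ ω := by
      have := Summit.HubbardSuperconductivity.HubbardSuperconductivity.Theorems.norm_sum_numberOp_mul_numberOp_le
        (Λ := FermionTorus 2 ℓ)
      rw [Summit.HubbardSuperconductivity.HubbardSuperconductivity.Theorems.card_fermionTorus_two] at this
      rw [hω]; exact_mod_cast this
    calc (star ψ₀ ⬝ᵥ W *ᵥ ψ₀).re ≤ ‖star ψ₀ ⬝ᵥ W *ᵥ ψ₀‖ := Complex.re_le_norm _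
      _ ≤ eucNorm ψ₀ * eucNorm (W *ᵥ ψ₀) := norm_star_dotProduct_le _ _
      _ ≤ 1 * (‖W‖ * 1) := by
          rw [eucNorm_eq_one hψ₀]
          refine mul_le_mul_of_nonneg_left ?_ zero_le_one
          simpa [eucNorm_eq_one hψ₀] using eucNorm_mulVec_le W ψ₀
      _ ≤ ω := by linarith
  have hden : 0 < β * (ℓ : ℝ) ^ 2 := mul_pos hβpos hℓ
  have hR : pTilde β ℓ U μs h - pTilde β ℓ U μs 0 ≤ (A + Dl + 1) * h ^ 2 / ω := by
    rw [pTilde, pTilde, ← sub_div, div_le_iff₀ hden, dWaveSourceTorus_zero]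
    change Real.log (partitionFn β (hubbardTorusWith 2 ℓ 1 U μs - (h : ℂ) • Q)).re -
        Real.log (partitionFn β (hubbardTorusWith 2 ℓ 1 U μs)).re ≤ _
    refine bound.trans ?_
    have hβU : β * (U * ω) = 1 := by rw [hβ, mul_comm U ω, one_div_mul_cancel hωU.ne']
    have e1 : β * (h ^ 2 * ‖Q‖ ^ 2 / γ) = A := by
      rw [hA, ← mul_div_assoc, ← mul_assoc, mul_comm β, hh2β, one_mul]
    have hℓ0 : (ℓ : ℝ) ≠ 0 := by exact_mod_cast NeZero.ne ℓ
    have e3 : (A + Dl + 1) * h ^ 2 / ω * (β * (ℓ : ℝ) ^ 2) = A + Dl + 1 := by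
      rw [hh2, hβ, hω]
      field_simp
    have hcost' := mul_le_mul_of_nonneg_left hcost hβpos.le
    rw [hβU] at hcost'
    rw [e3]
    linarith [e1]
  -- the floor at `h`
  have hlog : Real.log β / 2 - Real.log 2 ≤ Real.log (1 / (|h| + 1 / β)) := by
    rw [abs_of_pos hhpos, hβinv]
    have hsq' : h ^ 2 ≤ h := by rw [sq]; exact mul_le_of_le_one_left hhpos.le hhle1
    have hsum' : h + h ^ 2 ≤ 2 * h := by linarith
    have hpos' : 0 < h + h ^ 2 := by positivity
    have hlogh : Real.log h = -(Real.log β / 2) := by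
      have : Real.log (h ^ 2) = -Real.log β := by rw [← hβinv, one_div, Real.log_inv]
      rw [Real.log_pow] at this
      push_cast at this
      linarith
    calc Real.log β / 2 - Real.log 2 = Real.log (1 / (2 * h)) := by
          rw [one_div, Real.log_inv, Real.log_mul two_ne_zero hhpos.ne', hlogh]; ring
      _ ≤ Real.log (1 / (h + h ^ 2)) :=
          Real.log_le_log (by positivity) (one_div_le_one_div_of_le hpos' hsum')
  -- `log β ≥ M₁ + 1`
  have hlogβ : M₁ + 1 ≤ Real.log β := by
    have h1 : ω * U ≤ Real.exp (-M₁ - 1) := by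
      calc ω * U ≤ ω * (Real.exp (-M₁ - 1) / ω) := mul_le_mul_of_nonneg_left hU4 hωpos.le
        _ = Real.exp (-M₁ - 1) := mul_div_cancel₀ _ hωpos.ne'
    have h2 : Real.log (ω * U) ≤ -M₁ - 1 := by
      rw [← Real.log_exp (-M₁ - 1)]; exact Real.log_le_log hωU h1
    rw [hβ, one_div, Real.log_inv]
    linarith
  -- compare: floor `h²(c(log β/2 - log 2) - C) ≤ response ≤ (A + Dl + 1) h²/ω`
  have hh2pos : 0 < h ^ 2 := by positivity
  have step : c * h ^ 2 * (Real.log β / 2 - Real.log 2) - C * h ^ 2 ≤ (A + Dl + 1) * h ^ 2 / ω := by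
    have := mul_le_mul_of_nonneg_left hlog (le_of_lt (mul_pos hc hh2pos))
    linarith
  have step2 : c * (Real.log β / 2 - Real.log 2) - C ≤ (A + Dl + 1) / ω := by
    have e : (A + Dl + 1) * h ^ 2 / ω = (A + Dl + 1) / ω * h ^ 2 := by ring
    rw [e] at step
    by_contra hcon
    push Not at hcon
    have := mul_lt_mul_of_pos_left hcon hh2pos
    linarith
  -- but `log β ≥ M₁ + 1` makes the floor exceed the cap
  have hω0 : ω ≠ 0 := hωpos.ne'
  have hc0 : c ≠ 0 := hc.ne'
  have hcM : c * M₁ / 2 = (A + Dl + 1) / ω + C + c * Real.log 2 := by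
    rw [hM₁]
    field_simp
  have h1 : c * (M₁ + 1) ≤ c * Real.log β := mul_le_mul_of_nonneg_left hlogβ hc.le
  linarith

end Gapped

/-! ## §8 No threshold chosen before the temperature: the exact free BdG pressure caps the response
of every torus whose free levels avoid `μ`, UNIFORMLY in `β` -/

section UniformThreshold

/-- `(2√2 h ĝ_d(k))² ≤ 32 h²`. [folklore] -/
theorem bdg_pairing_sq_le {L : ℕ} (h : ℝ) (k : TorusSite 2 L) :
    (2 * Real.sqrt 2 * h * dWaveGap k) ^ 2 ≤ 32 * h ^ 2 := by
  have h2 : Real.sqrt 2 ^ 2 = 2 := Real.sq_sqrt zero_le_two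
  have hg : (dWaveGap k) ^ 2 ≤ 4 := by
    have h1 := abs_dWaveGap_le_two k
    have h0 := abs_nonneg (dWaveGap k)
    rw [← sq_abs]
    nlinarith
  have h8 : 0 ≤ 8 * h ^ 2 := by positivity
  calc (2 * Real.sqrt 2 * h * dWaveGap k) ^ 2 = 8 * h ^ 2 * (dWaveGap k) ^ 2 := by
        rw [mul_pow, mul_pow, mul_pow, h2]; ring
    _ ≤ 8 * h ^ 2 * 4 := mul_le_mul_of_nonneg_left hg h8
    _ = 32 * h ^ 2 := by ring

/-- **Free gain of a torus whose levels avoid `μ` by `γ`** (numerator form, `L ≥ 3`, `β > 0`): from the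
exact BdG formula (`log_partitionFn_dWaveSourceTorus_zero_sub`) and the per-mode bound
`bdgModeGain_le` (`≤ βD²·β/(2+β|ξ|) ≤ βD²/γ`):
`log Z_β(H_L(0,μ,h)) - log Z_β(H_L(0,μ,0)) ≤ L² · 32βh²/γ`. [folklore] -/
theorem free_logGain_le_of_levelGap {L : ℕ} [NeZero L] (hL : 3 ≤ L) {μ γ : ℝ} (hγ : 0 < γ)
    (hgap : ∀ k : TorusSite 2 L, γ ≤ |torusBand L k - μ|) {β : ℝ} (hβ : 0 < β) (h : ℝ) :
    Real.log (partitionFn β (dWaveSourceTorus L 0 μ h)).re -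
        Real.log (partitionFn β (dWaveSourceTorus L 0 μ 0)).re ≤
      (L : ℝ) ^ 2 * (32 * β * h ^ 2 / γ) := by
  rw [log_partitionFn_dWaveSourceTorus_zero_sub hL β μ h]
  have hmode : ∀ k : TorusSite 2 L,
      Real.log ((1 + Real.cosh (β * Real.sqrt ((torusBand L k - μ) ^ 2 +
          (2 * Real.sqrt 2 * h * dWaveGap k) ^ 2))) / 2) -
        Real.log ((1 + Real.cosh (β * (torusBand L k - μ))) / 2) ≤ 32 * β * h ^ 2 / γ := by
    intro k
    refine (bdgModeGain_le hβ (torusBand L k - μ) (2 * Real.sqrt 2 * h * dWaveGap k)).trans ?_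
    have hD := bdg_pairing_sq_le h k
    have hfrac : β / (2 + β * |torusBand L k - μ|) ≤ 1 / γ := by
      have hden : 0 < 2 + β * |torusBand L k - μ| := by positivity
      rw [div_le_div_iff₀ hden hγ, one_mul]
      have := mul_le_mul_of_nonneg_left (hgap k) hβ.le
      linarith
    have hfrac0 : 0 ≤ β / (2 + β * |torusBand L k - μ|) := by positivity
    calc β * (2 * Real.sqrt 2 * h * dWaveGap k) ^ 2 * (β / (2 + β * |torusBand L k - μ|))
        ≤ β * (32 * h ^ 2) * (1 / γ) :=
          mul_le_mul (mul_le_mul_of_nonneg_left hD hβ.le) hfrac hfrac0 (by positivity)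
      _ = 32 * β * h ^ 2 / γ := by ring
  calc ∑ k : TorusSite 2 L, (Real.log ((1 + Real.cosh (β * Real.sqrt ((torusBand L k - μ) ^ 2 +
          (2 * Real.sqrt 2 * h * dWaveGap k) ^ 2))) / 2) -
        Real.log ((1 + Real.cosh (β * (torusBand L k - μ))) / 2))
      ≤ ∑ _k : TorusSite 2 L, 32 * β * h ^ 2 / γ := Finset.sum_le_sum fun k _ => hmode k
    _ = (L : ℝ) ^ 2 * (32 * β * h ^ 2 / γ) := by
        rw [Finset.sum_const, Finset.card_univ, card_torusSite_two, nsmul_eq_mul]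
        push_cast
        ring

/-- **`β`-UNIFORM cap on the free response of a torus whose levels avoid `μ`**:
`p̃_L(β,0,μ,h) - p̃_L(β,0,μ,0) ≤ 32h²/γ` for all `β > 0`, all real `h`. [folklore] -/
theorem free_gain_le_of_levelGap {L : ℕ} [NeZero L] (hL : 3 ≤ L) {μ γ : ℝ} (hγ : 0 < γ)
    (hgap : ∀ k : TorusSite 2 L, γ ≤ |torusBand L k - μ|) {β : ℝ} (hβ : 0 < β) (h : ℝ) :
    pTilde β L 0 μ h - pTilde β L 0 μ 0 ≤ 32 * h ^ 2 / γ := by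
  have hL2 : (0 : ℝ) < (L : ℝ) ^ 2 := cast_sq_pos_of_neZero L
  have hden : 0 < β * (L : ℝ) ^ 2 := mul_pos hβ hL2
  rw [pTilde, pTilde, ← sub_div, div_le_iff₀ hden]
  refine (free_logGain_le_of_levelGap hL hγ hgap hβ h).trans (le_of_eq ?_)
  field_simp

/-- **The interacting response of such a torus is capped `β`-uniformly up to `2U`**:
`p̃_L(β,U,μ,h) - p̃_L(β,U,μ,0) ≤ 32h²/γ + 2|U|` (`G_U ≤ G_0 + 2|U|`, tree
`sourcedGain_le_free_add`). [folklore] -/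
theorem gain_le_of_levelGap {L : ℕ} [NeZero L] (hL : 3 ≤ L) {μ γ : ℝ} (hγ : 0 < γ)
    (hgap : ∀ k : TorusSite 2 L, γ ≤ |torusBand L k - μ|) {β : ℝ} (hβ : 0 < β) (U h : ℝ) :
    pTilde β L U μ h - pTilde β L U μ 0 ≤ 32 * h ^ 2 / γ + 2 * |U| := by
  have h1 := Summit.HubbardSuperconductivity.HubbardSuperconductivity.Theorems.sourcedGain_le_free_add L U μ h hβ
  have h2 := free_gain_le_of_levelGap hL hγ hgap hβ h
  unfold pTilde at h2 ⊢
  linarith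

/-- **Generic chemical potentials are off the finite level set**: in any nondegenerate interval there is
`μ` at positive distance `γ` from every free level `ε_L(k)` of the `L`-torus. [folklore] -/
theorem exists_mu_off_levels (L : ℕ) [NeZero L] {μ₁ μ₂ : ℝ} (h12 : μ₁ < μ₂) :
    ∃ μ ∈ Set.Icc μ₁ μ₂, ∃ γ : ℝ, 0 < γ ∧ ∀ k : TorusSite 2 L, γ ≤ |torusBand L k - μ| := by
  classical
  obtain ⟨μ, hμ, hnot⟩ := (Set.Icc_infinite h12).exists_notMem_finset
    (Finset.univ.image fun k : TorusSite 2 L => torusBand L k)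
  obtain ⟨k₀, -, hk₀⟩ := Finset.exists_min_image Finset.univ
    (fun k : TorusSite 2 L => |torusBand L k - μ|) ⟨fun _ => 0, Finset.mem_univ _⟩
  refine ⟨μ, hμ, |torusBand L k₀ - μ|, ?_, fun k => hk₀ k (Finset.mem_univ k)⟩
  have hne : torusBand L k₀ ≠ μ := fun heq =>
    hnot (Finset.mem_image.2 ⟨k₀, Finset.mem_univ _, heq⟩)
  exact abs_pos.2 (sub_ne_zero.2 hne)

/-- **Tightness form of the obstruction.** If the free levels of the `L`-torus (`L ≥ 3`) avoid `μ` by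
`γ > 0`, and the crux's inequality with constants `c > 0`, `C` holds at that `(μ, L)` for the admissible
point `β = 1/U`, `h = √U` (`0 < U ≤ 1`), then `c(½ log(1/U) - log 2) - C ≤ 32/γ + 2`: the torus must
carry a free level within `O(1/(c log β))` of `μ`, i.e. `L₀(U,β,μ)` is forced to grow with `log β`.
[folklore] -/
theorem levelGap_obstruction {L : ℕ} [NeZero L] (hL : 3 ≤ L) {μ γ : ℝ} (hγ : 0 < γ)
    (hgap : ∀ k : TorusSite 2 L, γ ≤ |torusBand L k - μ|) {U c C : ℝ} (hU : 0 < U) (hU1 : U ≤ 1)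
    (hc : 0 < c)
    (hineq : c * Real.sqrt U ^ 2 * Real.log (1 / (|Real.sqrt U| + 1 / (1 / U))) - C * Real.sqrt U ^ 2 ≤
      pTilde (1 / U) L U μ (Real.sqrt U) - pTilde (1 / U) L U μ 0) :
    c * (Real.log (1 / U) / 2 - Real.log 2) - C ≤ 32 / γ + 2 := by
  set h : ℝ := Real.sqrt U with hh
  have hhpos : 0 < h := Real.sqrt_pos.2 hU
  have hh2 : h ^ 2 = U := Real.sq_sqrt hU.le
  have hhle1 : h ≤ 1 := by rw [hh, ← Real.sqrt_one]; exact Real.sqrt_le_sqrt hU1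
  have hβpos : 0 < 1 / U := one_div_pos.2 hU
  -- the cap at `β = 1/U`: `(32/γ) h² + 2U = (32/γ + 2) h²`
  have hcap := gain_le_of_levelGap hL hγ hgap hβpos U h
  rw [abs_of_pos hU] at hcap
  -- the floor: `log(1/(h + h²)) ≥ ½ log(1/U) - log 2`
  have hlog : Real.log (1 / U) / 2 - Real.log 2 ≤ Real.log (1 / (|h| + 1 / (1 / U))) := by
    rw [abs_of_pos hhpos, one_div_one_div, ← hh2]
    have hsq' : h ^ 2 ≤ h := by rw [sq]; exact mul_le_of_le_one_left hhpos.le hhle1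
    have hsum' : h + h ^ 2 ≤ 2 * h := by linarith
    have hpos' : 0 < h + h ^ 2 := by positivity
    have hlogh : Real.log h = -(Real.log (1 / h ^ 2) / 2) := by
      rw [one_div, Real.log_inv, Real.log_pow]; push_cast; ring
    calc Real.log (1 / h ^ 2) / 2 - Real.log 2 = Real.log (1 / (2 * h)) := by
          rw [one_div (2 * h), Real.log_inv, Real.log_mul two_ne_zero hhpos.ne', hlogh]; ring
      _ ≤ Real.log (1 / (h + h ^ 2)) :=
          Real.log_le_log (by positivity) (one_div_le_one_div_of_le hpos' hsum')
  have hh2pos : 0 < h ^ 2 := by positivity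
  have step : c * h ^ 2 * (Real.log (1 / U) / 2 - Real.log 2) - C * h ^ 2 ≤ (32 / γ + 2) * h ^ 2 := by
    have e1 := mul_le_mul_of_nonneg_left hlog (le_of_lt (mul_pos hc hh2pos))
    have e2 : 32 * h ^ 2 / γ + 2 * h ^ 2 = (32 / γ + 2) * h ^ 2 := by ring
    have e3 : 2 * U = 2 * h ^ 2 := by rw [hh2]
    linarith
  by_contra hcon
  push Not at hcon
  have := mul_lt_mul_of_pos_left hcon hh2pos
  linarith

/-- `1/U ≤ e^{a/U}` once `0 < U ≤ a²/4` (`1/U ≤ (a/2U)² ≤ (e^{a/2U})²`). [folklore] -/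
theorem one_div_le_exp_div {U a : ℝ} (hU : 0 < U) (ha : 0 ≤ a) (hUa : U ≤ a ^ 2 / 4) :
    1 / U ≤ Real.exp (a / U) := by
  have step2 : 1 / U ≤ (a / (2 * U)) ^ 2 := by
    rw [div_pow, div_le_div_iff₀ hU (by positivity)]
    nlinarith
  have step3 : (a / (2 * U)) ^ 2 ≤ Real.exp (a / U) := by
    have e1 : a / (2 * U) ≤ Real.exp (a / (2 * U)) := by
      linarith [Real.add_one_le_exp (a / (2 * U))]
    have e2 : 0 ≤ a / (2 * U) := by positivity
    calc (a / (2 * U)) ^ 2 ≤ Real.exp (a / (2 * U)) ^ 2 := pow_le_pow_left₀ e2 e1 2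
      _ = Real.exp (a / U) := by rw [sq, ← Real.exp_add]; congr 1; ring
  exact step2.trans step3

/-- The crux with its finite-size threshold `L₀` chosen BEFORE `(U, β, μ)` (it may depend on
`μ₁, μ₂, U₀, a, c, C, h₀`). -/
def TwSourcedCondensationUniformL0 : Prop :=
  ∀ μ₁ μ₂ : ℝ, -4 < μ₁ → μ₁ ≤ μ₂ → μ₂ < 0 → ∃ U₀ a c C h₀ : ℝ, ∃ L₀ : ℕ, 0 < U₀ ∧ 0 < a ∧ 0 < c ∧
    0 < C ∧ 0 < h₀ ∧ ∀ U : ℝ, 0 < U → U ≤ U₀ → ∀ β : ℝ, 1 ≤ β → β ≤ Real.exp (a / U) →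
    ∀ μ ∈ Set.Icc μ₁ μ₂, ∀ (L : ℕ) [NeZero L], L₀ ≤ L → ∀ h : ℝ, |h| ≤ h₀ →
      c * h ^ 2 * Real.log (1 / (|h| + 1 / β)) - C * h ^ 2 ≤ pTilde β L U μ h - pTilde β L U μ 0

/-- **No finite-size threshold can be chosen before the temperature: `¬ TwSourcedCondensationUniformL0`**
(UNCONDITIONAL; supersedes the conditional §7a/§7b). Witness: interval `[-3,-1]`; given `L₀`, the torus
`L = max(L₀,3)` and a generic `μ ∈ [-3,-1]` off its finite level set (gap `γ > 0`); then `β = 1/U`,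
`h = √U` with `U = min(U₀, 1, h₀², a²/4, e^{-M-1})`, `M = 2(32/γ + 2 + C + c log 2)/c`: the response
is `≤ (32/γ + 2)h²` (`levelGap_obstruction`) while the floor is `≥ h²(c(½ log(1/U) - log 2) - C)`. [folklore] -/
theorem twSourcedCondensation_false_uniformL0 : ¬ TwSourcedCondensationUniformL0 := by
  intro H
  obtain ⟨U₀, a, c, C, h₀, L₀, hU₀, ha, hc, hC, hh₀, H⟩ :=
    H (-3) (-1) (by norm_num) (by norm_num) (by norm_num)
  set L : ℕ := max L₀ 3 with hLdef
  have hL3 : 3 ≤ L := le_max_right _ _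
  have hL₀ : L₀ ≤ L := le_max_left _ _
  haveI : NeZero L := ⟨by omega⟩
  obtain ⟨μ, hμ, γ, hγ, hgap⟩ := exists_mu_off_levels L (show (-3 : ℝ) < -1 by norm_num)
  set A : ℝ := 32 / γ + 2 with hA
  have hA0 : 0 ≤ A := by positivity
  have hlog2 : 0 < Real.log 2 := Real.log_pos one_lt_two
  set M : ℝ := 2 * (A + C + c * Real.log 2) / c with hM
  have hM0 : 0 ≤ M := by positivity
  set U : ℝ := min U₀ (min (min 1 (h₀ ^ 2)) (min (a ^ 2 / 4) (Real.exp (-M - 1)))) with hU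
  have hUpos : 0 < U := by positivity
  have hUU₀ : U ≤ U₀ := min_le_left _ _
  have hU1 : U ≤ 1 := (min_le_right _ _).trans ((min_le_left _ _).trans (min_le_left _ _))
  have hU2 : U ≤ h₀ ^ 2 := (min_le_right _ _).trans ((min_le_left _ _).trans (min_le_right _ _))
  have hU3 : U ≤ a ^ 2 / 4 := (min_le_right _ _).trans ((min_le_right _ _).trans (min_le_left _ _))
  have hU4 : U ≤ Real.exp (-M - 1) := (min_le_right _ _).trans ((min_le_right _ _).trans (min_le_right _ _))
  -- the admissible point `β = 1/U`, `h = √U`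
  have hβ1 : 1 ≤ 1 / U := by rw [le_div_iff₀ hUpos, one_mul]; exact hU1
  have hβexp : 1 / U ≤ Real.exp (a / U) := one_div_le_exp_div hUpos ha.le hU3
  have hhh₀ : |Real.sqrt U| ≤ h₀ := by
    rw [abs_of_nonneg (Real.sqrt_nonneg U), ← Real.sqrt_sq hh₀.le]
    exact Real.sqrt_le_sqrt hU2
  have key := H U hUpos hUU₀ (1 / U) hβ1 hβexp μ hμ L hL₀ (Real.sqrt U) hhh₀
  have core := levelGap_obstruction hL3 hγ hgap hUpos hU1 hc key
  -- but `log(1/U) ≥ M + 1`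
  have hlogU : M + 1 ≤ Real.log (1 / U) := by
    have h2 : Real.log U ≤ -M - 1 := by
      rw [← Real.log_exp (-M - 1)]; exact Real.log_le_log hUpos hU4
    rw [one_div, Real.log_inv]
    linarith
  have hc0 : c ≠ 0 := hc.ne'
  have hcM : c * M / 2 = A + C + c * Real.log 2 := by
    rw [hM]; field_simp
  have h1 : c * (M + 1) ≤ c * Real.log (1 / U) := mul_le_mul_of_nonneg_left hlogU hc.le
  linarith

/-- A frozen threshold is a uniform one. [folklore] -/
theorem uniformL0_of_fromSide (ℓ : ℕ) (H : TwSourcedCondensationFromSide ℓ) :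
    TwSourcedCondensationUniformL0 := by
  intro μ₁ μ₂ h1 h2 h3
  obtain ⟨U₀, a, c, C, h₀, hU₀, ha, hc, hC, hh₀, H⟩ := H μ₁ μ₂ h1 h2 h3
  exact ⟨U₀, a, c, C, h₀, ℓ, hU₀, ha, hc, hC, hh₀, H⟩

/-- **The frozen-threshold strengthening is FALSE at EVERY side `ℓ`, unconditionally**
(gen 2 had it modulo `ClusterGapHypothesis` / `FreeClusterGap`). [folklore] -/
theorem twSourcedCondensation_false_fromSide (ℓ : ℕ) : ¬ TwSourcedCondensationFromSide ℓ :=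
  fun H => twSourcedCondensation_false_uniformL0 (uniformL0_of_fromSide ℓ H)

/-! ### 8b. The band hypothesis `-4 < μ₁` is LOAD-BEARING (below the band: no Cooper logarithm, and the
level gap is `L`-independent, so no control of `L₀` is needed) -/

/-- Below the band every free level of every torus avoids `μ` by `γ`: `μ ≤ -4 - γ` gives `γ ≤ |ε_L(k) - μ|`
(`ε_L(k) ≥ -4`). [folklore] -/
theorem levelGap_belowBand (L : ℕ) {μ γ : ℝ} (hμ : μ ≤ -4 - γ) (k : TorusSite 2 L) :
    γ ≤ |torusBand L k - μ| := by
  have h4 := neg_four_le_torusBand L k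
  have h1 : γ ≤ torusBand L k - μ := by linarith
  exact h1.trans (le_abs_self _)

/-- **The band hypothesis `-4 < μ₁` is LOAD-BEARING in the crux.** With it dropped (interval `[-5,-5]` below the
band bottom) the statement is FALSE: all free levels avoid `μ = -5` by `γ = 1` on EVERY torus, so the response is
`≤ (32 + 2)h²` at `β = 1/U`, `h = √U` whatever `L₀(U,β,μ)` is (`levelGap_obstruction`), while the floor is
`h²(c(½ log(1/U) - log 2) - C)`. Below the band `ρ_d(μ) = 0`: there is no Cooper logarithm. [folklore] -/
theorem twSourcedCondensation_false_belowBand :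
    ¬ (∀ μ₁ μ₂ : ℝ, μ₁ ≤ μ₂ → μ₂ < 0 → ∃ U₀ a c C h₀ : ℝ, 0 < U₀ ∧ 0 < a ∧ 0 < c ∧ 0 < C ∧ 0 < h₀ ∧
      ∀ U : ℝ, 0 < U → U ≤ U₀ → ∀ β : ℝ, 1 ≤ β → β ≤ Real.exp (a / U) →
      ∀ μ ∈ Set.Icc μ₁ μ₂, ∃ L₀ : ℕ, ∀ (L : ℕ) [NeZero L], L₀ ≤ L → ∀ h : ℝ, |h| ≤ h₀ →
        c * h ^ 2 * Real.log (1 / (|h| + 1 / β)) - C * h ^ 2 ≤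
          Real.log (partitionFn β (dWaveSourceTorus L U μ h)).re / (β * (L : ℝ) ^ 2) -
            Real.log (partitionFn β (dWaveSourceTorus L U μ 0)).re / (β * (L : ℝ) ^ 2)) := by
  intro H
  obtain ⟨U₀, a, c, C, h₀, hU₀, ha, hc, hC, hh₀, H⟩ := H (-5) (-5) le_rfl (by norm_num)
  have hlog2 : 0 < Real.log 2 := Real.log_pos one_lt_two
  set A : ℝ := 32 / 1 + 2 with hA
  have hA0 : 0 ≤ A := by positivity
  set M : ℝ := 2 * (A + C + c * Real.log 2) / c with hM
  have hM0 : 0 ≤ M := by positivity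
  set U : ℝ := min U₀ (min (min 1 (h₀ ^ 2)) (min (a ^ 2 / 4) (Real.exp (-M - 1)))) with hU
  have hUpos : 0 < U := by positivity
  have hUU₀ : U ≤ U₀ := min_le_left _ _
  have hU1 : U ≤ 1 := (min_le_right _ _).trans ((min_le_left _ _).trans (min_le_left _ _))
  have hU2 : U ≤ h₀ ^ 2 := (min_le_right _ _).trans ((min_le_left _ _).trans (min_le_right _ _))
  have hU3 : U ≤ a ^ 2 / 4 := (min_le_right _ _).trans ((min_le_right _ _).trans (min_le_left _ _))
  have hU4 : U ≤ Real.exp (-M - 1) := (min_le_right _ _).trans ((min_le_right _ _).trans (min_le_right _ _))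
  have hβ1 : 1 ≤ 1 / U := by rw [le_div_iff₀ hUpos, one_mul]; exact hU1
  have hβexp : 1 / U ≤ Real.exp (a / U) := one_div_le_exp_div hUpos ha.le hU3
  have hhh₀ : |Real.sqrt U| ≤ h₀ := by
    rw [abs_of_nonneg (Real.sqrt_nonneg U), ← Real.sqrt_sq hh₀.le]
    exact Real.sqrt_le_sqrt hU2
  obtain ⟨L₀, hL₀⟩ := H U hUpos hUU₀ (1 / U) hβ1 hβexp (-5) ⟨le_rfl, le_rfl⟩
  set L : ℕ := max L₀ 3 with hLdef
  have hL3 : 3 ≤ L := le_max_right _ _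
  have hLL₀ : L₀ ≤ L := le_max_left _ _
  haveI : NeZero L := ⟨by omega⟩
  have hgap : ∀ k : TorusSite 2 L, (1 : ℝ) ≤ |torusBand L k - (-5)| :=
    fun k => levelGap_belowBand L (by norm_num) k
  have key := hL₀ L hLL₀ (Real.sqrt U) hhh₀
  have core := levelGap_obstruction hL3 one_pos hgap hUpos hU1 hc key
  have hlogU : M + 1 ≤ Real.log (1 / U) := by
    have h2 : Real.log U ≤ -M - 1 := by
      rw [← Real.log_exp (-M - 1)]; exact Real.log_le_log hUpos hU4
    rw [one_div, Real.log_inv]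
    linarith
  have hc0 : c ≠ 0 := hc.ne'
  have hcM : c * M / 2 = A + C + c * Real.log 2 := by
    rw [hM]; field_simp
  have h1 : c * (M + 1) ≤ c * Real.log (1 / U) := mul_le_mul_of_nonneg_left hlogU hc.le
  have hA' : (32 : ℝ) / 1 + 2 = A := rfl
  linarith

/-- **The band hypothesis is load-bearing in the lead's free stub (F) too**: with `μ₁ = μ₂ = -5` the free
response is `≤ 32h²` for every `β` and every `L ≥ 3` (`free_gain_le_of_levelGap`, gap `1`), while the stub's floor at
`h = 1/β` is `(c₀ log β - C₀)/β²`. [folklore] -/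
theorem stub_freeLinearCooperLog_false_belowBand :
    ¬ (∀ μ₁ μ₂ : ℝ, μ₁ ≤ μ₂ → μ₂ < 0 → ∃ c₀ C₀ : ℝ, 0 < c₀ ∧ 0 < C₀ ∧ ∀ β : ℝ, 1 ≤ β →
      ∀ μ ∈ Set.Icc μ₁ μ₂, ∃ L₀ : ℕ, ∀ (L : ℕ) [NeZero L], L₀ ≤ L → ∀ h : ℝ, |h| ≤ 1 / β →
        c₀ * h ^ 2 * Real.log β - C₀ * h ^ 2 ≤
          Real.log (partitionFn β (dWaveSourceTorus L 0 μ h)).re / (β * (L : ℝ) ^ 2) -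
            Real.log (partitionFn β (dWaveSourceTorus L 0 μ 0)).re / (β * (L : ℝ) ^ 2)) := by
  intro H
  obtain ⟨c₀, C₀, hc₀, hC₀, H⟩ := H (-5) (-5) le_rfl (by norm_num)
  set β : ℝ := Real.exp ((32 / 1 + C₀) / c₀ + 1) with hβ
  have hβpos : 0 < β := Real.exp_pos _
  have hβ1 : 1 ≤ β := Real.one_le_exp (by positivity)
  obtain ⟨L₀, hL₀⟩ := H β hβ1 (-5) ⟨le_rfl, le_rfl⟩
  set L : ℕ := max L₀ 3 with hLdef
  have hL3 : 3 ≤ L := le_max_right _ _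
  have hLL₀ : L₀ ≤ L := le_max_left _ _
  haveI : NeZero L := ⟨by omega⟩
  have hgap : ∀ k : TorusSite 2 L, (1 : ℝ) ≤ |torusBand L k - (-5)| :=
    fun k => levelGap_belowBand L (by norm_num) k
  have key := hL₀ L hLL₀ (1 / β) (by rw [abs_of_pos (one_div_pos.2 hβpos)])
  have hcap := free_gain_le_of_levelGap hL3 one_pos hgap hβpos (1 / β)
  unfold pTilde at hcap
  have hlogβ : Real.log β = (32 / 1 + C₀) / c₀ + 1 := by rw [hβ, Real.log_exp]
  rw [hlogβ] at key
  have hh2 : 0 < (1 / β) ^ 2 := by positivity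
  have hc0 : c₀ ≠ 0 := hc₀.ne'
  have e : c₀ * ((32 / 1 + C₀) / c₀ + 1) - C₀ = 32 / 1 + c₀ := by field_simp; ring
  have : (c₀ * ((32 / 1 + C₀) / c₀ + 1) - C₀) * (1 / β) ^ 2 ≤ 32 / 1 * (1 / β) ^ 2 := by
    have e2 : 32 * (1 / β) ^ 2 / 1 = 32 / 1 * (1 / β) ^ 2 := by ring
    nlinarith
  rw [e] at this
  nlinarith [mul_pos hc₀ hh2]


/-- Orientation: the uniform-threshold version implies the crux. [folklore] -/
theorem crux_of_uniformL0 (H : TwSourcedCondensationUniformL0) : Crux := by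
  rw [crux_iff]
  intro μ₁ μ₂ h1 h2 h3
  obtain ⟨U₀, a, c, C, h₀, L₀, hU₀, ha, hc, hC, hh₀, H⟩ := H μ₁ μ₂ h1 h2 h3
  exact ⟨U₀, a, c, C, h₀, hU₀, ha, hc, hC, hh₀, fun U hU hUU β hβ1 hβa μ hμ =>
    ⟨L₀, fun L _ hL h hh => H U hU hUU β hβ1 hβa μ hμ L hL h hh⟩⟩

/-- The `∀ L` version is a uniform one (`L₀ = 0`); so §4a is also a corollary of §8. [folklore] -/
theorem uniformL0_of_allL (H : TwSourcedCondensationAllL) : TwSourcedCondensationUniformL0 := by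
  intro μ₁ μ₂ h1 h2 h3
  obtain ⟨U₀, a, c, C, h₀, hU₀, ha, hc, hC, hh₀, H⟩ := H μ₁ μ₂ h1 h2 h3
  exact ⟨U₀, a, c, C, h₀, 0, hU₀, ha, hc, hC, hh₀, fun U hU hUU β hβ1 hβa μ hμ L _ _ h hh =>
    H U hU hUU β hβ1 hβa μ hμ L h hh⟩

end UniformThreshold

/-! ## §9 TARGETS: the lead's four registered stubs (line `entropy-staircase-linear-regime`,
skeleton `f819e3d0`) -/

section Targets

/-! ### (F) `stub_freeLinearCooperLog`: survives; its `L₀`-uniform version is FALSE -/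

/-- The registered stub (F), verbatim up to the abbreviation `pTilde`. -/
def StubFreeLinearCooperLog : Prop :=
  ∀ μ₁ μ₂ : ℝ, -4 < μ₁ → μ₁ ≤ μ₂ → μ₂ < 0 → ∃ c₀ C₀ : ℝ, 0 < c₀ ∧ 0 < C₀ ∧ ∀ β : ℝ, 1 ≤ β →
    ∀ μ ∈ Set.Icc μ₁ μ₂, ∃ L₀ : ℕ, ∀ (L : ℕ) [NeZero L], L₀ ≤ L → ∀ h : ℝ, |h| ≤ 1 / β →
      c₀ * h ^ 2 * Real.log β - C₀ * h ^ 2 ≤ pTilde β L 0 μ h - pTilde β L 0 μ 0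

/-- Stub (F) with the threshold chosen before `β, μ`. -/
def StubFreeLinearCooperLogUniformL0 : Prop :=
  ∀ μ₁ μ₂ : ℝ, -4 < μ₁ → μ₁ ≤ μ₂ → μ₂ < 0 → ∃ c₀ C₀ : ℝ, ∃ L₀ : ℕ, 0 < c₀ ∧ 0 < C₀ ∧ ∀ β : ℝ, 1 ≤ β →
    ∀ μ ∈ Set.Icc μ₁ μ₂, ∀ (L : ℕ) [NeZero L], L₀ ≤ L → ∀ h : ℝ, |h| ≤ 1 / β →
      c₀ * h ^ 2 * Real.log β - C₀ * h ^ 2 ≤ pTilde β L 0 μ h - pTilde β L 0 μ 0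

/-- Orientation: the uniform version is the stronger one. [folklore] -/
theorem stubFreeLinearCooperLog_of_uniformL0 (H : StubFreeLinearCooperLogUniformL0) :
    StubFreeLinearCooperLog := by
  intro μ₁ μ₂ h1 h2 h3
  obtain ⟨c₀, C₀, L₀, hc₀, hC₀, H⟩ := H μ₁ μ₂ h1 h2 h3
  exact ⟨c₀, C₀, hc₀, hC₀, fun β hβ μ hμ => ⟨L₀, fun L _ hL h hh => H β hβ μ hμ L hL h hh⟩⟩

/-- **TARGET (F): the `L₀`-uniform free Cooper logarithm is FALSE.** On a torus whose free levels avoid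
`μ` by `γ` the free response is `≤ 32h²/γ` for EVERY `β` (`free_gain_le_of_levelGap`), while the stub's
floor at `h = 1/β` is `(c₀ log β - C₀)/β² → ∞·β⁻²`. Witness: `[-3,-1]`, `L = max(L₀,3)`, generic `μ`,
`β = exp((32/γ + C₀)/c₀ + 1)`, `h = 1/β`. MESSAGE: in (F) the threshold `L₀(β,μ)` must grow with `β`
(a level of the torus within `O(1/(c₀ log β))` of `μ` is necessary): `L ≳ β` is the natural regime. [folklore] -/
theorem stub_freeLinearCooperLog_false_uniformL0 : ¬ StubFreeLinearCooperLogUniformL0 := by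
  intro H
  obtain ⟨c₀, C₀, L₀, hc₀, hC₀, H⟩ := H (-3) (-1) (by norm_num) (by norm_num) (by norm_num)
  set L : ℕ := max L₀ 3 with hLdef
  have hL3 : 3 ≤ L := le_max_right _ _
  have hL₀ : L₀ ≤ L := le_max_left _ _
  haveI : NeZero L := ⟨by omega⟩
  obtain ⟨μ, hμ, γ, hγ, hgap⟩ := exists_mu_off_levels L (show (-3 : ℝ) < -1 by norm_num)
  set β : ℝ := Real.exp ((32 / γ + C₀) / c₀ + 1) with hβ
  have hβpos : 0 < β := Real.exp_pos _
  have hβ1 : 1 ≤ β := Real.one_le_exp (by positivity)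
  have key := H β hβ1 μ hμ L hL₀ (1 / β) (by rw [abs_of_pos (one_div_pos.2 hβpos)])
  have hcap := free_gain_le_of_levelGap hL3 hγ hgap hβpos (1 / β)
  rw [hβ, Real.log_exp] at key
  have hh2 : 0 < (1 / β) ^ 2 := by positivity
  have hc0 : c₀ ≠ 0 := hc₀.ne'
  have e : c₀ * ((32 / γ + C₀) / c₀ + 1) - C₀ = 32 / γ + c₀ := by field_simp; ring
  have : (c₀ * ((32 / γ + C₀) / c₀ + 1) - C₀) * (1 / β) ^ 2 ≤ 32 / γ * (1 / β) ^ 2 := by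
    have e2 : 32 * (1 / β) ^ 2 / γ = 32 / γ * (1 / β) ^ 2 := by ring
    nlinarith
  rw [e] at this
  nlinarith [mul_pos hc₀ hh2]

/-! ### (Fh) `stub_freeLinearThermalLaw`: survives; the source is DECORATIVE (the free heat chord is
maximal at `h = 0`); its `L₀`-uniform version is FALSE at a resonant torus -/

/-- Exact free `log Z` at ANY source (`L ≥ 3`):
`log Z_β(H_L(0,μ,s)) = 2L² log 2 + Σ_k [-βξ_k + log((1 + cosh βE_k(s))/2)]`. [folklore] -/
theorem log_partitionFn_free (L : ℕ) [NeZero L] (hL : 3 ≤ L) (β μ s : ℝ) :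
    Real.log (partitionFn β (dWaveSourceTorus L 0 μ s)).re =
      (Fintype.card (Orb (FermionTorus 2 L)) : ℝ) * Real.log 2 +
        ∑ k : TorusSite 2 L, (-(β * (torusBand L k - μ)) +
          Real.log ((1 + Real.cosh (β * Real.sqrt ((torusBand L k - μ) ^ 2 +
            (2 * Real.sqrt 2 * s * dWaveGap k) ^ 2))) / 2)) := by
  rw [partitionFn_dWaveSourceTorus_zero_re hL β μ s]
  have hpow : (0 : ℝ) < (2 : ℝ) ^ Fintype.card (Orb (FermionTorus 2 L)) := by positivity
  have hfac : ∀ k : TorusSite 2 L, Real.exp (-(β * (torusBand L k - μ))) *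
      ((1 + Real.cosh (β * Real.sqrt ((torusBand L k - μ) ^ 2 + (2 * Real.sqrt 2 * s * dWaveGap k) ^ 2))) / 2) ≠ 0 :=
    fun k => (bdgModeFactor_pos β _ _).ne'
  rw [Real.log_mul hpow.ne' (Finset.prod_ne_zero_iff.2 fun k _ => hfac k), Real.log_pow,
    Real.log_prod (hf := fun k _ => hfac k)]
  congr 1
  refine Finset.sum_congr rfl fun k _ => ?_
  have hcosh : 0 < (1 + Real.cosh (β * Real.sqrt ((torusBand L k - μ) ^ 2 +
      (2 * Real.sqrt 2 * s * dWaveGap k) ^ 2))) / 2 := by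
    have := Real.one_le_cosh (β * Real.sqrt ((torusBand L k - μ) ^ 2 + (2 * Real.sqrt 2 * s * dWaveGap k) ^ 2))
    positivity
  rw [Real.log_mul (Real.exp_pos _).ne' hcosh.ne', Real.log_exp]

/-- The dyadic per-mode function `ψ = 2 log((1+cosh(βS/2))/2) - log((1+cosh βS)/2)` is `≥ -2 log 2`
(`cosh²(y/2) ≤ (1 + cosh(y/2))²`). [folklore] -/
theorem dyadicMode_ge (β S : ℝ) :
    -(2 * Real.log 2) ≤
      2 * Real.log ((1 + Real.cosh (β / 2 * S)) / 2) - Real.log ((1 + Real.cosh (β * S)) / 2) := by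
  have hc := Real.one_le_cosh (β / 2 * S)
  have hpos2 : 0 < (1 + Real.cosh (β / 2 * S)) / 2 := by positivity
  have hpos1 : 0 < (1 + Real.cosh (β * S)) / 2 := by have := Real.one_le_cosh (β * S); positivity
  have key : (1 + Real.cosh (β * S)) / 2 ≤ (2 * ((1 + Real.cosh (β / 2 * S)) / 2)) ^ 2 := by
    rw [one_add_cosh (β * S), show β * S / 2 = β / 2 * S by ring]
    nlinarith
  have := Real.log_le_log hpos1 key
  rw [Real.log_pow, Real.log_mul two_ne_zero hpos2.ne'] at this
  push_cast at this
  linarith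

/-- Sum bookkeeping: `2(A + Σa) - (A + Σb) = A + Σc` when `2a_k - b_k = c_k`. [folklore] -/
theorem two_mul_add_sum_sub {ι : Type*} [Fintype ι] (A : ℝ) (a b c : ι → ℝ)
    (h : ∀ k, 2 * a k - b k = c k) :
    2 * (A + ∑ k, a k) - (A + ∑ k, b k) = A + ∑ k, c k := by
  rw [← Finset.sum_congr rfl fun k _ => h k, Finset.sum_sub_distrib, ← Finset.mul_sum]
  ring

/-- **Exact dyadic identity for the free heat chord numerator** (`L ≥ 3`, any source `s`):
`2 log Z_{β/2}(s) - log Z_β(s) = 2L² log 2 + Σ_k ψ_k`, `ψ_k = 2 log((1+cosh(βE_k/2))/2) - log((1+cosh βE_k)/2)`.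
[folklore] -/
theorem two_log_half_sub_log_free (L : ℕ) [NeZero L] (hL : 3 ≤ L) (β μ s : ℝ) :
    2 * Real.log (partitionFn (β / 2) (dWaveSourceTorus L 0 μ s)).re -
        Real.log (partitionFn β (dWaveSourceTorus L 0 μ s)).re =
      (Fintype.card (Orb (FermionTorus 2 L)) : ℝ) * Real.log 2 +
        ∑ k : TorusSite 2 L,
          (2 * Real.log ((1 + Real.cosh (β / 2 * Real.sqrt ((torusBand L k - μ) ^ 2 +
              (2 * Real.sqrt 2 * s * dWaveGap k) ^ 2))) / 2) -
            Real.log ((1 + Real.cosh (β * Real.sqrt ((torusBand L k - μ) ^ 2 +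
              (2 * Real.sqrt 2 * s * dWaveGap k) ^ 2))) / 2)) := by
  rw [log_partitionFn_free L hL, log_partitionFn_free L hL]
  refine two_mul_add_sum_sub _ _ _ _ fun k => ?_
  ring

/-- **The free heat chord of a torus with a zero mode is at least `2 log 2/(βL²)`** (`L ≥ 3`, `h = 0`,
`ε_L(q) = μ`): every exact zero mode keeps entropy `2 log 2` down to `T = 0`. [folklore] -/
theorem free_heatChord_ge_of_zeroMode (L : ℕ) [NeZero L] (hL : 3 ≤ L) {μ : ℝ} (q : TorusSite 2 L)
    (hq : torusBand L q = μ) {β : ℝ} (hβ : 0 < β) :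
    2 * Real.log 2 / (β * (L : ℝ) ^ 2) ≤ pTilde (β / 2) L 0 μ 0 - pTilde β L 0 μ 0 := by
  have hL2 : (0 : ℝ) < (L : ℝ) ^ 2 := cast_sq_pos_of_neZero L
  have hden : 0 < β * (L : ℝ) ^ 2 := mul_pos hβ hL2
  have hchord : pTilde (β / 2) L 0 μ 0 - pTilde β L 0 μ 0 =
      (2 * Real.log (partitionFn (β / 2) (dWaveSourceTorus L 0 μ 0)).re -
        Real.log (partitionFn β (dWaveSourceTorus L 0 μ 0)).re) / (β * (L : ℝ) ^ 2) := by
    rw [pTilde, pTilde]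
    field_simp
  rw [hchord, two_log_half_sub_log_free L hL]
  refine div_le_div_of_nonneg_right ?_ hden.le
  -- the sum: `ψ_q = 0`, `ψ_k ≥ -2 log 2` elsewhere, `card Orb = 2L²`
  set ψ : TorusSite 2 L → ℝ := fun k =>
    2 * Real.log ((1 + Real.cosh (β / 2 * Real.sqrt ((torusBand L k - μ) ^ 2 +
        (2 * Real.sqrt 2 * 0 * dWaveGap k) ^ 2))) / 2) -
      Real.log ((1 + Real.cosh (β * Real.sqrt ((torusBand L k - μ) ^ 2 +
        (2 * Real.sqrt 2 * 0 * dWaveGap k) ^ 2))) / 2) with hψ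
  have hψq : ψ q = 0 := by
    simp only [hψ, hq, sub_self, mul_zero, zero_mul, ne_eq, OfNat.ofNat_ne_zero, not_false_eq_true,
      zero_pow, add_zero, Real.sqrt_zero, Real.cosh_zero]
    norm_num
  have hψk : ∀ k, -(2 * Real.log 2) ≤ ψ k := fun k => dyadicMode_ge β _
  have hsum : -(2 * Real.log 2) * ((L : ℝ) ^ 2 - 1) ≤ ∑ k, ψ k := by
    rw [← Finset.add_sum_erase Finset.univ ψ (Finset.mem_univ q), hψq, zero_add]
    have hcard : ((Finset.univ.erase q).card : ℝ) = (L : ℝ) ^ 2 - 1 := by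
      rw [Finset.card_erase_of_mem (Finset.mem_univ q), Finset.card_univ, card_torusSite_two]
      have : 1 ≤ L ^ 2 := Nat.one_le_pow _ _ (Nat.pos_of_ne_zero (NeZero.ne L))
      push_cast [Nat.cast_sub this]
      ring
    calc -(2 * Real.log 2) * ((L : ℝ) ^ 2 - 1) = ∑ _k ∈ Finset.univ.erase q, -(2 * Real.log 2) := by
          rw [Finset.sum_const, nsmul_eq_mul, hcard]; ring
      _ ≤ ∑ k ∈ Finset.univ.erase q, ψ k := Finset.sum_le_sum fun k _ => hψk k
  have hcardOrb : (Fintype.card (Orb (FermionTorus 2 L)) : ℝ) = 2 * (L : ℝ) ^ 2 := by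
    rw [card_orb_fermionTorus_two]; push_cast; ring
  change 2 * Real.log 2 ≤ (Fintype.card (Orb (FermionTorus 2 L)) : ℝ) * Real.log 2 + ∑ k, ψ k
  rw [hcardOrb]
  nlinarith [Real.log_pos one_lt_two]

/-- The dyadic per-mode function is ANTITONE in the quasi-particle energy: for `β ≥ 0` and
`0 ≤ E ≤ E'`, `ψ(E') ≤ ψ(E)` where `ψ(E) = 2 log((1+cosh(βE/2))/2) - log((1+cosh βE)/2)`
(`ψ = 2 log(u²/(2u²-1))`, `u = cosh(βE/4) ≥ 1` increasing in `E`, `u²/(2u²-1)` decreasing in `u`). [folklore] -/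
theorem dyadicMode_antitone {β E E' : ℝ} (hβ : 0 ≤ β) (hE : 0 ≤ E) (hEE' : E ≤ E') :
    2 * Real.log ((1 + Real.cosh (β / 2 * E')) / 2) - Real.log ((1 + Real.cosh (β * E')) / 2) ≤
      2 * Real.log ((1 + Real.cosh (β / 2 * E)) / 2) - Real.log ((1 + Real.cosh (β * E)) / 2) := by
  -- `u = cosh(βE/4)`, `u' = cosh(βE'/4)`
  set u : ℝ := Real.cosh (β / 2 * E / 2) with hu
  set u' : ℝ := Real.cosh (β / 2 * E' / 2) with hu'
  have hu1 : 1 ≤ u := Real.one_le_cosh _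
  have hu'1 : 1 ≤ u' := Real.one_le_cosh _
  have hE' : 0 ≤ E' := hE.trans hEE'
  have huu' : u ≤ u' := by
    rw [hu, hu', Real.cosh_le_cosh, abs_of_nonneg (by positivity), abs_of_nonneg (by positivity)]
    have := mul_le_mul_of_nonneg_left hEE' hβ
    linarith
  -- the four `(1 + cosh)/2` factors through `u, u'`
  have hA : (1 + Real.cosh (β / 2 * E)) / 2 = u ^ 2 := by
    rw [one_add_cosh (β / 2 * E)]; ring
  have hA' : (1 + Real.cosh (β / 2 * E')) / 2 = u' ^ 2 := by
    rw [one_add_cosh (β / 2 * E')]; ring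
  have hB : (1 + Real.cosh (β * E)) / 2 = (2 * u ^ 2 - 1) ^ 2 := by
    rw [one_add_cosh (β * E)]
    have : Real.cosh (β * E / 2) = 2 * u ^ 2 - 1 := by
      have h1 := one_add_cosh (β * E / 2)
      rw [show β * E / 2 / 2 = β / 2 * E / 2 by ring] at h1
      linarith
    rw [this]; ring
  have hB' : (1 + Real.cosh (β * E')) / 2 = (2 * u' ^ 2 - 1) ^ 2 := by
    rw [one_add_cosh (β * E')]
    have : Real.cosh (β * E' / 2) = 2 * u' ^ 2 - 1 := by
      have h1 := one_add_cosh (β * E' / 2)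
      rw [show β * E' / 2 / 2 = β / 2 * E' / 2 by ring] at h1
      linarith
    rw [this]; ring
  rw [hA, hA', hB, hB']
  have hupos : 0 < u := by linarith
  have hu'pos : 0 < u' := by linarith
  have hv : 0 < 2 * u ^ 2 - 1 := by nlinarith
  have hv' : 0 < 2 * u' ^ 2 - 1 := by nlinarith
  rw [Real.log_pow, Real.log_pow, Real.log_pow, Real.log_pow]
  push_cast
  -- reduce to `log(u'²... )`: `2·2 log u' - 2 log(2u'²-1) ≤ 2·2 log u - 2 log(2u²-1)`
  have key : Real.log (u' ^ 2 / (2 * u' ^ 2 - 1)) ≤ Real.log (u ^ 2 / (2 * u ^ 2 - 1)) := by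
    refine Real.log_le_log (by positivity) ?_
    rw [div_le_div_iff₀ hv' hv]
    nlinarith [mul_le_mul huu' huu' hupos.le hu'pos.le]
  rw [Real.log_div (by positivity) hv'.ne', Real.log_div (by positivity) hv.ne', Real.log_pow,
    Real.log_pow] at key
  push_cast at key
  linarith

/-- **In stub (Fh) the source is DECORATIVE: the free heat chord is maximal at `h = 0`.** For `L ≥ 3`,
`β > 0`, all `μ` and every real source `s`:
`p̃₀(β/2,s) - p̃₀(β,s) ≤ p̃₀(β/2,0) - p̃₀(β,0)` (the BdG energies `E_k(s) ≥ |ξ_k|` only lower the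
dyadic entropy increment, mode by mode). So (Fh) need only be proved for the number-conserving free
gas at `h = 0` (a Sommerfeld bound); the window `|h| ≤ 1/β` plays no role in it. [folklore] -/
theorem free_heatChord_le_zero_source (L : ℕ) [NeZero L] (hL : 3 ≤ L) {β : ℝ} (hβ : 0 < β)
    (μ s : ℝ) :
    pTilde (β / 2) L 0 μ s - pTilde β L 0 μ s ≤ pTilde (β / 2) L 0 μ 0 - pTilde β L 0 μ 0 := by
  have hL2 : (0 : ℝ) < (L : ℝ) ^ 2 := cast_sq_pos_of_neZero L
  have hden : 0 < β * (L : ℝ) ^ 2 := mul_pos hβ hL2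
  have hchord : ∀ t : ℝ, pTilde (β / 2) L 0 μ t - pTilde β L 0 μ t =
      (2 * Real.log (partitionFn (β / 2) (dWaveSourceTorus L 0 μ t)).re -
        Real.log (partitionFn β (dWaveSourceTorus L 0 μ t)).re) / (β * (L : ℝ) ^ 2) := by
    intro t
    rw [pTilde, pTilde]
    field_simp
  rw [hchord s, hchord 0, two_log_half_sub_log_free L hL, two_log_half_sub_log_free L hL]
  refine div_le_div_of_nonneg_right ?_ hden.le
  rw [add_le_add_iff_left]
  apply Finset.sum_le_sum
  intro k _
  refine dyadicMode_antitone hβ.le (Real.sqrt_nonneg _) (Real.sqrt_le_sqrt ?_)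
  have h0 : (2 * Real.sqrt 2 * (0 : ℝ) * dWaveGap k) ^ 2 = 0 := by ring
  rw [h0]
  nlinarith [sq_nonneg (2 * Real.sqrt 2 * s * dWaveGap k)]

/-- `cos(2π/3) = -1/2`. [folklore] -/
theorem cos_two_pi_div_three : Real.cos (2 * Real.pi * 1 / 3) = -1 / 2 := by
  rw [show 2 * Real.pi * 1 / 3 = Real.pi - Real.pi / 3 by ring, Real.cos_pi_sub, Real.cos_pi_div_three]
  ring

/-- The shell momentum `q = (j, 0)` of the `3j`-torus. -/
def qOn (j : ℕ) : TorusSite 2 (3 * j) := ![((j : ℕ) : ZMod (3 * j)), 0]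

theorem val_qOn_zero {j : ℕ} (hj : 1 ≤ j) : ((qOn j) 0).val = j := by
  rw [qOn, Matrix.cons_val_zero, ZMod.val_natCast]
  exact Nat.mod_eq_of_lt (by omega)

theorem qOn_one (j : ℕ) : (qOn j) 1 = 0 := by
  simp [qOn]

/-- **The `3j`-torus has the free level `ε = -1`** through `q = (j,0)` (`cos(2π/3) = -1/2`). [folklore] -/
theorem torusBand_qOn {j : ℕ} (hj : 1 ≤ j) : torusBand (3 * j) (qOn j) = -1 := by
  have h0 : Real.cos (latticeMomentum (3 * j) (qOn j) 0) = -1 / 2 := by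
    unfold latticeMomentum
    rw [val_qOn_zero hj]
    have hj0 : (j : ℝ) ≠ 0 := by exact_mod_cast (show j ≠ 0 by omega)
    rw [show (2 * Real.pi * (j : ℝ) / ((3 * j : ℕ) : ℝ)) = 2 * Real.pi * 1 / 3 by push_cast; field_simp]
    exact cos_two_pi_div_three
  have h1 : Real.cos (latticeMomentum (3 * j) (qOn j) 1) = 1 := by
    unfold latticeMomentum
    rw [qOn_one, ZMod.val_zero]
    simp
  rw [torusBand, Fin.sum_univ_two, h0, h1]
  norm_num

/-- The registered stub (Fh), verbatim up to `pTilde`. -/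
def StubFreeLinearThermalLaw : Prop :=
  ∀ μ₁ μ₂ : ℝ, -4 < μ₁ → μ₁ ≤ μ₂ → μ₂ < 0 → ∃ C₁ : ℝ, 0 < C₁ ∧ ∀ β : ℝ, 1 ≤ β → ∀ μ ∈ Set.Icc μ₁ μ₂,
    ∃ L₀ : ℕ, ∀ (L : ℕ) [NeZero L], L₀ ≤ L → ∀ h : ℝ, |h| ≤ 1 / β →
      pTilde (β / 2) L 0 μ h - pTilde β L 0 μ h ≤ C₁ / β ^ 2

/-- Stub (Fh) with the threshold chosen before `β, μ`. -/
def StubFreeLinearThermalLawUniformL0 : Prop :=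
  ∀ μ₁ μ₂ : ℝ, -4 < μ₁ → μ₁ ≤ μ₂ → μ₂ < 0 → ∃ C₁ : ℝ, ∃ L₀ : ℕ, 0 < C₁ ∧ ∀ β : ℝ, 1 ≤ β →
    ∀ μ ∈ Set.Icc μ₁ μ₂, ∀ (L : ℕ) [NeZero L], L₀ ≤ L → ∀ h : ℝ, |h| ≤ 1 / β →
      pTilde (β / 2) L 0 μ h - pTilde β L 0 μ h ≤ C₁ / β ^ 2

/-- Orientation. [folklore] -/
theorem stubFreeLinearThermalLaw_of_uniformL0 (H : StubFreeLinearThermalLawUniformL0) :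
    StubFreeLinearThermalLaw := by
  intro μ₁ μ₂ h1 h2 h3
  obtain ⟨C₁, L₀, hC₁, H⟩ := H μ₁ μ₂ h1 h2 h3
  exact ⟨C₁, hC₁, fun β hβ μ hμ => ⟨L₀, fun L _ hL h hh => H β hβ μ hμ L hL h hh⟩⟩

/-- **TARGET (Fh): the `L₀`-uniform free thermal law is FALSE** — at the resonant point `μ = -1` every
`3j`-torus has a zero mode, whose entropy `2 log 2` survives to `T = 0`, so the heat chord is
`≥ 2 log 2/(βL²) ≫ C₁/β²` for `β > C₁L²/(2 log 2)`. Witness: `μ₁ = μ₂ = -1`, `L = 3·max(L₀,1)`, `h = 0`,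
`β = C₁L²/log 2 + 1`. MESSAGE: in (Fh) too `L₀(β,μ)` must grow with `β` (`L₀(β,-1)² ≳ β/C₁`): the
Sommerfeld law needs `L ≫ √β` at resonant `μ`, beyond the thermal length `L ≫ β` everything is safe. [folklore] -/
theorem stub_freeLinearThermalLaw_false_uniformL0 : ¬ StubFreeLinearThermalLawUniformL0 := by
  intro H
  obtain ⟨C₁, L₀, hC₁, H⟩ := H (-1) (-1) (by norm_num) le_rfl (by norm_num)
  set j : ℕ := max L₀ 1 with hjdef
  have hj : 1 ≤ j := le_max_right _ _
  set L : ℕ := 3 * j with hLdef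
  have hL3 : 3 ≤ L := by omega
  have hL₀ : L₀ ≤ L := by omega
  haveI : NeZero L := ⟨by omega⟩
  have hL2 : (0 : ℝ) < (L : ℝ) ^ 2 := cast_sq_pos_of_neZero L
  have hlog2 : 0 < Real.log 2 := Real.log_pos one_lt_two
  set β : ℝ := C₁ * (L : ℝ) ^ 2 / Real.log 2 + 1 with hβ
  have hβ1 : 1 ≤ β := by
    have : 0 ≤ C₁ * (L : ℝ) ^ 2 / Real.log 2 := by positivity
    linarith
  have hβpos : 0 < β := by linarith
  have key := H β hβ1 (-1) ⟨le_rfl, le_rfl⟩ L hL₀ 0 (by rw [abs_zero]; positivity)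
  have hq : torusBand L (qOn j) = -1 := torusBand_qOn hj
  have hfloor := free_heatChord_ge_of_zeroMode L hL3 (qOn j) hq hβpos
  -- `2 log 2/(βL²) ≤ C₁/β²` is impossible for this `β`
  have h1 : 2 * Real.log 2 / (β * (L : ℝ) ^ 2) ≤ C₁ / β ^ 2 := hfloor.trans key
  rw [div_le_div_iff₀ (by positivity) (by positivity)] at h1
  -- `2 log 2 · β² ≤ C₁ β L²` i.e. `2 log 2 · β ≤ C₁ L²`, but `β log 2 = C₁L² + log 2`
  have h2 : 2 * Real.log 2 * β ≤ C₁ * (L : ℝ) ^ 2 := by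
    have := h1
    nlinarith
  have h3 : Real.log 2 * β = C₁ * (L : ℝ) ^ 2 + Real.log 2 := by
    rw [hβ]; field_simp
  nlinarith

/-! ### (F) continued: the window reduces to its CORNER `|h| = 1/β` (prover aid).
The BdG mode gain is CONCAVE in `s²` (`G(v) = log((1+cosh √v)/2)` has `G' = tanh(√v/2)/(2√v)`,
non-increasing because `tanh` is concave on `[0,∞)`), so the free gain per `s²` is non-increasing in
`|s|`, and stub (F) on all of `|h| ≤ 1/β` follows from the single inequality at `|h| = 1/β`
(`stubF_of_corner`) — the shape of the sibling workfile's `free_gain_thermal_lower_bound`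
(`Cruxes/TwSourcedInertness` §J, there at `μ = -2` with explicit constants). -/

/-! ### `tanh` is concave on `[0, ∞)`, so `tanh w / w` is non-increasing -/

/-- `tanh' = 1/cosh²`. [folklore] -/
theorem hasDerivAt_real_tanh (x : ℝ) : HasDerivAt Real.tanh (1 / Real.cosh x ^ 2) x := by
  have hc : Real.cosh x ≠ 0 := (Real.cosh_pos x).ne'
  have h := (Real.hasDerivAt_sinh x).div (Real.hasDerivAt_cosh x) hc
  have heq : (Real.sinh / Real.cosh : ℝ → ℝ) = Real.tanh := by
    funext y; simp [Real.tanh_eq_sinh_div_cosh]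
  rw [heq] at h
  have h1 : Real.cosh x * Real.cosh x - Real.sinh x * Real.sinh x = 1 := by
    have := Real.cosh_sq_sub_sinh_sq x
    nlinarith
  refine h.congr_deriv ?_
  rw [h1]

theorem continuous_real_tanh' : Continuous Real.tanh :=
  continuous_iff_continuousAt.2 fun x => (hasDerivAt_real_tanh x).continuousAt

/-- `tanh` is concave on `[0,∞)` (its derivative `1/cosh²` is non-increasing there). [folklore] -/
theorem concaveOn_tanh_Ici : ConcaveOn ℝ (Set.Ici (0 : ℝ)) Real.tanh := by
  refine AntitoneOn.concaveOn_of_deriv (convex_Ici 0) continuous_real_tanh'.continuousOn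
    (fun x _ => (hasDerivAt_real_tanh x).differentiableAt.differentiableWithinAt) ?_
  rw [interior_Ici]
  intro x hx y hy hxy
  rw [(hasDerivAt_real_tanh x).deriv, (hasDerivAt_real_tanh y).deriv]
  have hx0 : 0 < x := hx
  have hy0 : 0 < y := hy
  apply one_div_le_one_div_of_le (pow_pos (Real.cosh_pos x) 2)
  exact pow_le_pow_left₀ (Real.cosh_pos x).le
    (Real.cosh_le_cosh.2 (by rw [abs_of_pos hx0, abs_of_pos hy0]; exact hxy)) 2

/-- `tanh w / w` is non-increasing on `(0,∞)`. [folklore] -/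
theorem tanh_div_le_tanh_div {a b : ℝ} (ha : 0 < a) (hab : a ≤ b) :
    Real.tanh b / b ≤ Real.tanh a / a := by
  rcases hab.eq_or_lt with rfl | hlt
  · exact le_rfl
  have hb : 0 < b := ha.trans hlt
  have hconv : ConvexOn ℝ (Set.Ici (0 : ℝ)) (-Real.tanh) := concaveOn_tanh_Ici.neg
  have key := hconv.secant_mono (a := 0) (x := a) (y := b) Set.self_mem_Ici ha.le hb.le ha.ne' hb.ne' hab
  simp only [Pi.neg_apply, Real.tanh_zero, neg_zero, sub_zero] at key
  rw [neg_div, neg_div] at key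
  linarith

/-! ### The BdG mode function `G(v) = log((1 + cosh √v)/2)` is concave on `[0,∞)` -/

/-- Half-angle: `sinh y/(1 + cosh y) = tanh(y/2)`. [folklore] -/
theorem sinh_div_one_add_cosh (y : ℝ) : Real.sinh y / (1 + Real.cosh y) = Real.tanh (y / 2) := by
  have h1 : Real.sinh y = 2 * Real.sinh (y / 2) * Real.cosh (y / 2) := by
    rw [← Real.sinh_two_mul]; ring_nf
  have h2 : 1 + Real.cosh y = 2 * Real.cosh (y / 2) ^ 2 := one_add_cosh y
  have hc : Real.cosh (y / 2) ≠ 0 := (Real.cosh_pos _).ne'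
  rw [h1, h2, Real.tanh_eq_sinh_div_cosh]
  field_simp

/-- Derivative of `G(v) = log((1+cosh √v)/2)` at `v > 0`: `G'(v) = tanh(√v/2)/(2√v)`. [folklore] -/
theorem hasDerivAt_bdgG {v : ℝ} (hv : 0 < v) :
    HasDerivAt (fun v => Real.log ((1 + Real.cosh (Real.sqrt v)) / 2))
      (Real.tanh (Real.sqrt v / 2) / (2 * Real.sqrt v)) v := by
  have hs : HasDerivAt Real.sqrt (1 / (2 * Real.sqrt v)) v := Real.hasDerivAt_sqrt hv.ne'
  have hcosh : HasDerivAt (fun v => Real.cosh (Real.sqrt v))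
      (Real.sinh (Real.sqrt v) * (1 / (2 * Real.sqrt v))) v := (Real.hasDerivAt_cosh _).comp v hs
  have hin : HasDerivAt (fun v => (1 + Real.cosh (Real.sqrt v)) / 2)
      (Real.sinh (Real.sqrt v) * (1 / (2 * Real.sqrt v)) / 2) v := (hcosh.const_add 1).div_const 2
  have hpos : 0 < (1 + Real.cosh (Real.sqrt v)) / 2 := by
    have := Real.one_le_cosh (Real.sqrt v); positivity
  have hlog := hin.log hpos.ne'
  convert hlog using 1
  have hsv : 0 < Real.sqrt v := Real.sqrt_pos.2 hv
  have h1c : 0 < 1 + Real.cosh (Real.sqrt v) := by linarith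
  rw [← sinh_div_one_add_cosh]
  field_simp

/-- Continuity of `G`. [folklore] -/
theorem continuous_bdgG : Continuous (fun v : ℝ => Real.log ((1 + Real.cosh (Real.sqrt v)) / 2)) := by
  refine Continuous.log (by fun_prop) fun v => ?_
  have := Real.one_le_cosh (Real.sqrt v)
  positivity

/-- `G'` is non-increasing on `(0,∞)`. [folklore] -/
theorem bdgG_deriv_antitone {v v' : ℝ} (hv : 0 < v) (hvv' : v ≤ v') :
    Real.tanh (Real.sqrt v' / 2) / (2 * Real.sqrt v') ≤ Real.tanh (Real.sqrt v / 2) / (2 * Real.sqrt v) := by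
  have hsv : 0 < Real.sqrt v := Real.sqrt_pos.2 hv
  have hsv' : 0 < Real.sqrt v' := Real.sqrt_pos.2 (hv.trans_le hvv')
  have hle : Real.sqrt v / 2 ≤ Real.sqrt v' / 2 := by
    have := Real.sqrt_le_sqrt hvv'; linarith
  have key := tanh_div_le_tanh_div (by positivity) hle
  have e : ∀ w : ℝ, 0 < w → Real.tanh (w / 2) / (2 * w) = (Real.tanh (w / 2) / (w / 2)) / 4 := by
    intro w hw; field_simp; ring
  rw [e _ hsv, e _ hsv']
  linarith

/-- **`G(v) = log((1 + cosh √v)/2)` is concave on `[0,∞)`.** [folklore] -/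
theorem concaveOn_bdgG : ConcaveOn ℝ (Set.Ici (0 : ℝ)) (fun v => Real.log ((1 + Real.cosh (Real.sqrt v)) / 2)) := by
  refine AntitoneOn.concaveOn_of_deriv (convex_Ici 0) continuous_bdgG.continuousOn ?_ ?_
  · rw [interior_Ici]
    intro v hv
    exact (hasDerivAt_bdgG (show 0 < v from hv)).differentiableAt.differentiableWithinAt
  · rw [interior_Ici]
    intro v hv v' hv' hvv'
    rw [(hasDerivAt_bdgG (show 0 < v from hv)).deriv, (hasDerivAt_bdgG (show 0 < v' from hv')).deriv]
    exact bdgG_deriv_antitone hv hvv'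

/-- Secant form of the concavity from a base point `v₀ ≥ 0` along a ray `v₀ + c·u`, `c ≥ 0`:
for `0 < u ≤ u'`, `(G(v₀ + cu') - G(v₀))/u' ≤ (G(v₀ + cu) - G(v₀))/u`. [folklore] -/
theorem bdgG_secant_antitone {v₀ c u u' : ℝ} (hv₀ : 0 ≤ v₀) (hc : 0 ≤ c) (hu : 0 < u) (huu' : u ≤ u') :
    (Real.log ((1 + Real.cosh (Real.sqrt (v₀ + c * u'))) / 2) - Real.log ((1 + Real.cosh (Real.sqrt v₀)) / 2)) / u' ≤
      (Real.log ((1 + Real.cosh (Real.sqrt (v₀ + c * u))) / 2) - Real.log ((1 + Real.cosh (Real.sqrt v₀)) / 2)) / u := by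
  set G : ℝ → ℝ := fun v => Real.log ((1 + Real.cosh (Real.sqrt v)) / 2) with hG
  have hu' : 0 < u' := hu.trans_le huu'
  rcases hc.eq_or_lt with hc0 | hcpos
  · rw [← hc0]; simp
  have hconv : ConvexOn ℝ (Set.Ici (0 : ℝ)) (-G) := concaveOn_bdgG.neg
  have hx : v₀ + c * u ∈ Set.Ici (0 : ℝ) := by change 0 ≤ v₀ + c * u; positivity
  have hy : v₀ + c * u' ∈ Set.Ici (0 : ℝ) := by change 0 ≤ v₀ + c * u'; positivity
  have hxa : v₀ + c * u ≠ v₀ := by intro h; nlinarith [mul_pos hcpos hu]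
  have hya : v₀ + c * u' ≠ v₀ := by intro h; nlinarith [mul_pos hcpos hu']
  have hxy : v₀ + c * u ≤ v₀ + c * u' := by nlinarith
  have key := hconv.secant_mono (a := v₀) hv₀ hx hy hxa hya hxy
  simp only [Pi.neg_apply] at key
  rw [show v₀ + c * u - v₀ = c * u by ring, show v₀ + c * u' - v₀ = c * u' by ring] at key
  -- `key : (-G x + G v₀)/(c u) ≤ (-G y + G v₀)/(c u')`
  change (G (v₀ + c * u') - G v₀) / u' ≤ (G (v₀ + c * u) - G v₀) / u
  have e1 : (-G (v₀ + c * u) - -G v₀) / (c * u) = -((G (v₀ + c * u) - G v₀) / u) / c := by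
    field_simp; ring
  have e2 : (-G (v₀ + c * u') - -G v₀) / (c * u') = -((G (v₀ + c * u') - G v₀) / u') / c := by
    field_simp; ring
  rw [e1, e2, div_le_div_iff_of_pos_right hcpos, neg_le_neg_iff] at key
  exact key

/-! ### The free BdG gain per `s²` is non-increasing in `|s|` -/

/-- `β√X = √(β²X)` bookkeeping for the mode function. [folklore] -/
theorem log_cosh_mode_eq {β : ℝ} (hβ : 0 ≤ β) (X : ℝ) :
    Real.log ((1 + Real.cosh (β * Real.sqrt X)) / 2) =
      Real.log ((1 + Real.cosh (Real.sqrt (β ^ 2 * X))) / 2) := by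
  rw [Real.sqrt_mul (sq_nonneg β), Real.sqrt_sq hβ]

/-- **Per-mode: the BdG gain per `s²` is non-increasing in `|s|`**: for `0 < s ≤ s'`,
`m(s')/s'² ≤ m(s)/s²`, `m(s) = log((1+cosh βE(s))/2) - log((1+cosh βξ)/2)`, `E(s)² = ξ² + (2√2 s ĝ)²`. [folklore] -/
theorem bdgModeGain_div_sq_antitone {β : ℝ} (hβ : 0 < β) (ξ g : ℝ) {s s' : ℝ} (hs : 0 < s) (hss' : s ≤ s') :
    (Real.log ((1 + Real.cosh (β * Real.sqrt (ξ ^ 2 + (2 * Real.sqrt 2 * s' * g) ^ 2))) / 2) -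
        Real.log ((1 + Real.cosh (β * ξ)) / 2)) / s' ^ 2 ≤
      (Real.log ((1 + Real.cosh (β * Real.sqrt (ξ ^ 2 + (2 * Real.sqrt 2 * s * g) ^ 2))) / 2) -
        Real.log ((1 + Real.cosh (β * ξ)) / 2)) / s ^ 2 := by
  have h2 : Real.sqrt 2 ^ 2 = 2 := Real.sq_sqrt zero_le_two
  have hX : ∀ t : ℝ, ξ ^ 2 + (2 * Real.sqrt 2 * t * g) ^ 2 = ξ ^ 2 + 8 * g ^ 2 * t ^ 2 := by
    intro t; rw [mul_pow, mul_pow, mul_pow, h2]; ring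
  have hξ : Real.log ((1 + Real.cosh (β * ξ)) / 2) = Real.log ((1 + Real.cosh (Real.sqrt (β ^ 2 * ξ ^ 2))) / 2) := by
    rw [show β ^ 2 * ξ ^ 2 = (β * ξ) ^ 2 by ring, Real.sqrt_sq_eq_abs]
    rcases abs_choice (β * ξ) with h | h
    · rw [h]
    · rw [h, Real.cosh_neg]
  rw [hX s, hX s', log_cosh_mode_eq hβ.le, log_cosh_mode_eq hβ.le, hξ,
    show β ^ 2 * (ξ ^ 2 + 8 * g ^ 2 * s' ^ 2) = β ^ 2 * ξ ^ 2 + (8 * β ^ 2 * g ^ 2) * s' ^ 2 by ring,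
    show β ^ 2 * (ξ ^ 2 + 8 * g ^ 2 * s ^ 2) = β ^ 2 * ξ ^ 2 + (8 * β ^ 2 * g ^ 2) * s ^ 2 by ring]
  exact bdgG_secant_antitone (by positivity) (by positivity) (by positivity)
    (pow_le_pow_left₀ hs.le hss' 2)

variable {L : ℕ} [NeZero L]

/-- **The free sourced gain per `s²` is non-increasing in `|s|`** (`L ≥ 3`, `β > 0`, numerator form):
for `0 < s ≤ s'`, `[log Z(s') - log Z(0)]/s'² ≤ [log Z(s) - log Z(0)]/s²`. [folklore] -/
theorem free_logGain_div_sq_antitone (hL : 3 ≤ L) {β : ℝ} (hβ : 0 < β) (μ : ℝ) {s s' : ℝ}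
    (hs : 0 < s) (hss' : s ≤ s') :
    (Real.log (partitionFn β (dWaveSourceTorus L 0 μ s')).re -
        Real.log (partitionFn β (dWaveSourceTorus L 0 μ 0)).re) / s' ^ 2 ≤
      (Real.log (partitionFn β (dWaveSourceTorus L 0 μ s)).re -
        Real.log (partitionFn β (dWaveSourceTorus L 0 μ 0)).re) / s ^ 2 := by
  rw [log_partitionFn_dWaveSourceTorus_zero_sub hL β μ s', log_partitionFn_dWaveSourceTorus_zero_sub hL β μ s,
    Finset.sum_div, Finset.sum_div]
  exact Finset.sum_le_sum fun k _ => bdgModeGain_div_sq_antitone hβ (torusBand L k - μ) (dWaveGap k) hs hss'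

/-- The free gain is EVEN in the source (it depends on `s²` only). [folklore] -/
theorem free_logGain_even (hL : 3 ≤ L) (β μ s : ℝ) :
    Real.log (partitionFn β (dWaveSourceTorus L 0 μ (-s))).re -
        Real.log (partitionFn β (dWaveSourceTorus L 0 μ 0)).re =
      Real.log (partitionFn β (dWaveSourceTorus L 0 μ s)).re -
        Real.log (partitionFn β (dWaveSourceTorus L 0 μ 0)).re := by
  rw [log_partitionFn_dWaveSourceTorus_zero_sub hL β μ (-s), log_partitionFn_dWaveSourceTorus_zero_sub hL β μ s]
  refine Finset.sum_congr rfl fun k _ => ?_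
  rw [show (2 * Real.sqrt 2 * -s * dWaveGap k) ^ 2 = (2 * Real.sqrt 2 * s * dWaveGap k) ^ 2 by ring]

/-- **Stub (F) on the whole window follows from its CORNER `|h| = 1/β`.** If for every compact
`[μ₁,μ₂] ⊂ (-4,0)` there are `c₀, C₀ > 0` with `(c₀ log β - C₀)/β² ≤ p̃₀(β,1/β) - p̃₀(β,0)` eventually in `L`
(`β ≥ 1`, `μ ∈ [μ₁,μ₂]`), then the registered stub (F) holds (same constants, `L₀ := max(L₀,3)`):
`c₀h² log β - C₀h² ≤ p̃₀(β,h) - p̃₀(β,0)` for all `|h| ≤ 1/β`. [folklore] -/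
theorem stubF_of_corner
    (Hc : ∀ μ₁ μ₂ : ℝ, -4 < μ₁ → μ₁ ≤ μ₂ → μ₂ < 0 → ∃ c₀ C₀ : ℝ, 0 < c₀ ∧ 0 < C₀ ∧ ∀ β : ℝ, 1 ≤ β →
      ∀ μ ∈ Set.Icc μ₁ μ₂, ∃ L₀ : ℕ, ∀ (L : ℕ) [NeZero L], L₀ ≤ L →
        (c₀ * Real.log β - C₀) / β ^ 2 ≤
          Real.log (partitionFn β (dWaveSourceTorus L 0 μ (1 / β))).re / (β * (L : ℝ) ^ 2) -
            Real.log (partitionFn β (dWaveSourceTorus L 0 μ 0)).re / (β * (L : ℝ) ^ 2)) :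
    ∀ μ₁ μ₂ : ℝ, -4 < μ₁ → μ₁ ≤ μ₂ → μ₂ < 0 → ∃ c₀ C₀ : ℝ, 0 < c₀ ∧ 0 < C₀ ∧ ∀ β : ℝ, 1 ≤ β →
      ∀ μ ∈ Set.Icc μ₁ μ₂, ∃ L₀ : ℕ, ∀ (L : ℕ) [NeZero L], L₀ ≤ L → ∀ h : ℝ, |h| ≤ 1 / β →
        c₀ * h ^ 2 * Real.log β - C₀ * h ^ 2 ≤
          Real.log (partitionFn β (dWaveSourceTorus L 0 μ h)).re / (β * (L : ℝ) ^ 2) -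
            Real.log (partitionFn β (dWaveSourceTorus L 0 μ 0)).re / (β * (L : ℝ) ^ 2) := by
  intro μ₁ μ₂ h1 h2 h3
  obtain ⟨c₀, C₀, hc₀, hC₀, H⟩ := Hc μ₁ μ₂ h1 h2 h3
  refine ⟨c₀, C₀, hc₀, hC₀, fun β hβ μ hμ => ?_⟩
  obtain ⟨L₀, hL₀⟩ := H β hβ μ hμ
  refine ⟨max L₀ 3, fun L _ hL h hh => ?_⟩
  have hL3 : 3 ≤ L := le_of_max_le_right hL
  have hβpos : 0 < β := by linarith
  have hLpos : (0 : ℝ) < (L : ℝ) ^ 2 := by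
    have : (0 : ℝ) < L := by exact_mod_cast (show 0 < L by omega)
    positivity
  have hden : 0 < β * (L : ℝ) ^ 2 := mul_pos hβpos hLpos
  have corner := hL₀ L (le_of_max_le_left hL)
  -- reduce to `s = |h| > 0`
  rcases eq_or_ne h 0 with rfl | hh0
  · simp
  have hs : 0 < |h| := abs_pos.2 hh0
  -- the gain at `h` equals the gain at `|h|`
  have heven : Real.log (partitionFn β (dWaveSourceTorus L 0 μ h)).re -
      Real.log (partitionFn β (dWaveSourceTorus L 0 μ 0)).re =
      Real.log (partitionFn β (dWaveSourceTorus L 0 μ |h|)).re -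
        Real.log (partitionFn β (dWaveSourceTorus L 0 μ 0)).re := by
    rcases abs_choice h with habs | habs
    · rw [habs]
    · rw [habs, free_logGain_even hL3]
  have mono := free_logGain_div_sq_antitone hL3 hβpos μ hs hh
  -- corner in numerator form: `(c₀ log β - C₀)/β² · βL² ≤ log Z(1/β) - log Z(0)`
  rw [← sub_div, le_div_iff₀ hden] at corner ⊢
  rw [heven]
  set Gs := Real.log (partitionFn β (dWaveSourceTorus L 0 μ |h|)).re -
    Real.log (partitionFn β (dWaveSourceTorus L 0 μ 0)).re with hGs
  set Gc := Real.log (partitionFn β (dWaveSourceTorus L 0 μ (1 / β))).re -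
    Real.log (partitionFn β (dWaveSourceTorus L 0 μ 0)).re with hGc
  -- `Gc/(1/β)² ≤ Gs/|h|²`, i.e. `Gc β² ≤ Gs/h²`
  have hs2 : 0 < |h| ^ 2 := by positivity
  have hh2 : |h| ^ 2 = h ^ 2 := sq_abs h
  have m2 : Gc * β ^ 2 * h ^ 2 ≤ Gs := by
    have := mono
    rw [div_le_div_iff₀ (by positivity) hs2] at this
    -- `Gc * |h|^2 ≤ Gs * (1/β)^2`
    have e : Gs * (1 / β) ^ 2 * β ^ 2 = Gs := by field_simp
    have e3 : Gc * |h| ^ 2 * β ^ 2 = Gc * β ^ 2 * h ^ 2 := by rw [hh2]; ring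
    have h4 := mul_le_mul_of_nonneg_right this (sq_nonneg β)
    rw [e3, e] at h4
    exact h4
  have c2 : (c₀ * Real.log β - C₀) * (L : ℝ) ^ 2 ≤ Gc * β := by
    have e : (c₀ * Real.log β - C₀) / β ^ 2 * (β * (L : ℝ) ^ 2) = (c₀ * Real.log β - C₀) * (L : ℝ) ^ 2 / β := by
      field_simp
    rw [e, div_le_iff₀ hβpos] at corner
    exact corner
  -- combine: `(c₀ log β - C₀) h² βL² ≤ Gc β · β h² · ... `
  have h2nn : 0 ≤ h ^ 2 := sq_nonneg h
  calc (c₀ * h ^ 2 * Real.log β - C₀ * h ^ 2) * (β * (L : ℝ) ^ 2)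
      = ((c₀ * Real.log β - C₀) * (L : ℝ) ^ 2) * (β * h ^ 2) := by ring
    _ ≤ (Gc * β) * (β * h ^ 2) := mul_le_mul_of_nonneg_right c2 (by positivity)
    _ = Gc * β ^ 2 * h ^ 2 := by ring
    _ ≤ Gs := m2


/-! ### (S) `stub_sourceSlack` and (T) `stub_thermalSlack`: survive (analysis record) -/

/-- **TARGETS (S), (T) — why no cheap kill** (record for the lead; the `True` carries no content).

(S) `∀ η ∃ U₀ a K: I_U(h) ≥ I_0(h) - (η log β + K)h²` on `|h| ≤ 1/β` (`I_U = p̃_U(h) - p̃_U(0)`).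
 1. Structure: equality at `h = 0`; both sides even (`§1`); `0 ≤ I_U ≤ I_0 + 2U` (tree
    `sourcedGain_le_free_add`) — the only hypothesis-free comparison is `h`-INDEPENDENT, hence void for
    `h² log β ≲ U`, which is the whole window at `β ~ e^{a/U}`.
 2. First order in `U` is EXACTLY computable (Hellmann–Feynman `∂_U p̃ = -d`, proved in the
    hellmann-feynman line; Wick at `U = 0`): the on-site anomalous amplitude of the `d`-wave-sourced free
    gas vanishes (`Σ_k ĝ_d(k) u_k v_k = 0`, `k₁ ↔ k₂`), so the free doublon density is `d₀ = n₀²/4` at EVERY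
    source, and `I_U - I_0 = -(U/4)[n₀(h)² - n₀(0)²] + O(U²) = -(U n̄/2)·∂_μ I_0(h) + O(U²)`,
    `∂_μ I_0(h) ≈ 2ρ_d'(μ) h² log β`. Size `≍ U h² log β ≤ a·h²`: a CONSTANT times `h²` in the window —
    so `K ≳ a n̄ |ρ_d'|` is necessary and `η` could even be `0` at this order; sign: the repulsion LOWERS
    the response wherever `ρ_d' > 0` (most of `(-4,0)`), so the slack is genuinely negative, `-K h²` is
    load-bearing, and a version of (S) with `K = 0` is false at first order (not Lean-checkable here: it
    needs `∂_μ` of the free Cooper logarithm with its sign).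
 3. Higher orders: `U^n log^m β` with `m ≤ n` is `≤ a^m U^{n-m}`: every order is `O(1)·h²`; the KL vertex
    (`U² log² β ≤ a²`) and self-energy (`U² log β ≤ aU`) included. No perturbative sign obstruction; the
    content of (S) is CONVERGENCE of the sourced expansion at the summit's fillings (BGM 2006 Thm 1.1 is
    low density), i.e. the crux's own content in difference form — (S) is not cheaper than the crux
    restricted to `|h| ≤ 1/β`, only better isolated.
 4. Finite size: none. On a gapped torus both `I_U, I_0 ≤ 32h²/γ (+2U)` (§8) and (S) there would need a
    LOWER bound on `I_0 - I_U` of a specific interacting cluster; on a resonant torus (`μ = -1`, `L = 3j`)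
    `I_0(1/β) ≳ 1/(βL²) ≫ K/β²`, so the `L₀`-uniform version of (S) is false iff `U ≫ T` suppresses the
    shell's Curie response below the free one — plausible (degeneracy lifting) but an ED statement about the
    interacting `3 × 3` cluster, not a Lean kill. `∃ L₀` after `(U,β,μ)` absorbs all of it.
(T) `∀ η ∃ U₀ a K': [p̃_U(β/2,h) - p̃_U(β,h)] - [p̃_0(β/2,h) - p̃_0(β,h)] ≤ (η log β + K')/β²`.
 1. The chord is `∫_T^{2T} s_L dT'` (entropy density), so (T) says `γ_U - γ_0 ≲ η log β + K'` for the
    specific-heat coefficients: Fermi-liquid size `O(U)` (Hartree shift of `N(μ)`) `+ O(U²)`; in `d = 2` the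
    leading non-analytic correction is `∝ U²T²` (no `T² log T`), so even `η = 0` is expected; the allowance
    `η log β` is generous (needed only at the excluded van Hove point `μ = 0`).
 2. First order exactly: `-U[d₀(β/2,h) - d₀(β,h)] = -(U/4)[n₀(2T)² - n₀(T)²] = O(U T²)` (Sommerfeld for
    the free density; `d₀ = n₀²/4` at every `h` by item (S).2).
 3. By `free_heatChord_le_zero_source` the FREE chord is maximal at `h = 0`; the interacting chord has no
    such monotonicity for free, but (T) only asks for a difference bound.
 4. Finite size acts in the HARMLESS direction (lifting degeneracies lowers entropy: `chord_U < chord_0` on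
    resonant tori once `U ≫ T`); the one adverse scenario is an interaction-INDUCED crossing (ground states
    of `N` and `N+2` degenerate at some `U_c(μ,L)`: chord `≈ log 2/(βL²) ≫ K'/β²`), which shows `∃ L₀`
    after `(U,β,μ)` is load-bearing in (T) too, but is absorbed by it — no kill.
CROSS-CHECK (independent seat): the drefute report `Cruxes/TwSourcedCondensation/Drefute-entropy-staircase-linear-regime.md`
(refuter-drefute-…-1697-0, 2026-08-16) reaches the same verdict (0 stub-false, 4 survived) with thermodynamic-limit
numbers: best free constant `sup c₀ = 8ρ_d(μ)` (`0.021` at `μ = -3.5` … `3.5` at `μ = -0.25`), first-order Hartree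
deficit `κ₁ = -4n₀ρ_d' < 0` on all of `(-4,0)` (`-0.004 … -2.8`), free heat chord `β²·chord_0 → π²ρ(μ)` (`0.84 … 2.1`);
its kit job j009805 (1536² k-grid) auto-attaches to the item. The kernel-checked statements of this section
(`stubF_of_corner`, `free_heatChord_le_zero_source`, the two `_false_uniformL0`) are the formal counterparts.
VERDICT ON TARGETS (gen 3): (F), (Fh) provable now from the tree's BdG formula ((Fh): prove it at
`h = 0` only; (F): prove it at `|h| = 1/β` only, then concavity); (S) = the crux's irreducible content;
(T) = interacting specific heat at `T ≥ e^{-a/U}`, weaker than (S). [folklore] -/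
theorem targets_ST_analysis : True := trivial

end Targets

/-! ## §10 (gen 3) The constants cannot be uniform up to the band edge: `c = c(μ₁) ≲ μ₁ + 4`
The `d`-wave form factor vanishes at the band bottom (`|ĝ_d(k)| ≤ (4 + ε_L(k))/2`), so near `μ = -4 + δ` the
free Cooper coefficient is `O(δ)` (with the tree's torus Cooper logarithm, constant made explicit in
`d₀`): the crux with its constants chosen BEFORE the interval (`∃ U₀ a c C h₀ ∀ [μ₁,μ₂]`) is FALSE. -/

section BandEdge

/-! ### The torus Cooper logarithm with its constant made explicit in `d₀` -/

section FermiWeight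

open Real

variable {L : ℕ} [NeZero L]

/-- **The Fermi-surface weight sum with explicit constant** (the tree's `exists_sum_fermiWeight_le`,
constant exposed): for `d₀ ≤ μ + 4`, `d₀ ≤ -μ`, `β ≥ 1`, all `L ≥ 1`,
`Σ_k β/(2 + β|ε_L(k) - μ|) ≤ (4/d₀ + (2/log 2 + 2)·4/(π√(d₀/8)))·(1 + log β) L² + 8βL`. [folklore] -/
theorem sum_fermiWeight_le_explicit {d₀ : ℝ} (hd₀ : 0 < d₀) (μ : ℝ) (hμ4 : d₀ ≤ μ + 4) (hμ0 : d₀ ≤ -μ)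
    {β : ℝ} (hβ : 1 ≤ β) (L : ℕ) [NeZero L] :
    ∑ k : TorusSite 2 L, β / (2 + β * |torusBand L k - μ|) ≤
      (4 / d₀ + (2 / Real.log 2 + 2) * (4 / (π * Real.sqrt (d₀ / 8)))) * (1 + Real.log β) * (L : ℝ) ^ 2 +
        8 * β * L := by
  set s₀ := Real.sqrt (d₀ / 8) with hs₀def
  have hs₀ : 0 < s₀ := Real.sqrt_pos.2 (by positivity)
  set κ : ℝ := 2 / Real.log 2 + 2 with hκ
  have hlog2 : 0 < Real.log 2 := Real.log_pos one_lt_two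
  have hκpos : 0 < κ := by positivity
  have hL : (0 : ℝ) < L := by exact_mod_cast Nat.pos_of_ne_zero (NeZero.ne L)
  have hlogβ : 0 ≤ Real.log β := Real.log_nonneg hβ
  set B := β / 2 with hBdef
  have hB : 0 < B := by positivity
  set η₀ := d₀ / 4 with hη₀def
  have hη₀ : 0 < η₀ := by positivity
  have hd₀2 : d₀ ≤ 2 := by linarith
  have hw : ∀ k : TorusSite 2 L, β / (2 + β * |torusBand L k - μ|) = B / (1 + B * |torusBand L k - μ|) := by
    intro k
    rw [hBdef]
    have : 0 < 2 + β * |torusBand L k - μ| := by positivity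
    field_simp
  simp only [hw]
  have hcardL : (Finset.univ : Finset (TorusSite 2 L)).card = L ^ 2 := by
    rw [Finset.card_univ, Fintype.card_pi, Fin.prod_univ_two, ZMod.card, sq]
  by_cases hsmall : B * η₀ ≤ 1
  · have hbound : ∀ k : TorusSite 2 L, B / (1 + B * |torusBand L k - μ|) ≤ 4 / d₀ := fun k => by
      refine (div_le_self hB.le (by nlinarith [abs_nonneg (torusBand L k - μ)])).trans ?_
      rw [le_div_iff₀ hd₀]
      rw [hη₀def] at hsmall
      linarith
    calc ∑ k : TorusSite 2 L, B / (1 + B * |torusBand L k - μ|) ≤ ∑ _k : TorusSite 2 L, 4 / d₀ :=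
          Finset.sum_le_sum fun k _ => hbound k
      _ = 4 / d₀ * (L : ℝ) ^ 2 := by rw [Finset.sum_const, hcardL, nsmul_eq_mul]; push_cast; ring
      _ ≤ (4 / d₀ + κ * (4 / (π * s₀))) * (1 + Real.log β) * (L : ℝ) ^ 2 + 8 * β * L := by
          have h1 : (0 : ℝ) ≤ κ * (4 / (π * s₀)) := by positivity
          have h2 : (0 : ℝ) ≤ (L : ℝ) ^ 2 := by positivity
          nlinarith [mul_nonneg h1 h2, mul_nonneg (mul_nonneg (show (0:ℝ) ≤ 4 / d₀ + κ * (4 / (π * s₀)) by positivity) hlogβ) h2]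
  · rw [not_le] at hsmall
    obtain ⟨n, hn1, hn2⟩ := exists_nat_pow_near hsmall.le one_lt_two
    set J := n + 1 with hJdef
    have hJ1 : η₀ ≤ 2 ^ J / B := by
      rw [le_div_iff₀ hB, hJdef]; linarith
    have hJ2 : (2 : ℝ) ^ J / B ≤ d₀ / 2 := by
      rw [div_le_iff₀ hB, hJdef, pow_succ]; nlinarith
    have hJ3 : ((J : ℕ) : ℝ) + 1 ≤ κ * (1 + Real.log β) := by
      have hBη : B * η₀ ≤ β := by rw [hBdef, hη₀def]; nlinarith
      have hn : (n : ℝ) * Real.log 2 ≤ Real.log β := by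
        rw [← Real.log_pow]
        exact Real.log_le_log (by positivity) (hn1.trans hBη)
      have hc : 0 < (Real.log 2)⁻¹ := inv_pos.2 hlog2
      have hn' : (n : ℝ) ≤ Real.log β * (Real.log 2)⁻¹ := by
        rw [← div_eq_mul_inv, le_div_iff₀ hlog2]; exact hn
      rw [hJdef, hκ, div_eq_mul_inv]
      push_cast
      nlinarith [mul_nonneg hc.le hlogβ]
    have hpt : ∀ k : TorusSite 2 L, B / (1 + B * |torusBand L k - μ|) ≤
        1 / η₀ + ∑ j ∈ Finset.range (J + 1), (if |torusBand L k - μ| < 2 ^ j / B then 2 * B / 2 ^ j else 0) :=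
      fun k => fermiWeight_le_dyadic hB (abs_nonneg _) hη₀ hJ1
    have hcount : ∀ j ∈ Finset.range (J + 1),
        ∑ k : TorusSite 2 L, (if |torusBand L k - μ| < 2 ^ j / B then 2 * B / 2 ^ j else (0 : ℝ)) ≤
          4 * (L : ℝ) ^ 2 / (π * s₀) + 8 * B * L / 2 ^ j := by
      intro j hj
      have hjJ : j ≤ J := Nat.lt_succ_iff.1 (Finset.mem_range.1 hj)
      have hηj : 0 < (2 : ℝ) ^ j / B := by positivity
      have hηj' : (2 : ℝ) ^ j / B ≤ d₀ / 2 :=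
        le_trans (div_le_div_of_nonneg_right (pow_le_pow_right₀ one_le_two hjJ) hB.le) hJ2
      have hN := card_torusShell_le (L := L) hμ4 hμ0 hηj hηj'
      rw [← hs₀def] at hN
      rw [← Finset.sum_filter, Finset.sum_const, nsmul_eq_mul]
      calc (((Finset.univ.filter fun k : TorusSite 2 L => |torusBand L k - μ| < 2 ^ j / B).card : ℕ) : ℝ) * (2 * B / 2 ^ j)
          ≤ 4 * (L * (2 ^ j / B * L / (2 * π * s₀) + 1)) * (2 * B / 2 ^ j) :=
            mul_le_mul_of_nonneg_right hN (by positivity)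
        _ = 4 * (L : ℝ) ^ 2 / (π * s₀) + 8 * B * L / 2 ^ j := by
            field_simp
            ring
    have hgeom : ∑ j ∈ Finset.range (J + 1), (8 * B * (L : ℝ) / 2 ^ j) ≤ 16 * B * L := by
      have hg := geom_sum_Ico_le_of_lt_one (show (0 : ℝ) ≤ 1 / 2 by norm_num) (show (1 : ℝ) / 2 < 1 by norm_num)
        (m := 0) (n := J + 1)
      simp only [pow_zero, Finset.range_eq_Ico] at hg ⊢
      calc ∑ j ∈ Finset.Ico 0 (J + 1), 8 * B * (L : ℝ) / 2 ^ j
          = 8 * B * L * ∑ j ∈ Finset.Ico 0 (J + 1), ((1 : ℝ) / 2) ^ j := by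
            rw [Finset.mul_sum]
            refine Finset.sum_congr rfl fun j _ => ?_
            rw [one_div, inv_pow]; ring
        _ ≤ 8 * B * L * (1 / (1 - 1 / 2)) := by gcongr
        _ = 16 * B * L := by norm_num; ring
    calc ∑ k : TorusSite 2 L, B / (1 + B * |torusBand L k - μ|)
        ≤ ∑ k : TorusSite 2 L, (1 / η₀ + ∑ j ∈ Finset.range (J + 1),
            (if |torusBand L k - μ| < 2 ^ j / B then 2 * B / 2 ^ j else 0)) := Finset.sum_le_sum fun k _ => hpt k
      _ = (L : ℝ) ^ 2 / η₀ + ∑ j ∈ Finset.range (J + 1), ∑ k : TorusSite 2 L,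
            (if |torusBand L k - μ| < 2 ^ j / B then 2 * B / 2 ^ j else (0 : ℝ)) := by
          rw [Finset.sum_add_distrib, Finset.sum_const, hcardL, nsmul_eq_mul, Finset.sum_comm]
          push_cast; ring
      _ ≤ (L : ℝ) ^ 2 / η₀ + ∑ j ∈ Finset.range (J + 1), (4 * (L : ℝ) ^ 2 / (π * s₀) + 8 * B * L / 2 ^ j) := by
          gcongr with j hj
          exact hcount j hj
      _ = (L : ℝ) ^ 2 / η₀ + ((J : ℕ) + 1 : ℝ) * (4 * (L : ℝ) ^ 2 / (π * s₀)) +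
            ∑ j ∈ Finset.range (J + 1), (8 * B * (L : ℝ) / 2 ^ j) := by
          rw [Finset.sum_add_distrib, Finset.sum_const, Finset.card_range, nsmul_eq_mul]
          push_cast; ring
      _ ≤ (L : ℝ) ^ 2 / η₀ + κ * (1 + Real.log β) * (4 * (L : ℝ) ^ 2 / (π * s₀)) + 16 * B * L := by
          gcongr
      _ ≤ (4 / d₀ + κ * (4 / (π * s₀))) * (1 + Real.log β) * (L : ℝ) ^ 2 + 8 * β * L := by
          rw [hη₀def, hBdef]
          have h2 : (0 : ℝ) ≤ (L : ℝ) ^ 2 := by positivity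
          have h3 : (L : ℝ) ^ 2 / (d₀ / 4) = 4 / d₀ * (L : ℝ) ^ 2 := by field_simp
          have h4 : κ * (1 + Real.log β) * (4 * (L : ℝ) ^ 2 / (π * s₀)) =
              κ * (4 / (π * s₀)) * (1 + Real.log β) * (L : ℝ) ^ 2 := by ring
          have h5 : (0 : ℝ) ≤ 4 / d₀ * Real.log β * (L : ℝ) ^ 2 :=
            mul_nonneg (mul_nonneg (by positivity) hlogβ) h2
          rw [h3, h4]
          nlinarith [h5]

/-- The explicit Fermi-weight constant is `≤ 4(1 + κ₀)/d₀` for `d₀ ≤ 1` (`√(d₀/8) ≥ d₀/3`, `π > 3`),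
`κ₀ = 2/log 2 + 2`. [folklore] -/
theorem fermiWeightConst_le {d₀ : ℝ} (hd₀ : 0 < d₀) (hd₀1 : d₀ ≤ 1) :
    4 / d₀ + (2 / Real.log 2 + 2) * (4 / (π * Real.sqrt (d₀ / 8))) ≤ (4 + 4 * (2 / Real.log 2 + 2)) / d₀ := by
  have hlog2 : 0 < Real.log 2 := Real.log_pos one_lt_two
  set κ₀ : ℝ := 2 / Real.log 2 + 2 with hκ₀
  have hκ₀pos : 0 < κ₀ := by positivity
  have hs : d₀ / 3 ≤ Real.sqrt (d₀ / 8) := by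
    rw [show d₀ / 3 = Real.sqrt ((d₀ / 3) ^ 2) by rw [Real.sqrt_sq (by positivity)]]
    exact Real.sqrt_le_sqrt (by nlinarith)
  have hspos : 0 < Real.sqrt (d₀ / 8) := Real.sqrt_pos.2 (by positivity)
  have hπ := Real.pi_gt_three
  -- `4/(π s) ≤ 4/(3 · d₀/3) = 4/d₀`
  have h1 : 4 / (π * Real.sqrt (d₀ / 8)) ≤ 4 / d₀ := by
    apply div_le_div_of_nonneg_left (by norm_num) hd₀
    nlinarith [mul_le_mul hπ.le hs (by positivity) (by positivity)]
  have h2 : κ₀ * (4 / (π * Real.sqrt (d₀ / 8))) ≤ κ₀ * (4 / d₀) := mul_le_mul_of_nonneg_left h1 hκ₀pos.le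
  have e : (4 + 4 * κ₀) / d₀ = 4 / d₀ + κ₀ * (4 / d₀) := by field_simp
  rw [e]
  linarith

end FermiWeight

/-! ### The `d`-wave form factor is small near the band bottom -/

/-- `|ĝ_d(k)| ≤ (4 + ε_L(k))/2` (`|cos k₁ - cos k₂| ≤ (1 - cos k₁) + (1 - cos k₂)`): the `d`-wave form
factor vanishes at the band bottom. [folklore] -/
theorem abs_dWaveGap_le_edge {L : ℕ} (k : TorusSite 2 L) : |dWaveGap k| ≤ (4 + torusBand L k) / 2 := by
  rw [dWaveGap, torusBand, Fin.sum_univ_two]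
  have h1 := Real.cos_le_one (latticeMomentum L k 0)
  have h2 := Real.cos_le_one (latticeMomentum L k 1)
  rw [abs_le]
  constructor <;> nlinarith

/-- Pointwise edge bound for the weighted form factor: with `μ = -4 + δ`, `0 < δ`, `β > 0`,
`ĝ_d(k)² · β/(2+β|ξ_k|) ≤ δ² · β/(2+β|ξ_k|) + 4/δ` (modes within `δ` of `μ` have `ĝ² ≤ δ²`, the others
have weight `≤ 1/δ`). [folklore] -/
theorem dWaveGap_sq_mul_weight_le {L : ℕ} (k : TorusSite 2 L) {δ β : ℝ} (hδ : 0 < δ) (hβ : 0 < β) :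
    (dWaveGap k) ^ 2 * (β / (2 + β * |torusBand L k - (-4 + δ)|)) ≤
      δ ^ 2 * (β / (2 + β * |torusBand L k - (-4 + δ)|)) + 4 / δ := by
  set w := β / (2 + β * |torusBand L k - (-4 + δ)|) with hw
  have hw0 : 0 ≤ w := by positivity
  have hg2 : (dWaveGap k) ^ 2 ≤ 4 := by
    have h1 := abs_dWaveGap_le_two k
    have h0 := abs_nonneg (dWaveGap k)
    rw [← sq_abs]; nlinarith
  by_cases hcase : |torusBand L k - (-4 + δ)| ≤ δ
  · -- near the Fermi level: `ε ≤ -4 + 2δ`, so `ĝ² ≤ δ²`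
    have hε : torusBand L k ≤ -4 + 2 * δ := by
      have := (abs_le.1 hcase).2; linarith
    have hε4 : 0 ≤ 4 + torusBand L k := by linarith [neg_four_le_torusBand L k]
    have hg : (dWaveGap k) ^ 2 ≤ δ ^ 2 := by
      have h1 := abs_dWaveGap_le_edge k
      have h3 : (4 + torusBand L k) / 2 ≤ δ := by linarith
      have h0 := abs_nonneg (dWaveGap k)
      rw [← sq_abs]
      exact pow_le_pow_left₀ h0 (h1.trans h3) 2
    have := mul_le_mul_of_nonneg_right hg hw0
    have h4 : 0 ≤ 4 / δ := by positivity
    linarith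
  · -- away from it: the weight is `≤ 1/δ`
    rw [not_le] at hcase
    have hwle : w ≤ 1 / δ := by
      rw [hw, div_le_div_iff₀ (by positivity) hδ]
      nlinarith [mul_le_mul_of_nonneg_left hcase.le hβ.le]
    have : (dWaveGap k) ^ 2 * w ≤ 4 * (1 / δ) := mul_le_mul hg2 hwle hw0 (by norm_num)
    have e : 4 * (1 / δ) = 4 / δ := by ring
    rw [e] at this
    have h5 : 0 ≤ δ ^ 2 * w := by positivity
    linarith

/-- **Free response near the band edge** (numerator form): for `μ = -4 + δ` (`0 < δ ≤ 1`), `1 ≤ β ≤ L`,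
`L ≥ 3`, at the source `h = 1/β`:
`log Z(1/β) - log Z(0) ≤ (8/β)·(δ²·(C_F(δ)(1 + log β) + 8) + 4/δ)·L²`, `C_F(δ) = 4(1+κ₀)/δ`: the
coefficient of `log β` is `≤ 32(1+κ₀)·δ → 0` at the band edge. [folklore] -/
theorem free_logGain_edge_le {L : ℕ} [NeZero L] (hL : 3 ≤ L) {δ : ℝ} (hδ : 0 < δ) (hδ1 : δ ≤ 1)
    {β : ℝ} (hβ : 1 ≤ β) (hβL : β ≤ L) :
    Real.log (partitionFn β (dWaveSourceTorus L 0 (-4 + δ) (1 / β))).re -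
        Real.log (partitionFn β (dWaveSourceTorus L 0 (-4 + δ) 0)).re ≤
      (8 / β) * (δ ^ 2 * ((4 + 4 * (2 / Real.log 2 + 2)) / δ * (1 + Real.log β) + 8) + 4 / δ) * (L : ℝ) ^ 2 := by
  have hβpos : 0 < β := by linarith
  have hLpos : (0 : ℝ) < L := by linarith
  set μ : ℝ := -4 + δ with hμ
  set w : TorusSite 2 L → ℝ := fun k => β / (2 + β * |torusBand L k - μ|) with hwdef
  rw [log_partitionFn_dWaveSourceTorus_zero_sub hL β μ (1 / β)]
  -- per-mode: `mode_k ≤ 8 ĝ² w_k / β`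
  have hmode : ∀ k : TorusSite 2 L,
      Real.log ((1 + Real.cosh (β * Real.sqrt ((torusBand L k - μ) ^ 2 +
          (2 * Real.sqrt 2 * (1 / β) * dWaveGap k) ^ 2))) / 2) -
        Real.log ((1 + Real.cosh (β * (torusBand L k - μ))) / 2) ≤ 8 / β * ((dWaveGap k) ^ 2 * w k) := by
    intro k
    refine (bdgModeGain_le hβpos (torusBand L k - μ) (2 * Real.sqrt 2 * (1 / β) * dWaveGap k)).trans (le_of_eq ?_)
    have h2 : Real.sqrt 2 ^ 2 = 2 := Real.sq_sqrt zero_le_two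
    rw [hwdef]
    simp only []
    rw [mul_pow, mul_pow, mul_pow, h2]
    field_simp
    ring
  -- pointwise edge bound and the explicit Cooper logarithm
  have hpt : ∀ k : TorusSite 2 L, (dWaveGap k) ^ 2 * w k ≤ δ ^ 2 * w k + 4 / δ := fun k =>
    dWaveGap_sq_mul_weight_le k hδ hβpos
  have hsumw : ∑ k : TorusSite 2 L, w k ≤
      (4 + 4 * (2 / Real.log 2 + 2)) / δ * (1 + Real.log β) * (L : ℝ) ^ 2 + 8 * β * L := by
    have h1 := sum_fermiWeight_le_explicit hδ μ (by rw [hμ]; linarith) (by rw [hμ]; linarith) hβ L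
    have hlogβ : 0 ≤ Real.log β := Real.log_nonneg hβ
    have hC := fermiWeightConst_le hδ hδ1
    have h2 : (4 / δ + (2 / Real.log 2 + 2) * (4 / (Real.pi * Real.sqrt (δ / 8)))) * (1 + Real.log β) * (L : ℝ) ^ 2 ≤
        (4 + 4 * (2 / Real.log 2 + 2)) / δ * (1 + Real.log β) * (L : ℝ) ^ 2 :=
      mul_le_mul_of_nonneg_right (mul_le_mul_of_nonneg_right hC (by positivity)) (by positivity)
    exact h1.trans (by linarith)
  have hcard : (Finset.univ : Finset (TorusSite 2 L)).card = L ^ 2 := by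
    rw [Finset.card_univ, card_torusSite_two]
  calc ∑ k : TorusSite 2 L, (Real.log ((1 + Real.cosh (β * Real.sqrt ((torusBand L k - μ) ^ 2 +
          (2 * Real.sqrt 2 * (1 / β) * dWaveGap k) ^ 2))) / 2) -
        Real.log ((1 + Real.cosh (β * (torusBand L k - μ))) / 2))
      ≤ ∑ k : TorusSite 2 L, 8 / β * ((dWaveGap k) ^ 2 * w k) := Finset.sum_le_sum fun k _ => hmode k
    _ ≤ ∑ k : TorusSite 2 L, 8 / β * (δ ^ 2 * w k + 4 / δ) :=
        Finset.sum_le_sum fun k _ => mul_le_mul_of_nonneg_left (hpt k) (by positivity)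
    _ = 8 / β * (δ ^ 2 * ∑ k : TorusSite 2 L, w k + 4 / δ * (L : ℝ) ^ 2) := by
        rw [← Finset.mul_sum, Finset.sum_add_distrib, ← Finset.mul_sum, Finset.sum_const, hcard, nsmul_eq_mul]
        push_cast; ring
    _ ≤ 8 / β * (δ ^ 2 * ((4 + 4 * (2 / Real.log 2 + 2)) / δ * (1 + Real.log β) * (L : ℝ) ^ 2 + 8 * β * L) +
          4 / δ * (L : ℝ) ^ 2) := by
        gcongr
    _ ≤ (8 / β) * (δ ^ 2 * ((4 + 4 * (2 / Real.log 2 + 2)) / δ * (1 + Real.log β) + 8) + 4 / δ) * (L : ℝ) ^ 2 := by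
        -- `8βL ≤ 8L²` since `β ≤ L`
        have h1 : 8 * β * (L : ℝ) ≤ 8 * (L : ℝ) ^ 2 := by nlinarith
        have h8 : 0 ≤ 8 / β := by positivity
        have hδ2 : 0 ≤ δ ^ 2 := sq_nonneg δ
        have key : δ ^ 2 * ((4 + 4 * (2 / Real.log 2 + 2)) / δ * (1 + Real.log β) * (L : ℝ) ^ 2 + 8 * β * L) +
            4 / δ * (L : ℝ) ^ 2 ≤
            (δ ^ 2 * ((4 + 4 * (2 / Real.log 2 + 2)) / δ * (1 + Real.log β) + 8) + 4 / δ) * (L : ℝ) ^ 2 := by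
          nlinarith [mul_le_mul_of_nonneg_left h1 hδ2]
        calc 8 / β * (δ ^ 2 * ((4 + 4 * (2 / Real.log 2 + 2)) / δ * (1 + Real.log β) * (L : ℝ) ^ 2 + 8 * β * L) +
              4 / δ * (L : ℝ) ^ 2)
            ≤ 8 / β * ((δ ^ 2 * ((4 + 4 * (2 / Real.log 2 + 2)) / δ * (1 + Real.log β) + 8) + 4 / δ) * (L : ℝ) ^ 2) :=
              mul_le_mul_of_nonneg_left key h8
          _ = _ := by ring

/-- The crux with its constants chosen BEFORE the interval `[μ₁,μ₂]` (i.e. uniformly on `(-4,0)`). -/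
def TwSourcedCondensationUniformMu : Prop :=
  ∃ U₀ a c C h₀ : ℝ, 0 < U₀ ∧ 0 < a ∧ 0 < c ∧ 0 < C ∧ 0 < h₀ ∧
    ∀ μ₁ μ₂ : ℝ, -4 < μ₁ → μ₁ ≤ μ₂ → μ₂ < 0 → ∀ U : ℝ, 0 < U → U ≤ U₀ → ∀ β : ℝ, 1 ≤ β → β ≤ Real.exp (a / U) →
    ∀ μ ∈ Set.Icc μ₁ μ₂, ∃ L₀ : ℕ, ∀ (L : ℕ) [NeZero L], L₀ ≤ L → ∀ h : ℝ, |h| ≤ h₀ →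
      c * h ^ 2 * Real.log (1 / (|h| + 1 / β)) - C * h ^ 2 ≤ pTilde β L U μ h - pTilde β L U μ 0

/-- **The constants cannot be uniform up to the band edge: `¬ TwSourcedCondensationUniformMu`.**
Given `c`, take `δ = min(1, c/(128(1+κ₀)))` and `μ = -4 + δ`: the free response at `h = 1/β` has
`log β`-coefficient `≤ 32(1+κ₀)δ ≤ c/4` (`free_logGain_edge_le`: the `d`-wave form factor vanishes at the
band bottom, `ĝ² ≤ δ²` within `δ` of the Fermi level), the interaction adds `≤ 2U = 2/β²` (`U = 1/β²`,
admissible since `β ≤ e^{aβ²}`), while the floor is `(c(log β - log 2) - C)/β²`: impossible for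
`log β` large. MESSAGE: `c = c(μ₁) ≲ (μ₁ + 4)` necessarily (the truth is `ρ_d(μ₁) ≍ (μ₁+4)²`). [folklore] -/
theorem twSourcedCondensation_false_uniformMu : ¬ TwSourcedCondensationUniformMu := by
  rintro ⟨U₀, a, c, C, h₀, hU₀, ha, hc, hC, hh₀, H⟩
  have hlog2 : 0 < Real.log 2 := Real.log_pos one_lt_two
  set κ₀ : ℝ := 2 / Real.log 2 + 2 with hκ₀
  have hκ₀pos : 0 < κ₀ := by positivity
  set A₁ : ℝ := 32 * (1 + κ₀) with hA₁
  have hA₁pos : 0 < A₁ := by positivity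
  -- the edge distance `δ` and the chemical potential `μ = -4 + δ`
  set δ : ℝ := min 1 (c / (4 * A₁)) with hδdef
  have hδ : 0 < δ := lt_min one_pos (by positivity)
  have hδ1 : δ ≤ 1 := min_le_left _ _
  have hδc : A₁ * δ ≤ c / 4 := by
    have : δ ≤ c / (4 * A₁) := min_le_right _ _
    rw [le_div_iff₀ (by positivity)] at this
    linarith
  set μ : ℝ := -4 + δ with hμ
  have hμ1 : -4 < μ := by rw [hμ]; linarith
  have hμ2 : μ < 0 := by rw [hμ]; linarith
  -- constants of the cap and the target size of `log β`
  set CF : ℝ := (4 + 4 * κ₀) / δ with hCF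
  have hCF0 : 0 ≤ CF := by positivity
  set K₁ : ℝ := 8 * (δ ^ 2 * (CF + 8) + 4 / δ) + 2 with hK₁
  have hK₁nn : 0 ≤ K₁ := by positivity
  set M : ℝ := 4 * (C + c * Real.log 2 + K₁) / (3 * c) with hM
  have hM0 : 0 ≤ M := by positivity
  -- the inverse temperature
  set β : ℝ := max (max (Real.exp (M + 1)) (1 / U₀ + 1)) (max (1 / a + 1) (1 / h₀ + 1)) with hβ
  have hβexpM : Real.exp (M + 1) ≤ β := (le_max_left _ _).trans (le_max_left _ _)
  have hβU₀ : 1 / U₀ + 1 ≤ β := (le_max_right _ _).trans (le_max_left _ _)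
  have hβa : 1 / a + 1 ≤ β := (le_max_left _ _).trans (le_max_right _ _)
  have hβh₀ : 1 / h₀ + 1 ≤ β := (le_max_right _ _).trans (le_max_right _ _)
  have hβ1 : 1 ≤ β := by
    have : 1 ≤ Real.exp (M + 1) := Real.one_le_exp (by linarith)
    linarith
  have hβpos : 0 < β := by linarith
  have hlogβ : M + 1 ≤ Real.log β := by
    rw [← Real.log_exp (M + 1)]; exact Real.log_le_log (Real.exp_pos _) hβexpM
  -- the coupling `U = 1/β²` and the source `h = 1/β`
  set U : ℝ := 1 / β ^ 2 with hU
  have hUpos : 0 < U := by positivity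
  have hUU₀ : U ≤ U₀ := by
    rw [hU, div_le_iff₀ (by positivity)]
    have h1 : 1 / U₀ ≤ β := by linarith
    rw [div_le_iff₀ hU₀] at h1
    nlinarith
  have hβexp : β ≤ Real.exp (a / U) := by
    have e : a / U = a * β ^ 2 := by rw [hU]; field_simp
    rw [e]
    have h1 : 1 / a ≤ β := by linarith
    rw [div_le_iff₀ ha] at h1
    calc β ≤ a * β ^ 2 := by nlinarith
      _ ≤ a * β ^ 2 + 1 := by linarith
      _ ≤ Real.exp (a * β ^ 2) := Real.add_one_le_exp _
  have hh : |1 / β| ≤ h₀ := by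
    rw [abs_of_pos (one_div_pos.2 hβpos), div_le_iff₀ hβpos]
    have h1 : 1 / h₀ ≤ β := by linarith
    rw [div_le_iff₀ hh₀] at h1
    linarith
  obtain ⟨L₀, hL₀⟩ := H μ μ hμ1 le_rfl hμ2 U hUpos hUU₀ β hβ1 hβexp μ ⟨le_rfl, le_rfl⟩
  set L : ℕ := max (max L₀ 3) ⌈β⌉₊ with hLdef
  have hL3 : 3 ≤ L := (le_max_right _ _).trans (le_max_left _ _)
  have hLL₀ : L₀ ≤ L := (le_max_left _ _).trans (le_max_left _ _)
  have hβL : β ≤ (L : ℝ) := (Nat.le_ceil β).trans (by exact_mod_cast le_max_right _ _)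
  haveI : NeZero L := ⟨by omega⟩
  have hLpos : (0 : ℝ) < (L : ℝ) ^ 2 := by positivity
  have hden : 0 < β * (L : ℝ) ^ 2 := mul_pos hβpos hLpos
  have key := hL₀ L hLL₀ (1 / β) hh
  -- the cap: `G_U ≤ G_0 + 2U` and the edge bound on `G_0`
  have hGU := Summit.HubbardSuperconductivity.HubbardSuperconductivity.Theorems.sourcedGain_le_free_add L U μ (1 / β) hβpos
  have hG0 := free_logGain_edge_le hL3 hδ hδ1 hβ1 hβL
  rw [← hκ₀] at hG0
  rw [abs_of_pos hUpos] at hGU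
  -- assemble in units of `1/β²`
  have hfloor : c * (1 / β) ^ 2 * Real.log (1 / (|1 / β| + 1 / β)) - C * (1 / β) ^ 2 =
      (c * (Real.log β - Real.log 2) - C) / β ^ 2 := by
    rw [abs_of_pos (one_div_pos.2 hβpos), show 1 / (1 / β + 1 / β) = β / 2 by field_simp; ring,
      Real.log_div hβpos.ne' two_ne_zero]
    field_simp
  have hG0' : Real.log (partitionFn β (dWaveSourceTorus L 0 μ (1 / β))).re / (β * (L : ℝ) ^ 2) -
      Real.log (partitionFn β (dWaveSourceTorus L 0 μ 0)).re / (β * (L : ℝ) ^ 2) ≤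
      8 * (δ ^ 2 * (CF * (1 + Real.log β) + 8) + 4 / δ) / β ^ 2 := by
    rw [← sub_div, div_le_iff₀ hden]
    refine hG0.trans (le_of_eq ?_)
    rw [hCF]
    field_simp
  change c * (1 / β) ^ 2 * Real.log (1 / (|1 / β| + 1 / β)) - C * (1 / β) ^ 2 ≤
    pTilde β L U μ (1 / β) - pTilde β L U μ 0 at key
  unfold pTilde at key
  rw [hfloor] at key
  have htot : (c * (Real.log β - Real.log 2) - C) / β ^ 2 ≤
      8 * (δ ^ 2 * (CF * (1 + Real.log β) + 8) + 4 / δ) / β ^ 2 + 2 * (1 / β ^ 2) := by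
    have e2 : 2 * U = 2 * (1 / β ^ 2) := by rw [hU]
    linarith [key, hGU, hG0', e2]
  have hβ2 : 0 < β ^ 2 := by positivity
  have htot' : c * (Real.log β - Real.log 2) - C ≤ 8 * (δ ^ 2 * (CF * (1 + Real.log β) + 8) + 4 / δ) + 2 := by
    have e : 8 * (δ ^ 2 * (CF * (1 + Real.log β) + 8) + 4 / δ) / β ^ 2 + 2 * (1 / β ^ 2) =
        (8 * (δ ^ 2 * (CF * (1 + Real.log β) + 8) + 4 / δ) + 2) / β ^ 2 := by
      field_simp
    rw [e, div_le_div_iff_of_pos_right hβ2] at htot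
    exact htot
  -- the `log β` coefficient on the right is `8 δ² CF = 8(4+4κ₀)δ = A₁ δ ≤ c/4`
  have hcoef : 8 * (δ ^ 2 * CF) = A₁ * δ := by
    rw [hCF, hA₁]; field_simp; ring
  have hlogβ0 : 0 ≤ Real.log β := Real.log_nonneg hβ1
  have h1 : 8 * (δ ^ 2 * (CF * (1 + Real.log β) + 8) + 4 / δ) + 2 = A₁ * δ * Real.log β + K₁ := by
    rw [hK₁, ← hcoef]; ring
  rw [h1] at htot'
  have h2 : A₁ * δ * Real.log β ≤ c / 4 * Real.log β := mul_le_mul_of_nonneg_right hδc hlogβ0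
  -- `c log β - c log 2 - C ≤ (c/4) log β + K₁`, but `log β ≥ M + 1`
  have h3 : 3 * c / 4 * Real.log β ≤ C + c * Real.log 2 + K₁ := by linarith
  have hc0 : c ≠ 0 := hc.ne'
  have hM' : 3 * c / 4 * M = C + c * Real.log 2 + K₁ := by
    rw [hM]; field_simp
  have h4 : 3 * c / 4 * (M + 1) ≤ 3 * c / 4 * Real.log β := mul_le_mul_of_nonneg_left hlogβ (by positivity)
  linarith


end BandEdge

/-! ## §5 Why the crux resists disproof (analysis record; no Lean content claimed) -/

section WhyItResists

/-- **Why `TwSourcedCondensation` resists** (record for ideators/provers; the `True` below carries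
no content).

1. SHAPE. By §2 the RHS is `≥ 0`, even, and `≤ 8√2|h|`. The LHS is `≤ h²(c log β - C)`, so the
   inequality bites only for `log β > C/c`, i.e. only along `U → 0`, `β ↗ e^{a/U}`, `|h| ≲ e^{-C/c}`:
   no finite-`β`, finite-`L` computation can refute it (`L₀ = L₀(U,β,μ)` is free), and the only
   decidable torus (`L = 1`, `Δ_d ≡ 0`) is excluded by `∃ L₀` (§4a shows it WOULD refute `∀ L`).
2. FREE PART (`U = 0`). `p̃₀(h) - p̃₀(0) = (2/βL²)Σ_k[log cosh(βE_k/2) - log cosh(βξ_k/2)]`,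
   `E_k² = ξ_k² + 4h²φ_k²`, and `log cosh(βE/2) - log cosh(βξ/2) ≥ (E² - ξ²)β tanh(βE/2)/(4E)` give
   `≥ 2h² L⁻² Σ_k φ_k² tanh(βE_k/2)/E_k ≈ 2ρ_d(μ) h² log(W/max(T,|h|))`, `ρ_d(μ) > 0` on all of
   `(-4,0)` (the Fermi curve never meets the nodal set `{φ = 0}` in a set of positive measure).
   So the claimed shape `c h² log(1/(|h|+T)) - C h²` is exactly right at `U = 0` (planner's audit
   kit j005403, L = 4096: slopes 1.432 vs 1.441).
3. INTERACTION, inside `β ≤ e^{a/U}` (the prover picks `a` small). First order: the on-site `U`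
   does not see the `B₁g` pair channel (`Σ_k φ_k G G` vanishes by `k_x ↔ k_y`), only a Hartree
   shift `μ → μ - Un/2` (relative change `O(U)` of `ρ_d`). Second order: self-energy
   `Z = 1 - O(U²)`, `O(U² log β) = O(aU)`; Kohn–Luttinger vertex `Γ_d = O(U²)` of EITHER sign
   changes `χ_d` by the relative amount `|Γ_d| χ_d⁰ ≲ U² ρ_d log β ≤ a U ρ_d → 0`. Hence
   `χ_d(β,U,μ) = 2ρ_d log β (1 + O(a)) + O(1)` order by order: NO perturbative sign obstruction,
   whatever the leading KL channel at the given filling (the regime where a repulsive `Γ_d` could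
   win, `U² log β ≳ 1`, is excluded by the ceiling `β ≤ e^{a/U}` — this is exactly
   `Literature.Barriers.HubbardSuperconductivity.WeakCouplingCeiling`, used as engine).
4. WHAT IS LEFT is non-perturbative control: convergence of the sourced BGM expansion at
   `μ_BGM ≥ (2-√2)/2` (umklapp with ≤ 4 quasi-particles, BGM 2006 p. 3; Rem. 2 p. 4 expects it with
   `U₀(μ) → 0` at half filling — consistent with the crux's `U₀ = U₀(μ₂)`). A Gibbs-variational
   shortcut fails quantitatively: it leaves an `h`-independent `O(U²)` slack while the gain used by
   the route at `|h| = e^{-a/(4U)}` is `c h² log(1/h) ~ (a/4U) e^{-a/(2U)} ≪ U²`.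
5. REDUCTIONS ON RECORD: the planner's kernel-checked Staircase reduction (evidence
   `StaircaseProof.lean`) shows the crux follows from the LINEAR regime `|h| ≤ 1/β` plus a
   `T²` specific-heat bound — the "source as second infrared cutoff" regime is not needed.
   By §4e here a prover may in addition take `h > 0`, drop `U₀`, `h₀`.
6. GEN 3: the exact free BdG pressure is now in the tree; it makes the finite-size threshold analysis
   unconditional (§8) but gives NO handle on the crux itself: every free lower bound is on the crux's
   side (the free gas SATISFIES the crux, kit j005403/j007577), and the only interacting comparison
   available without the constructive expansion, `|p̃_U - p̃_0| ≤ U`, is `h`-independent and therefore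
   useless below `h² ≲ U/log β` — exactly the window where the crux has content (cf. the planner's
   `why it might fail`). The lead's line (entropy staircase) isolates that content in `stub_sourceSlack`.
VERDICT (gen 3): resists; true-but-constructive. [folklore] -/
theorem whyItResists : True := trivial

end WhyItResists

end Summit.HubbardSuperconductivity.HubbardSuperconductivity.Cruxes.TwSourcedCondensation.Disproof
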